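import Literature.Geometry.Riemannian.VolumeSphereTheoremProofs
import Mathlib.MeasureTheory.Integral.IntervalIntegral.FundThmCalculus
import Mathlib.Analysis.Matrix.Spectrum
import Mathlib.Analysis.InnerProductSpace.Projection.FiniteDimensional
import Mathlib.LinearAlgebra.Alternating.Basic
import Mathlib.Topology.Instances.Matrix
import HarnessLib

/-!
# Principal-curvature estimates for geodesic spheres of asymptotically hyperbolic manifolds:
# the Riccati layer of Li–Qing–Shi 2017, §6

Support file (everything PROVED; no definitions, no named facts, D-0026) for the named fact
`Literature.Geometry.Riemannian.liQingShi_pinching_five` (`LiQingShiPinching.lean`; G. Li,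
J. Qing, Y. Shi, Trans. AMS 369 (2017), Thm. 1.8 at `n = 5`). The printed proof of Thm. 1.8
(arXiv:1410.6402, pp. 12–13) rests on the relative volume inequality Thm. 1.5, whose lower bound
is proved in §§5–6 of the paper; §6 ("Estimates of the total scalar curvature") is an analysis
of the Riccati equation (6.1) `∇_{∇t} S + S² = -R_{∇t}` for the shape operator `S = ∇²t` of the
geodesic spheres `Γ_t` along minimal geodesics of an AH manifold whose curvature satisfies the
decay (1.9) `|K + 1| ≤ C₀ x²` (`x ∼ e^{-t}`), i.e. (6.2)
`1 - C₀e^{-2t} ≤ μ' + μ² ≤ 1 + C₀e^{-2t}` "for the principal curvature `μ`". This file proves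
the ONE-VARIABLE and MATRIX content of §6.1–§6.3, in the conventions of the Jacobi-tensor layer
of `VolumeSphereTheoremProofs.lean`, §8 (in a parallel orthonormal frame of `γ'^⊥` the shape
operator is the symmetric matrix curve `𝒰 = 𝒜'𝒜⁻¹` with `𝒰' = -ℛ - 𝒰²`,
`hasDerivAt_shape_riccati`; `ℛ(t) = R(·, γ')γ'`, `⟨ℛ v, v⟩/|v|² = K(v, γ')`; the Jacobi
determinant `𝒥 = det 𝒜` has `𝒥' = H𝒥`, `H = tr 𝒰`, `hasDerivAt_det_jacobi`), so that only the
identification of `S` along `γ` with `𝒰` and the polar-coordinate formula separate these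
statements from the printed ones. The principal curvatures `μ_m ≤ μ ≤ μ_M` enter through the
Rayleigh quotient `⟨𝒰 v, v⟩/|v|²` (its extrema), which is how the non-smooth functions
`μ_m(t)`, `μ_M(t)` of the paper are handled rigorously: upper bounds are proved for EVERY
direction `v` (the quotient in a fixed parallel direction is a genuine sub-solution,
`rayleigh_riccati_le`), lower barriers by a first-violation argument over the compact set
`[s, T] × {|v| = 1}` at whose minimal-time violation the direction is an eigenvector.

§A. ONE-VARIABLE LEMMAS (differentiable `μ` on a closed interval, `HasDerivAt`):
* `sub_one_le_of_riccati_le`, `le_one_add_of_riccati_le` — **Cor. 6.2** (sharp upper bound):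
  `μ' + μ² ≤ 1 + C₀e^{-2s}` on `[t₀, t]` ⇒ `μ(t) - 1 ≤ (e^{2t₀}(μ(t₀) - 1) + C₀(t - t₀))e^{-2t}`,
  hence `μ(t) ≤ 1 + C(t + 1)e^{-2t}` with `C = max(e^{2t₀}(K - 1), C₀)` when `μ(t₀) ≤ K`
  (the printed proof: `z = μ - 1`, `z' + 2z ≤ C₀e^{-2s}`);
* `riccati_blowdown`, `neg_coth_lt_of_riccati_le`, `neg_le_of_riccati_le_Ici` — **Prop. 6.3 and
  Lemma 6.6** (no lower bound in general, but existence of the solution bounds `μ` below):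
  `μ' ≤ a² - μ²`, `μ(s₀) < -a` ⇒ `χe^{2a(s-s₀)} ≤ (μ + a)/(μ - a) < 1` with
  `χ = (μ(s₀) + a)/(μ(s₀) - a)` (the printed comparison with `-a(1 + χe^{2a(s-s₀)})/(1 - χe^{2a(s-s₀)})`);
  so a sub-solution existing on `[s₀, s₀ + L]` has `μ(s₀) > -a coth(aL)` (Lemma 6.6 with the
  explicit constant; `L = 1` in the paper) and one existing on `[s₀, ∞)` has `μ(s₀) ≥ -a`
  (Prop. 6.3);
* `le_of_riccati_ge_barrier` — **Lemma 6.4** (lower barrier): `μ' + μ² ≥ b²`, `|β| < b`,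
  `μ(s) ≥ β` ⇒ `μ ≥ β` on `[s, T]`;
* `le_mul_exp_of_deriv_eq_mul` — **Prop. 6.5** (6.13)–(6.15): `𝒥' = H𝒥`, `𝒥 ≥ 0`, `H ≤ K` ⇒
  `𝒥(t) ≤ 𝒥(t₀)e^{K(t-t₀)}`;
* `exp_mul_sub_integral_le_of_deriv_ge` — **Prop. 6.7**, (6.19) ⇒ (6.20): `F' ≥ kF - C𝒥` ⇒
  `F(t₂) ≥ e^{k(t₂-t₁)}F(t₁) - Ce^{kt₂}∫_{t₁}^{t₂} e^{-ks}𝒥`.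

§B. MATRIX FORM (symmetric `𝒰 : ℝ → Matrix ι ι ℝ` with `𝒰' = -ℛ(t) - 𝒰²` on a closed interval,
pinching of the quadratic form of `ℛ`): `rayleigh_riccati_le` (the quotient in a fixed
direction satisfies `φ' + φ² ≤ -⟨ℛv, v⟩/|v|²`), `rayleigh_sub_one_le` / `rayleigh_le_one_add`
(**Cor. 6.2** for every direction, hence for `μ_M`), `neg_coth_lt_rayleigh` (**Lemma 6.6**:
existence on `[s₀, s₀ + L]` ⇒ `μ_m(s₀) > -a coth(aL)`, `a² ≥ sup(-K)`), `neg_le_rayleigh_of_Ici`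
(**Prop. 6.3**), `rayleigh_barrier` / `rayleigh_barrier'` (**Lemma 6.4** for `μ_m`: `K ≤ -b²`,
`|β| < b`, `μ_m(s) > β` ⇒ `μ_m(t) > β` on `[s, T]`), with the elementary linear algebra it needs
(`mulVec_eq_smul_of_rayleigh_min`: a minimiser of the Rayleigh quotient is an eigenvector;
`isCompact_dotProduct_self_eq_one`).

§C. **Prop. 6.7**, the pointwise step "`(Δt)² - |∇²t|² = Σ_{i≠j} μᵢμⱼ ≥ 2(n-1)²μ_m`,
`μ_m ≥ H - C`": `sq_sum_sub_sum_sq_ge` (finite sums), `sq_trace_sub_trace_mul_self_ge`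
(`(tr 𝒰)² - tr 𝒰² ≥ (#ι)² μ_M μ_m` for symmetric `𝒰` with quotient in `[μ_m, μ_M]`,
`μ_m ≤ 0 ≤ μ_M`, by the spectral theorem: `trace_mul_self_eq_sum_eigenvalues_sq`,
`eigenvalues_mem_Icc_of_rayleigh`), `trace_sub_le_eigenvalues` (`μ_m ≥ H - (#ι - 1)μ_M`).

§D. ALONG THE JACOBI TENSOR (`𝒜'' + ℛ𝒜 = 0`, `𝒜(0) = 0`, `𝒜'(0) = I`, `det 𝒜 ≠ 0`):
`hasDerivAt_trace_mul_det` (**(6.16)** `(H𝒥)' = (-tr ℛ - tr 𝒰² + H²)𝒥`), `deriv_trace_mul_det_ge`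
(**(6.19)**, pointwise), `det_le_det_mul_exp` (**Prop. 6.5** for `𝒥 = det 𝒜`), `trace_mul_det_ge`
(**(6.20)** for `F = H𝒥`), and `rayleigh_shape_le_coth` — the HESSIAN COMPARISON in every
direction, `⟨𝒰(t)v, v⟩/|v|² ≤ a coth(at)` on `(0, b)` under `K ≥ -a²` (the quotient is a
sub-solution of `u' + u² = a²` with `u ∼ 1/t`, `jacobi_tendsto_shape_sub_inv_smul_one`, compared
by `riccati_comparison`), which supplies along each geodesic the bound `μ_M(t₀) ≤ a coth(at₀)`
that Lemma 6.1 provides in the paper as the input `K` of Cor. 6.2.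

§E. THE ANGLE `φ = g⁺(∇t, ∇r)` (**Lemma 4.1–4.2**, (4.5)–(4.6), the input of the Lipschitz
bound `|du| ≤ C` of Thm. 1.5's proof): `le_mul_exp_sub_of_deriv_le` (Grönwall with a
differentiable exponent), `pos_of_deriv_eq_one_sub_sq_mul` (Lemma 4.2: `φ' = (1 - φ²)h`, `h > 0`,
`φ(t₀) ≥ 0` ⇒ `φ > 0` after `t₀`), `one_sub_le_of_deriv_eq_one_sub_sq_mul` ((4.5):
`0 ≤ φ ≤ 1`, `h ≥ 1/2`, `|h - 1| ≤ Ce^{-2s}` ⇒ `1 - φ(t) ≤ (1 - φ(t₀))e^{3C+2}e^{-2(t-t₀)}`).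

§F. THE PRINTED STATEMENTS, matrix form, for an abstract symmetric solution `𝒰` on `[t_δ, T]`
with a Jacobi determinant `𝒥 > 0`, `𝒥' = H𝒥`: `trace_le_card_sub_of_barrier` (**Lemma 6.4**:
`K ≤ -(1-δ/2)²`, `μ_M ≤ M`, `(m-1)(M-1) ≤ δ/4`, a direction with quotient `≤ 1 - 3δ/4` at time
`T` ⇒ `H ≤ m - δ/4` on `[t_δ, T]`), `jacobian_le_of_barrier` (**Prop. 6.5** (6.15)),
`trace_mul_jacobian_ge` (**Prop. 6.7** (6.17): `H(t) ≤ -2m` ⇒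
`H𝒥(t) ≥ -𝒥(t_δ)e^{m²M}(m a coth a + m²(m-1)M²) e^{(m-δ/4)(t-1-t_δ)}`), with the linear
algebra they consume (`mul_dotProduct_le_of_eigenvalues_ge`: the least eigenvalue bounds the
quotient from below; `trace_sub_mul_dotProduct_le`: `μ_m ≥ H - (m-1)μ_M`;
`card_mul_lt_trace_of_rayleigh_gt`: `H > mβ` if all quotients exceed `β`;
`exists_unit_card_mul_rayleigh_le_trace`: `μ_m ≤ H/m`; `card_mul_le_neg_trace`:
`-tr ℛ ≥ m·min(-K)`), and their inputs along the Jacobi tensor: `rayleigh_shape_le_one_add`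
(**Cor. 6.2** along one geodesic with `μ_M(t₀) ≤ a coth(at₀)`, `a = √(1 + C₀)`, in place of
Lemma 6.1) and `exists_tδ` (the choice of `t_δ`, via `(t+1)e^{-2t} ≤ 1/(2t)`).

§G. `tendsto_exp_div_two_pow_div_sinh_pow` (**(4.13)**: `(e^t/2)^m/sinh^m t → 1`) and
`rpow_div_yamabeSphere_le` (the arithmetic "Lemma 4.4 ⇒ Thm. 1.5": dividing
`(Y/(m(m-1)))^{m/2} ≤ V₀` by `ω_m = (ω_m^{2/m})^{m/2}`).

§H. `alternatingMap_cons_eq_inner_mul` (**(6.10)–(6.11)**, pointwise: for an alternating top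
form `Ω` and a unit vector `ν'`, `Ω(ν, v₁..v_m) = ⟨ν, ν'⟩ Ω(ν', v₁..v_m)` whenever `vᵢ ⊥ ν'` —
`dv(∇t)|_{(∇r)^⊥} = g⁺(∇t, ∇r) dv(∇r)|_{(∇r)^⊥}`) and `twelve_mul_sqrt_vol_sphere_four`
(`12 (8π²/3)^{1/2} = 8√6π`, the constant of Lemma 4.4 / `Y(S⁴)` at `n = 5`).

§I. POLAR DATA around Thm. 1.5: `div_le_integral_div_integral_of_cross` (the middle
inequality of (1.7), area ratio `≤` volume ratio, from the cross inequality of Bishop's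
monotonicity), `le_of_antitoneOn_Ioi_of_tendsto` / `le_of_antitoneOn_Ioi_of_eventually_ge` (the
lower bound of (1.7) at every `t` from its limit `t → ∞` and the monotonicity of the area ratio),
`setIntegral_exp_neg_mul_jacobian_le` (**Prop. 6.5**, second half of (6.15): the normalised area
of the directions hitting `U^δ_r` is `≤ e^{-(m-ε)t_δ}e^{-ε(r-C)} ∫ 𝒥(t_δ)`),
`setIntegral_exp_neg_mul_trace_jacobian_ge` (**Prop. 6.7** integrated: the third integral of
Thm. 6.8 is `≥ -B e^{-(m-ε)(1+t_δ)}e^{-ε(r-C)} ∫ 𝒥(t_δ)`).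

§J. RIGIDITY (the equality cases behind **Thm. 1.7** and **Steps 1–2 of Thm. 1.8**):
`jacobi_rigidity_sinh` (`det 𝒜 ≡ sinh^{n-1}` with `Ric ≥ -(n-1)` along one geodesic ⇒
`𝒰 ≡ coth t · I`, `ℛ ≡ -I`, `𝒜 ≡ sinh t · I`) and `jacobi_rigidity_flat` (`det 𝒜 ≡ t^{n-1}`
with `Ric ≥ 0` ⇒ `𝒰 ≡ t⁻¹I`, `ℛ ≡ 0`, `𝒜 ≡ tI`), through equality in the Cauchy–Schwarz
trace step (`eq_smul_one_of_sq_trace_eq`, `eq_zero_of_trace_transpose_mul_self_eq_zero`).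

§K. FROM THE RAW DECAY: `exists_T₀_of_pinching`, `shape_hypotheses_of_pinching`,
`det_le_of_pinching` (**Prop. 6.5**) and `trace_mul_det_ge_of_pinching` (**Prop. 6.7** (6.17)) take
only a Jacobi tensor with the two-sided decay `(1 ∓ C₀e^{-2t})|v|² ≶ -⟨ℛv, v⟩` on `(0, c)` and a
time `T₀ ≥ 1` from which the two `t_δ`-conditions hold, and deliver the printed conclusions with
every constant explicit in `n`, `δ`, `C₀`, `det 𝒜(T₀)` — the one-call form for the manifold layer.

What is NOT here (geometry): Lemma 6.1 itself (a compactness statement on `Γ_{t₀} ∖ C_p`), the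
identification of `∇²t` along minimal geodesics with `𝒰`, the cut locus and the sets `U^δ_r`,
the volume forms (6.10)–(6.12) and Thm. 6.8; and §5 (normal cut loci). Those belong to the
manifold layer of the eventual discharge of Thm. 1.5.

## References

* G. Li, J. Qing, Y. Shi, *Gap phenomena and curvature estimates for conformally compact Einstein
  manifolds*, Trans. Amer. Math. Soc. 369 (2017) 4385–4413, arXiv:1410.6402: Lemma 1.6 (1.9),
  §4 (Lemma 4.1 (4.4)–(4.6), Lemma 4.2, Lemma 4.4, (4.13)), Thm. 1.5 (proof, p. 13),
  §6.1 ((6.1)–(6.2), Lemma 6.1, Cor. 6.2 (6.5), Prop. 6.3), §6.2 ((6.13), Lemma 6.4, Prop. 6.5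
  (6.15), (6.10)–(6.12)), §6.3 ((6.16)–(6.17), Lemma 6.6, Prop. 6.7 (6.19)–(6.20), Thm. 6.8).
  Thm. 1.7, Thm. 1.8 (proof, Steps 1–2, pp. 12–13). [LiQingShi2017]
* I. Chavel, *Riemannian Geometry: A Modern Introduction*, 2nd ed., CUP 2006, §III.4 (the
  Jacobi tensor `𝒜`, `𝒰 = 𝒜'𝒜⁻¹`, (III.4.16)). [Chavel2006]
-/

noncomputable section

namespace Literature.Geometry.Riemannian

namespace AHRiccati

open Set Filter Topology Matrix

/-! ### §A. One-variable Riccati lemmas (Li–Qing–Shi 2017, §6.1–§6.3, scalar content) -/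

section Scalar

/-- `d/dx e^{cx} = c e^{cx}`, in the form used below. [folklore] -/
theorem hasDerivAt_exp_const_mul (c s : ℝ) :
    HasDerivAt (fun x ↦ Real.exp (c * x)) (Real.exp (c * s) * c) s := by
  have h := ((hasDerivAt_id' s).const_mul c).exp
  simp only [mul_one] at h
  exact h

/-- `e^{cx} e^{-cx} = 1`. [folklore] -/
theorem exp_mul_exp_neg_mul (c s : ℝ) : Real.exp (c * s) * Real.exp (-c * s) = 1 := by
  rw [← Real.exp_add]; simp

/-- **Cor. 6.2, one-variable content (the "sink" `μ = 1` of `μ' + μ² = 1`).** If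
`μ' + μ² ≤ 1 + C₀ e^{-2s}` on `[t₀, t]`, then
`μ(t) - 1 ≤ (e^{2t₀}(μ(t₀) - 1) + C₀ (t - t₀)) e^{-2t}`: with `z = μ - 1`,
`z' + 2z ≤ C₀e^{-2s} - z² ≤ C₀ e^{-2s}`, i.e. `(e^{2s} z)' ≤ C₀` (Li–Qing–Shi 2017, proof of
Cor. 6.2). [cite: LiQingShi2017, Cor. 6.2 (proof)] -/
theorem sub_one_le_of_riccati_le {μ μ' : ℝ → ℝ} {t₀ t C₀ : ℝ} (ht : t₀ ≤ t)
    (hμ : ∀ s ∈ Icc t₀ t, HasDerivAt μ (μ' s) s)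
    (hric : ∀ s ∈ Icc t₀ t, μ' s + μ s ^ 2 ≤ 1 + C₀ * Real.exp (-2 * s)) :
    μ t - 1 ≤ (Real.exp (2 * t₀) * (μ t₀ - 1) + C₀ * (t - t₀)) * Real.exp (-2 * t) := by
  set G : ℝ → ℝ := fun s ↦ Real.exp (2 * s) * (μ s - 1) - C₀ * s with hG_def
  have hG : ∀ s ∈ Icc t₀ t, HasDerivAt G
      (Real.exp (2 * s) * 2 * (μ s - 1) + Real.exp (2 * s) * μ' s - C₀ * 1) s :=
    fun s hs ↦ ((hasDerivAt_exp_const_mul 2 s).mul ((hμ s hs).sub_const 1)).sub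
      ((hasDerivAt_id' s).const_mul C₀)
  have hG'le : ∀ s ∈ Icc t₀ t,
      Real.exp (2 * s) * 2 * (μ s - 1) + Real.exp (2 * s) * μ' s - C₀ * 1 ≤ 0 := by
    intro s hs
    have hexp : 0 < Real.exp (2 * s) := Real.exp_pos _
    have hee : Real.exp (2 * s) * Real.exp (-2 * s) = 1 := exp_mul_exp_neg_mul 2 s
    have h1 := hric s hs
    have h2 : Real.exp (2 * s) * (μ' s + μ s ^ 2) ≤ Real.exp (2 * s) * 1 + C₀ := by
      have := mul_le_mul_of_nonneg_left h1 hexp.le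
      calc Real.exp (2 * s) * (μ' s + μ s ^ 2)
          ≤ Real.exp (2 * s) * (1 + C₀ * Real.exp (-2 * s)) := this
        _ = Real.exp (2 * s) * 1 + C₀ := by
          rw [mul_add, mul_left_comm, hee]; ring
    nlinarith [mul_nonneg hexp.le (sq_nonneg (μ s - 1))]
  have hanti : AntitoneOn G (Icc t₀ t) := by
    refine antitoneOn_of_hasDerivWithinAt_nonpos (convex_Icc t₀ t)
      (f' := fun s ↦ Real.exp (2 * s) * 2 * (μ s - 1) + Real.exp (2 * s) * μ' s - C₀ * 1)
      (fun s hs ↦ (hG s hs).continuousAt.continuousWithinAt) (fun s hs ↦ ?_) (fun s hs ↦ ?_)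
    · rw [interior_Icc] at hs
      exact (hG s (Ioo_subset_Icc_self hs)).hasDerivWithinAt
    · rw [interior_Icc] at hs
      exact hG'le s (Ioo_subset_Icc_self hs)
  have hGt : G t ≤ G t₀ := hanti (left_mem_Icc.2 ht) (right_mem_Icc.2 ht) ht
  simp only [hG_def] at hGt
  have hexp : 0 < Real.exp (-2 * t) := Real.exp_pos _
  have hee : Real.exp (2 * t) * Real.exp (-2 * t) = 1 := exp_mul_exp_neg_mul 2 t
  have hrw : μ t - 1 = Real.exp (2 * t) * (μ t - 1) * Real.exp (-2 * t) := by
    rw [mul_comm (Real.exp (2 * t)), mul_assoc, hee, mul_one]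
  rw [hrw]
  exact mul_le_mul_of_nonneg_right (by linarith) hexp.le

/-- **Cor. 6.2 in the printed form `μ ≤ 1 + C (t + 1) e^{-2t}`**: if `μ' + μ² ≤ 1 + C₀e^{-2s}` on
`[t₀, t]` with `0 ≤ t₀`, `0 ≤ C₀` and `μ(t₀) ≤ K`, then `μ(t) ≤ 1 + C (t + 1) e^{-2t}` with the
explicit constant `C = max (e^{2t₀} (K - 1)) C₀` (depending only on `t₀`, `K`, `C₀`).
[cite: LiQingShi2017, Cor. 6.2] -/
theorem le_one_add_of_riccati_le {μ μ' : ℝ → ℝ} {t₀ t C₀ K : ℝ} (ht₀ : 0 ≤ t₀) (ht : t₀ ≤ t)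
    (hC₀ : 0 ≤ C₀) (hμ : ∀ s ∈ Icc t₀ t, HasDerivAt μ (μ' s) s)
    (hric : ∀ s ∈ Icc t₀ t, μ' s + μ s ^ 2 ≤ 1 + C₀ * Real.exp (-2 * s)) (hK : μ t₀ ≤ K) :
    μ t ≤ 1 + max (Real.exp (2 * t₀) * (K - 1)) C₀ * (t + 1) * Real.exp (-2 * t) := by
  have h := sub_one_le_of_riccati_le ht hμ hric
  set M := max (Real.exp (2 * t₀) * (K - 1)) C₀
  have hexp : 0 < Real.exp (-2 * t) := Real.exp_pos _
  have h1 : Real.exp (2 * t₀) * (μ t₀ - 1) ≤ M :=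
    le_trans (mul_le_mul_of_nonneg_left (by linarith) (Real.exp_pos _).le) (le_max_left _ _)
  have hMC : C₀ ≤ M := le_max_right _ _
  have h2 : C₀ * (t - t₀) ≤ M * t := by
    have ht' : 0 ≤ t := ht₀.trans ht
    nlinarith
  have h3 : (Real.exp (2 * t₀) * (μ t₀ - 1) + C₀ * (t - t₀)) * Real.exp (-2 * t)
      ≤ M * (t + 1) * Real.exp (-2 * t) := by
    apply mul_le_mul_of_nonneg_right _ hexp.le
    nlinarith
  linarith

/-- **A sub-solution of `μ' = a² - μ²` starting below `-a` stays below its initial value**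
(hence below `-a`): the first half of the blow-down argument of Li–Qing–Shi 2017, Prop. 6.3 and
Lemma 6.6 (`μ' ≤ a² - μ² < 0` while `μ < -a`). [cite: LiQingShi2017, Prop. 6.3 and Lemma 6.6 (proofs)] -/
theorem le_init_of_riccati_le_of_lt_neg {μ μ' : ℝ → ℝ} {s₀ s₁ a : ℝ}
    (hμ : ∀ s ∈ Icc s₀ s₁, HasDerivAt μ (μ' s) s)
    (hric : ∀ s ∈ Icc s₀ s₁, μ' s ≤ a ^ 2 - μ s ^ 2) (h0 : μ s₀ < -a) (ha : 0 < a) :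
    ∀ s ∈ Icc s₀ s₁, μ s ≤ μ s₀ := by
  intro s hs
  have hcont : ContinuousOn μ (Icc s₀ s₁) :=
    fun x hx ↦ (hμ x hx).continuousAt.continuousWithinAt
  refine image_le_of_deriv_right_lt_deriv_boundary' (f := μ) (f' := μ') (a := s₀) (b := s₁)
    hcont (fun x hx ↦ (hμ x (Ico_subset_Icc_self hx)).hasDerivWithinAt) (B := fun _ ↦ μ s₀)
    (B' := fun _ ↦ 0) le_rfl continuousOn_const (fun x _ ↦ hasDerivWithinAt_const _ _ _)
    (fun x hx hxB ↦ ?_) hs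
  have h1 := hric x (Ico_subset_Icc_self hx)
  rw [hxB] at h1
  have : a ^ 2 < μ s₀ ^ 2 := by nlinarith
  show μ' x < 0
  linarith

/-- **The blow-down comparison** (Li–Qing–Shi 2017, proof of Lemma 6.6): if `μ' ≤ a² - μ²` on
`[s₀, s₁]`, `a > 0` and `μ(s₀) < -a`, then with `χ = (μ(s₀) + a)/(μ(s₀) - a) ∈ (0, 1)` one has
`χ e^{2a(s - s₀)} ≤ (μ(s) + a)/(μ(s) - a) < 1` on `[s₀, s₁]` — the printed comparison
"`μ(s) ≤ -a (1 + χ e^{2a(s-s₀)})/(1 - χ e^{2a(s-s₀)})`" in the form which does not mention the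
blow-up time: the ratio `ρ = (μ + a)/(μ - a)` satisfies `ρ' ≥ 2aρ`.
[cite: LiQingShi2017, Lemma 6.6 (proof)] -/
theorem riccati_blowdown {μ μ' : ℝ → ℝ} {s₀ s₁ a : ℝ} (ha : 0 < a)
    (hμ : ∀ s ∈ Icc s₀ s₁, HasDerivAt μ (μ' s) s)
    (hric : ∀ s ∈ Icc s₀ s₁, μ' s ≤ a ^ 2 - μ s ^ 2) (h0 : μ s₀ < -a) :
    ∀ s ∈ Icc s₀ s₁, μ s < -a ∧
      (μ s₀ + a) / (μ s₀ - a) * Real.exp (2 * a * (s - s₀)) ≤ (μ s + a) / (μ s - a) := by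
  have hlt : ∀ s ∈ Icc s₀ s₁, μ s < -a :=
    fun s hs ↦ (le_init_of_riccati_le_of_lt_neg hμ hric h0 ha s hs).trans_lt h0
  have hne : ∀ s ∈ Icc s₀ s₁, μ s - a ≠ 0 := fun s hs ↦ by linarith [hlt s hs]
  -- `ρ = (μ + a)/(μ - a)` and `G = e^{-2as} ρ` is monotone
  set G : ℝ → ℝ := fun s ↦ Real.exp (-2 * a * s) * ((μ s + a) / (μ s - a)) with hG_def
  set G' : ℝ → ℝ := fun s ↦ Real.exp (-2 * a * s) * (-2 * a) * ((μ s + a) / (μ s - a)) +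
    Real.exp (-2 * a * s) * ((μ' s * (μ s - a) - (μ s + a) * μ' s) / (μ s - a) ^ 2) with hG'_def
  have hG : ∀ s ∈ Icc s₀ s₁, HasDerivAt G (G' s) s := fun s hs ↦
    (hasDerivAt_exp_const_mul (-2 * a) s).mul
      (((hμ s hs).add_const a).div ((hμ s hs).sub_const a) (hne s hs))
  have hG'nn : ∀ s ∈ Icc s₀ s₁, 0 ≤ G' s := by
    intro s hs
    have key : G' s =
        Real.exp (-2 * a * s) * ((-2 * a) / (μ s - a) ^ 2 * (μ' s + μ s ^ 2 - a ^ 2)) := by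
      simp only [hG'_def]
      field_simp [hne s hs]
      ring
    rw [key]
    refine mul_nonneg (Real.exp_pos _).le (mul_nonneg_of_nonpos_of_nonpos ?_ ?_)
    · exact div_nonpos_of_nonpos_of_nonneg (by linarith) (sq_nonneg _)
    · linarith [hric s hs]
  have hmono : MonotoneOn G (Icc s₀ s₁) := by
    refine monotoneOn_of_hasDerivWithinAt_nonneg (convex_Icc s₀ s₁) (f' := G')
      (fun s hs ↦ (hG s hs).continuousAt.continuousWithinAt) (fun s hs ↦ ?_) (fun s hs ↦ ?_)
    · rw [interior_Icc] at hs
      exact (hG s (Ioo_subset_Icc_self hs)).hasDerivWithinAt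
    · rw [interior_Icc] at hs
      exact hG'nn s (Ioo_subset_Icc_self hs)
  intro s hs
  refine ⟨hlt s hs, ?_⟩
  have key := hmono (left_mem_Icc.2 (hs.1.trans hs.2)) hs hs.1
  simp only [hG_def] at key
  -- `e^{-2as₀} ρ(s₀) ≤ e^{-2as} ρ(s)`; multiply by `e^{2as}`
  have hexp : 0 < Real.exp (2 * a * s) := Real.exp_pos _
  have h1 : Real.exp (2 * a * s) * Real.exp (-2 * a * s) = 1 := by
    rw [← Real.exp_add, ← Real.exp_zero]; congr 1; ring
  have h2 : Real.exp (2 * a * s) * Real.exp (-2 * a * s₀) = Real.exp (2 * a * (s - s₀)) := by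
    rw [← Real.exp_add]; congr 1; ring
  have key2 := mul_le_mul_of_nonneg_left key hexp.le
  rw [← mul_assoc, ← mul_assoc, h1, one_mul, h2, mul_comm] at key2
  exact key2

/-- **Lemma 6.6, one-variable content, with the explicit constant**: a sub-solution of
`μ' = a² - μ²` (`a > 0`) which exists (as a differentiable function) on `[s₀, s₀ + L]`, `L > 0`,
satisfies `μ(s₀) > -a (1 + e^{-2aL})/(1 - e^{-2aL}) = -a coth(aL)`: otherwise the blow-up time
`s₀ - log χ/(2a)` of the comparison solution would fall in the interval (Li–Qing–Shi 2017, proof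
of Lemma 6.6: "`-(1/2a) log χ < 1` when `μ(t-1)` is sufficiently negative, which implies, there is
a constant `C = C(t₀)` such that `μ_m(γ(t-1)) > -C`"; there `L = 1`, `a² = 1 + C₀e^{-2s₀}`).
[cite: LiQingShi2017, Lemma 6.6] -/
theorem neg_coth_lt_of_riccati_le {μ μ' : ℝ → ℝ} {s₀ L a : ℝ} (ha : 0 < a) (hL : 0 < L)
    (hμ : ∀ s ∈ Icc s₀ (s₀ + L), HasDerivAt μ (μ' s) s)
    (hric : ∀ s ∈ Icc s₀ (s₀ + L), μ' s ≤ a ^ 2 - μ s ^ 2) :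
    -(a * (1 + Real.exp (-2 * a * L)) / (1 - Real.exp (-2 * a * L))) < μ s₀ := by
  set q := Real.exp (-2 * a * L) with hq
  have hq0 : 0 < q := Real.exp_pos _
  have hq1 : q < 1 := by
    rw [hq]; apply Real.exp_lt_one_iff.2; nlinarith
  have h1q : 0 < 1 - q := by linarith
  rw [neg_lt, lt_div_iff₀ h1q]
  by_cases h0 : -a ≤ μ s₀
  · -- trivial case: `-a coth(aL) < -a ≤ μ(s₀)`
    nlinarith
  push Not at h0
  have hsL : s₀ + L ∈ Icc s₀ (s₀ + L) := right_mem_Icc.2 (by linarith)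
  obtain ⟨hlt, hcmp⟩ := riccati_blowdown ha hμ hric h0 (s₀ + L) hsL
  have hden0 : μ s₀ - a < 0 := by linarith
  have hden1 : μ (s₀ + L) - a < 0 := by linarith
  -- `ρ(s₀ + L) < 1`
  have hρ1 : (μ (s₀ + L) + a) / (μ (s₀ + L) - a) < 1 := by
    rw [div_lt_one_of_neg hden1]; linarith
  have hE : Real.exp (2 * a * (s₀ + L - s₀)) = q⁻¹ := by
    rw [hq, ← Real.exp_neg]; congr 1; ring
  rw [hE] at hcmp
  -- `χ / q < 1`, i.e. `χ < q`
  have hχ : (μ s₀ + a) / (μ s₀ - a) < q := by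
    have := hcmp.trans_lt hρ1
    rwa [← div_eq_mul_inv, div_lt_one hq0] at this
  rw [div_lt_iff_of_neg hden0] at hχ
  nlinarith

/-- **Prop. 6.3, one-variable content (the "source" `μ = -1`):** a sub-solution of `μ' = a² - μ²`
(`a > 0`) which exists for all `s ≥ s₀` satisfies `μ(s₀) ≥ -a` (Li–Qing–Shi 2017, Prop. 6.3:
"it is not hard to show that `μ_m(γ(s))` goes to `-∞` in a finite time after `t`, which is a
contradiction"; there `a² = 1 + C₀e^{-2t}`). [cite: LiQingShi2017, Prop. 6.3] -/
theorem neg_le_of_riccati_le_Ici {μ μ' : ℝ → ℝ} {s₀ a : ℝ} (ha : 0 < a)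
    (hμ : ∀ s ∈ Ici s₀, HasDerivAt μ (μ' s) s)
    (hric : ∀ s ∈ Ici s₀, μ' s ≤ a ^ 2 - μ s ^ 2) : -a ≤ μ s₀ := by
  by_contra h0
  push Not at h0
  set χ := (μ s₀ + a) / (μ s₀ - a) with hχ
  have hχ0 : 0 < χ := div_pos_of_neg_of_neg (by linarith) (by linarith)
  -- the blow-up time `s₀ + L`, `L = -log χ/(2a)`, lies in `[s₀, ∞)`
  set L := -Real.log χ / (2 * a) with hL
  have hχ1 : χ < 1 := by rw [hχ, div_lt_one_of_neg (by linarith)]; linarith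
  have hL0 : 0 ≤ L := div_nonneg (by linarith [Real.log_neg hχ0 hχ1]) (by linarith)
  have hsub : Icc s₀ (s₀ + L) ⊆ Ici s₀ := fun s hs ↦ hs.1
  obtain ⟨hlt, hcmp⟩ := riccati_blowdown ha (fun s hs ↦ hμ s (hsub hs))
    (fun s hs ↦ hric s (hsub hs)) h0 (s₀ + L) (right_mem_Icc.2 (by linarith))
  have hE : Real.exp (2 * a * (s₀ + L - s₀)) = χ⁻¹ := by
    have : 2 * a * (s₀ + L - s₀) = -Real.log χ := by rw [hL]; field_simp; ring
    rw [this, Real.exp_neg, Real.exp_log hχ0]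
  rw [hE, mul_inv_cancel₀ hχ0.ne'] at hcmp
  have hρ1 : (μ (s₀ + L) + a) / (μ (s₀ + L) - a) < 1 := by
    rw [div_lt_one_of_neg (by linarith)]; linarith
  linarith

/-- **Lemma 6.4, one-variable content (lower barrier):** if `μ' + μ² ≥ b²` on `[s, T]`,
`|β| < b` and `μ(s) ≥ β`, then `μ ≥ β` on `[s, T]` — "`μ'` is positive whenever
`μ ∈ (-b, b)`", so `μ` cannot cross the level `β` downwards (Li–Qing–Shi 2017, proof of
Lemma 6.4, with `b = 1 - δ/2`). [cite: LiQingShi2017, Lemma 6.4 (proof)] -/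
theorem le_of_riccati_ge_barrier {μ μ' : ℝ → ℝ} {s T b β : ℝ} (hβ : |β| < b)
    (hμ : ∀ t ∈ Icc s T, HasDerivAt μ (μ' t) t)
    (hric : ∀ t ∈ Icc s T, b ^ 2 - μ t ^ 2 ≤ μ' t) (h0 : β ≤ μ s) :
    ∀ t ∈ Icc s T, β ≤ μ t := by
  intro t ht
  have hcont : ContinuousOn (fun x ↦ -μ x) (Icc s T) :=
    fun x hx ↦ (hμ x hx).neg.continuousAt.continuousWithinAt
  have h0' : (fun x ↦ -μ x) s ≤ (fun _ ↦ -β) s := by show -μ s ≤ -β; linarith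
  have key := image_le_of_deriv_right_lt_deriv_boundary' (f := fun x ↦ -μ x)
    (f' := fun x ↦ -μ' x) (a := s) (b := T) hcont
    (fun x hx ↦ (hμ x (Ico_subset_Icc_self hx)).neg.hasDerivWithinAt) (B := fun _ ↦ -β)
    (B' := fun _ ↦ 0) h0' continuousOn_const
    (fun x _ ↦ hasDerivWithinAt_const _ _ _) (fun x hx hxB ↦ ?_) ht
  · have key' : -μ t ≤ -β := key
    linarith
  have hxB'' : -μ x = -β := hxB
  have hxB' : μ x = β := by linarith
  have h1 := hric x (Ico_subset_Icc_self hx)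
  rw [hxB'] at h1
  have hβ2 : β ^ 2 < b ^ 2 := by
    have hb : 0 < b := (abs_nonneg β).trans_lt hβ
    exact sq_lt_sq' (by linarith [neg_abs_le β, (abs_lt.1 hβ).1]) (abs_lt.1 hβ).2
  show -μ' x < 0
  linarith

/-- **Prop. 6.5, one-variable content (Grönwall):** if `𝒥' = H 𝒥` with `𝒥 ≥ 0` and `H ≤ K`
on `[t₀, t]`, then `𝒥(t) ≤ 𝒥(t₀) e^{K (t - t₀)}` (Li–Qing–Shi 2017, (6.13)–(6.15): the first
variation `d𝒥/dt = H𝒥` integrated under the mean-curvature bound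
`H ≤ (n-1)(1 - δ/(4(n-1)))` of Lemma 6.4). [cite: LiQingShi2017, Prop. 6.5 (6.15)] -/
theorem le_mul_exp_of_deriv_eq_mul {J H : ℝ → ℝ} {t₀ t K : ℝ} (ht : t₀ ≤ t)
    (hJ : ∀ s ∈ Icc t₀ t, HasDerivAt J (H s * J s) s) (hpos : ∀ s ∈ Icc t₀ t, 0 ≤ J s)
    (hH : ∀ s ∈ Icc t₀ t, H s ≤ K) : J t ≤ J t₀ * Real.exp (K * (t - t₀)) := by
  set G : ℝ → ℝ := fun s ↦ Real.exp (-K * s) * J s with hG_def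
  have hG : ∀ s ∈ Icc t₀ t, HasDerivAt G
      (Real.exp (-K * s) * (-K) * J s + Real.exp (-K * s) * (H s * J s)) s :=
    fun s hs ↦ (hasDerivAt_exp_const_mul (-K) s).mul (hJ s hs)
  have hanti : AntitoneOn G (Icc t₀ t) := by
    refine antitoneOn_of_hasDerivWithinAt_nonpos (convex_Icc t₀ t)
      (f' := fun s ↦ Real.exp (-K * s) * (-K) * J s + Real.exp (-K * s) * (H s * J s))
      (fun s hs ↦ (hG s hs).continuousAt.continuousWithinAt) (fun s hs ↦ ?_) (fun s hs ↦ ?_)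
    · rw [interior_Icc] at hs
      exact (hG s (Ioo_subset_Icc_self hs)).hasDerivWithinAt
    · rw [interior_Icc] at hs
      have hs' := Ioo_subset_Icc_self hs
      have : Real.exp (-K * s) * (-K) * J s + Real.exp (-K * s) * (H s * J s)
          = Real.exp (-K * s) * ((H s - K) * J s) := by ring
      rw [this]
      exact mul_nonpos_of_nonneg_of_nonpos (Real.exp_pos _).le
        (mul_nonpos_of_nonpos_of_nonneg (by linarith [hH s hs']) (hpos s hs'))
  have key := hanti (left_mem_Icc.2 ht) (right_mem_Icc.2 ht) ht
  simp only [hG_def] at key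
  have hexp : 0 < Real.exp (K * t) := Real.exp_pos _
  have h1 : Real.exp (K * t) * Real.exp (-K * t) = 1 := exp_mul_exp_neg_mul K t
  have h2 : Real.exp (K * t) * Real.exp (-K * t₀) = Real.exp (K * (t - t₀)) := by
    rw [← Real.exp_add]; congr 1; ring
  have key2 := mul_le_mul_of_nonneg_left key hexp.le
  rw [← mul_assoc, ← mul_assoc, h1, one_mul, h2] at key2
  linarith [key2]

/-- **Prop. 6.7, the integration step (6.19) ⇒ (6.20):** if `F' ≥ k F - C 𝒥` on `[t₁, t₂]`
with `𝒥` continuous, then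
`F(t₂) ≥ e^{k(t₂ - t₁)} F(t₁) - C e^{k t₂} ∫_{t₁}^{t₂} e^{-ks} 𝒥(s) ds`
(Li–Qing–Shi 2017, proof of Prop. 6.7: "`d/ds (e^{-2(n-1)²s} H𝒥) ≥ -C e^{-2(n-1)²s} 𝒥` … Thus
(6.20)", with `F = H𝒥`, `k = 2(n-1)²`, `[t₁, t₂] = [t-1, t]`).
[cite: LiQingShi2017, Prop. 6.7 (6.19)–(6.20)] -/
theorem exp_mul_sub_integral_le_of_deriv_ge {F F' J : ℝ → ℝ} {t₁ t₂ k C : ℝ} (ht : t₁ ≤ t₂)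
    (hF : ∀ s ∈ Icc t₁ t₂, HasDerivAt F (F' s) s) (hJ : ContinuousOn J (Icc t₁ t₂))
    (hineq : ∀ s ∈ Icc t₁ t₂, k * F s - C * J s ≤ F' s) :
    Real.exp (k * (t₂ - t₁)) * F t₁ -
        C * Real.exp (k * t₂) * ∫ s in t₁..t₂, Real.exp (-k * s) * J s ≤ F t₂ := by
  -- the integrand and its primitive
  set f : ℝ → ℝ := fun s ↦ Real.exp (-k * s) * J s with hf_def
  have hfc : ContinuousOn f (Icc t₁ t₂) :=
    ((Real.continuous_exp.comp (continuous_const.mul continuous_id)).continuousOn).mul hJ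
  have hfi : ∀ x ∈ Icc t₁ t₂, IntervalIntegrable f MeasureTheory.volume t₁ x := fun x hx ↦
    (hfc.mono (Icc_subset_Icc_right hx.2)).intervalIntegrable_of_Icc hx.1
  set P : ℝ → ℝ := fun x ↦ ∫ s in t₁..x, f s with hP_def
  have hPc : ContinuousOn P (Icc t₁ t₂) := by
    have h := intervalIntegral.continuousOn_primitive_interval (μ := MeasureTheory.volume)
      (f := f) (a := t₁) (b := t₂) ?_
    · simpa [uIcc_of_le ht] using h
    · rw [uIcc_of_le ht]
      exact hfc.integrableOn_Icc
  have hPd : ∀ x ∈ Ioo t₁ t₂, HasDerivAt P (f x) x := by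
    intro x hx
    have hxI : Icc t₁ t₂ ∈ 𝓝 x := Icc_mem_nhds hx.1 hx.2
    refine intervalIntegral.integral_hasDerivAt_right (hfi x (Ioo_subset_Icc_self hx)) ?_
      (hfc.continuousAt hxI)
    exact (hfc.mono Ioo_subset_Icc_self).stronglyMeasurableAtFilter isOpen_Ioo x hx
  -- `G = e^{-ks} F + C P` is monotone
  set G : ℝ → ℝ := fun s ↦ Real.exp (-k * s) * F s + C * P s with hG_def
  have hG : ∀ s ∈ Ioo t₁ t₂, HasDerivAt G
      (Real.exp (-k * s) * (-k) * F s + Real.exp (-k * s) * F' s + C * f s) s :=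
    fun s hs ↦ ((hasDerivAt_exp_const_mul (-k) s).mul (hF s (Ioo_subset_Icc_self hs))).add
      ((hPd s hs).const_mul C)
  have hGc : ContinuousOn G (Icc t₁ t₂) := by
    refine ContinuousOn.add (ContinuousOn.mul ?_ ?_) (continuousOn_const.mul hPc)
    · exact (Real.continuous_exp.comp (continuous_const.mul continuous_id)).continuousOn
    · exact fun s hs ↦ (hF s hs).continuousAt.continuousWithinAt
  have hmono : MonotoneOn G (Icc t₁ t₂) := by
    refine monotoneOn_of_hasDerivWithinAt_nonneg (convex_Icc t₁ t₂)
      (f' := fun s ↦ Real.exp (-k * s) * (-k) * F s + Real.exp (-k * s) * F' s + C * f s) hGc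
      (fun s hs ↦ ?_) (fun s hs ↦ ?_)
    · rw [interior_Icc] at hs
      exact (hG s hs).hasDerivWithinAt
    · rw [interior_Icc] at hs
      have hs' := Ioo_subset_Icc_self hs
      have h1 := hineq s hs'
      have hexp : 0 < Real.exp (-k * s) := Real.exp_pos _
      have : Real.exp (-k * s) * (-k) * F s + Real.exp (-k * s) * F' s + C * f s
          = Real.exp (-k * s) * (F' s - (k * F s - C * J s)) := by
        simp only [hf_def]; ring
      rw [this]
      exact mul_nonneg hexp.le (by linarith)
  have key := hmono (left_mem_Icc.2 ht) (right_mem_Icc.2 ht) ht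
  simp only [hG_def, hP_def, intervalIntegral.integral_same, mul_zero, add_zero] at key
  -- multiply by `e^{k t₂}`
  have hexp : 0 < Real.exp (k * t₂) := Real.exp_pos _
  have h1 : Real.exp (k * t₂) * Real.exp (-k * t₂) = 1 := exp_mul_exp_neg_mul k t₂
  have h2 : Real.exp (k * t₂) * Real.exp (-k * t₁) = Real.exp (k * (t₂ - t₁)) := by
    rw [← Real.exp_add]; congr 1; ring
  have key2 := mul_le_mul_of_nonneg_left key hexp.le
  rw [mul_add, ← mul_assoc, ← mul_assoc, h1, one_mul, h2] at key2
  have : Real.exp (k * t₂) * (C * ∫ s in t₁..t₂, f s)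
      = C * Real.exp (k * t₂) * ∫ s in t₁..t₂, Real.exp (-k * s) * J s := by
    simp only [hf_def]; ring
  linarith [key2, this]

end Scalar

/-! ### §B. The matrix Riccati equation with asymptotically hyperbolic curvature pinching

Along a unit speed geodesic the shape operator `S = ∇²t` of the geodesic spheres satisfies
`S' + S² = -R_{∇t}` (Li–Qing–Shi 2017, (6.1)); in a parallel orthonormal frame of `γ'^⊥` this is
the matrix Riccati equation `𝒰' + 𝒰² + ℛ = 0` of `VolumeSphereTheoremProofs.lean`, §8
(`hasDerivAt_shape_riccati`, `𝒰 = 𝒜'𝒜⁻¹` symmetric, `ℛ(t) = R(·, γ')γ'` symmetric with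
`⟨ℛ v, v⟩/|v|² = K(v, γ')`). The curvature decay (1.9) `|K + 1| ≤ C₀x²`, `x ∼ e^{-t}`, is the
two-sided pinching `(1 - C₀e^{-2t})|v|² ≤ -⟨ℛ(t)v, v⟩ ≤ (1 + C₀e^{-2t})|v|²` of the quadratic
form of `ℛ`, and the principal curvatures `μ` are the values of the Rayleigh quotient
`⟨𝒰 v, v⟩/|v|²` at eigenvectors; `μ_M`, `μ_m` are its maximum and minimum. Everything below is
about such matrix curves (`Fintype.card ι = n - 1`) and uses no Riemannian geometry. -/

section MatrixLayer

open scoped Matrix.Norms.Operator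

variable {ι : Type*} [Fintype ι]

/-! #### Quadratic forms of symmetric matrices -/

/-- Cauchy–Schwarz for the dot product on `ι → ℝ`. [folklore] -/
theorem dotProduct_sq_le_mul (v w : ι → ℝ) : (v ⬝ᵥ w) ^ 2 ≤ (v ⬝ᵥ v) * (w ⬝ᵥ w) := by
  have h := Finset.sum_mul_sq_le_sq_mul_sq Finset.univ v w
  simpa only [dotProduct, sq] using h

/-- `v ⬝ᵥ v ≥ 0` on `ι → ℝ`. [folklore] -/
theorem dotProduct_self_nonneg' (v : ι → ℝ) : 0 ≤ v ⬝ᵥ v :=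
  Finset.sum_nonneg fun i _ ↦ mul_self_nonneg (v i)

/-- `v ⬝ᵥ v > 0` for `v ≠ 0` on `ι → ℝ`. [folklore] -/
theorem dotProduct_self_pos' {v : ι → ℝ} (hv : v ≠ 0) : 0 < v ⬝ᵥ v :=
  lt_of_le_of_ne (dotProduct_self_nonneg' v) (fun h ↦ hv (dotProduct_self_eq_zero.1 h.symm))

/-- For a symmetric matrix, `⟨v, M w⟩ = ⟨M v, w⟩`. [folklore] -/
theorem dotProduct_mulVec_of_isSymm {M : Matrix ι ι ℝ} (hM : M.IsSymm) (v w : ι → ℝ) :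
    v ⬝ᵥ M *ᵥ w = (M *ᵥ v) ⬝ᵥ w := by
  rw [dotProduct_mulVec, ← Matrix.mulVec_transpose, hM.eq]

/-- For a symmetric matrix, `⟨v, M w⟩ = ⟨w, M v⟩`. [folklore] -/
theorem dotProduct_mulVec_comm_of_isSymm {M : Matrix ι ι ℝ} (hM : M.IsSymm) (v w : ι → ℝ) :
    v ⬝ᵥ M *ᵥ w = w ⬝ᵥ M *ᵥ v := by
  rw [dotProduct_mulVec_of_isSymm hM, dotProduct_comm]

/-- For a symmetric matrix, `⟨v, M² v⟩ = |M v|²`. [folklore] -/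
theorem dotProduct_mul_self_mulVec_of_isSymm {M : Matrix ι ι ℝ} (hM : M.IsSymm) (v : ι → ℝ) :
    v ⬝ᵥ (M * M) *ᵥ v = (M *ᵥ v) ⬝ᵥ (M *ᵥ v) := by
  rw [← Matrix.mulVec_mulVec, dotProduct_mulVec_of_isSymm hM]

/-- **The Riccati inequality for the Rayleigh quotient in a fixed (parallel) direction.** If `𝒰`
is symmetric and `𝒰' = -ℛ - 𝒰²`, then for every `v ≠ 0` the quotient `φ = ⟨𝒰v, v⟩/|v|²` has
`φ' + φ² ≤ -⟨ℛ v, v⟩/|v|²` (Cauchy–Schwarz `⟨𝒰v, v⟩² ≤ |v|²|𝒰v|²`): the source of the upper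
Riccati inequality "`μ' + μ² ≤ 1 + C₀e^{-2t}`" (Li–Qing–Shi 2017, (6.2)) for every direction,
hence for `μ_M`. [cite: LiQingShi2017, (6.1)–(6.2)] -/
theorem rayleigh_riccati_le {U R : Matrix ι ι ℝ} (hU : U.IsSymm) {v : ι → ℝ} (hv : v ≠ 0) :
    (v ⬝ᵥ (-R - U * U) *ᵥ v) / (v ⬝ᵥ v) + ((v ⬝ᵥ U *ᵥ v) / (v ⬝ᵥ v)) ^ 2 ≤
      -(v ⬝ᵥ R *ᵥ v) / (v ⬝ᵥ v) := by
  have hp : 0 < v ⬝ᵥ v := dotProduct_self_pos' hv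
  have hcs := dotProduct_sq_le_mul v (U *ᵥ v)
  have hq : v ⬝ᵥ (-R - U * U) *ᵥ v = -(v ⬝ᵥ R *ᵥ v) - (U *ᵥ v) ⬝ᵥ (U *ᵥ v) := by
    rw [Matrix.sub_mulVec, Matrix.neg_mulVec, dotProduct_sub, dotProduct_neg,
      dotProduct_mul_self_mulVec_of_isSymm hU]
  rw [hq, div_pow, div_add_div _ _ hp.ne' (pow_ne_zero 2 hp.ne'), div_le_div_iff₀
    (mul_pos hp (pow_pos hp 2)) hp]
  nlinarith [mul_le_mul_of_nonneg_left hcs hp.le, pow_pos hp 2, pow_pos hp 3]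

/-- **Differentiating a quadratic form along a curve of matrices**: `d/ds ⟨U(s) w, v⟩ = ⟨U'(s) w, v⟩`.
[folklore] -/
theorem hasDerivAt_dotProduct_mulVec {U : ℝ → Matrix ι ι ℝ} {U' : Matrix ι ι ℝ} {t : ℝ}
    (hU : HasDerivAt U U' t) (v w : ι → ℝ) :
    HasDerivAt (fun s ↦ v ⬝ᵥ U s *ᵥ w) (v ⬝ᵥ U' *ᵥ w) t := by
  let L : Matrix ι ι ℝ →ₗ[ℝ] ℝ :=
    { toFun := fun M ↦ v ⬝ᵥ M *ᵥ w
      map_add' := fun M N ↦ by simp only [Matrix.add_mulVec, dotProduct_add]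
      map_smul' := fun c M ↦ by
        simp only [Matrix.smul_mulVec, dotProduct_smul, smul_eq_mul, RingHom.id_apply] }
  have h := L.toContinuousLinearMap.hasFDerivAt.comp_hasDerivAt t hU
  exact h

/-- The Rayleigh quotient `⟨𝒰(s) v, v⟩/|v|²` of a solution of `𝒰' = -ℛ - 𝒰²` is differentiable
with derivative `⟨(-ℛ - 𝒰²) v, v⟩/|v|²`. [folklore] -/
theorem hasDerivAt_rayleigh {U R : ℝ → Matrix ι ι ℝ} {t : ℝ}
    (hU : HasDerivAt U (-(R t) - U t * U t) t) (v : ι → ℝ) :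
    HasDerivAt (fun s ↦ (v ⬝ᵥ U s *ᵥ v) / (v ⬝ᵥ v))
      ((v ⬝ᵥ (-(R t) - U t * U t) *ᵥ v) / (v ⬝ᵥ v)) t :=
  (hasDerivAt_dotProduct_mulVec hU v v).div_const _

/-! #### Cor. 6.2: the sharp upper bound `μ_M ≤ 1 + C (t + 1) e^{-2t}` -/

/-- **Cor. 6.2 (sharp upper bound for the principal curvatures), matrix form.** Let `𝒰` be a
symmetric solution of `𝒰' = -ℛ - 𝒰²` on `[t₀, t]` whose curvature term satisfies the
asymptotically hyperbolic lower sectional bound `-⟨ℛ(s)v, v⟩ ≤ (1 + C₀e^{-2s})|v|²`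
(`K ≥ -1 - C₀e^{-2s}`, from (1.9)). Then every Rayleigh quotient `φ_v = ⟨𝒰 v, v⟩/|v|²` obeys
`φ_v(t) - 1 ≤ (e^{2t₀}(φ_v(t₀) - 1) + C₀(t - t₀)) e^{-2t}`; with `φ_v(t₀) ≤ μ_M(t₀) ≤ C`
(Lemma 6.1) this is the printed `μ_M ≤ 1 + C(t + 1)e^{-2t}`.
[cite: LiQingShi2017, Cor. 6.2] -/
theorem rayleigh_sub_one_le {U R : ℝ → Matrix ι ι ℝ} {t₀ t C₀ : ℝ} (ht : t₀ ≤ t)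
    (hU : ∀ s ∈ Icc t₀ t, HasDerivAt U (-(R s) - U s * U s) s)
    (hsymm : ∀ s ∈ Icc t₀ t, (U s).IsSymm)
    (hR : ∀ s ∈ Icc t₀ t, ∀ v : ι → ℝ,
      -(v ⬝ᵥ R s *ᵥ v) ≤ (1 + C₀ * Real.exp (-2 * s)) * (v ⬝ᵥ v))
    {v : ι → ℝ} (hv : v ≠ 0) :
    (v ⬝ᵥ U t *ᵥ v) / (v ⬝ᵥ v) - 1 ≤
      (Real.exp (2 * t₀) * ((v ⬝ᵥ U t₀ *ᵥ v) / (v ⬝ᵥ v) - 1) + C₀ * (t - t₀)) *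
        Real.exp (-2 * t) := by
  have hp : 0 < v ⬝ᵥ v := dotProduct_self_pos' hv
  refine sub_one_le_of_riccati_le (μ := fun s ↦ (v ⬝ᵥ U s *ᵥ v) / (v ⬝ᵥ v))
    (μ' := fun s ↦ (v ⬝ᵥ (-(R s) - U s * U s) *ᵥ v) / (v ⬝ᵥ v)) ht
    (fun s hs ↦ hasDerivAt_rayleigh (hU s hs) v) (fun s hs ↦ ?_)
  have h1 := rayleigh_riccati_le (R := R s) (hsymm s hs) hv
  have h2 : -(v ⬝ᵥ R s *ᵥ v) / (v ⬝ᵥ v) ≤ 1 + C₀ * Real.exp (-2 * s) := by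
    rw [div_le_iff₀ hp]; exact hR s hs v
  exact h1.trans h2

/-- **Cor. 6.2, printed form**: under the hypotheses of `rayleigh_sub_one_le` with `0 ≤ t₀`,
`0 ≤ C₀` and `μ_M(t₀) ≤ K` (all Rayleigh quotients at `t₀` are `≤ K`, Lemma 6.1), every
Rayleigh quotient — in particular every principal curvature, and `μ_M(t)` — is
`≤ 1 + C (t + 1) e^{-2t}` with `C = max (e^{2t₀}(K - 1)) C₀`. [cite: LiQingShi2017, Cor. 6.2] -/
theorem rayleigh_le_one_add {U R : ℝ → Matrix ι ι ℝ} {t₀ t C₀ K : ℝ} (ht₀ : 0 ≤ t₀)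
    (ht : t₀ ≤ t) (hC₀ : 0 ≤ C₀)
    (hU : ∀ s ∈ Icc t₀ t, HasDerivAt U (-(R s) - U s * U s) s)
    (hsymm : ∀ s ∈ Icc t₀ t, (U s).IsSymm)
    (hR : ∀ s ∈ Icc t₀ t, ∀ v : ι → ℝ,
      -(v ⬝ᵥ R s *ᵥ v) ≤ (1 + C₀ * Real.exp (-2 * s)) * (v ⬝ᵥ v))
    (hK : ∀ v : ι → ℝ, v ≠ 0 → (v ⬝ᵥ U t₀ *ᵥ v) / (v ⬝ᵥ v) ≤ K) {v : ι → ℝ} (hv : v ≠ 0) :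
    (v ⬝ᵥ U t *ᵥ v) / (v ⬝ᵥ v) ≤
      1 + max (Real.exp (2 * t₀) * (K - 1)) C₀ * (t + 1) * Real.exp (-2 * t) := by
  have hp : 0 < v ⬝ᵥ v := dotProduct_self_pos' hv
  refine le_one_add_of_riccati_le (μ := fun s ↦ (v ⬝ᵥ U s *ᵥ v) / (v ⬝ᵥ v))
    (μ' := fun s ↦ (v ⬝ᵥ (-(R s) - U s * U s) *ᵥ v) / (v ⬝ᵥ v)) ht₀ ht hC₀
    (fun s hs ↦ hasDerivAt_rayleigh (hU s hs) v) (fun s hs ↦ ?_) (hK v hv)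
  have h1 := rayleigh_riccati_le (R := R s) (hsymm s hs) hv
  have h2 : -(v ⬝ᵥ R s *ᵥ v) / (v ⬝ᵥ v) ≤ 1 + C₀ * Real.exp (-2 * s) := by
    rw [div_le_iff₀ hp]; exact hR s hs v
  exact h1.trans h2

/-! #### Prop. 6.3 and Lemma 6.6: lower bounds for `μ_m` from the existence of the solution -/

/-- **Lemma 6.6 (uniform lower bound for `μ_m` one unit of time before the sphere), matrix
form.** If the symmetric solution `𝒰` of `𝒰' = -ℛ - 𝒰²` exists on `[s₀, s₀ + L]` (`L > 0`; in
the paper `L = 1`: the minimal geodesic from `p` to `q ∈ Γ_t ∖ C_p` carries the shape operator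
up to time `t`) and `-⟨ℛ v, v⟩ ≤ a²|v|²` there (`a² = 1 + C₀e^{-2s₀}`), then every Rayleigh
quotient at `s₀` — in particular `μ_m(s₀)` — is `> -a coth(aL) = -a(1 + e^{-2aL})/(1 - e^{-2aL})`.
[cite: LiQingShi2017, Lemma 6.6] -/
theorem neg_coth_lt_rayleigh {U R : ℝ → Matrix ι ι ℝ} {s₀ L a : ℝ} (ha : 0 < a) (hL : 0 < L)
    (hU : ∀ s ∈ Icc s₀ (s₀ + L), HasDerivAt U (-(R s) - U s * U s) s)
    (hsymm : ∀ s ∈ Icc s₀ (s₀ + L), (U s).IsSymm)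
    (hR : ∀ s ∈ Icc s₀ (s₀ + L), ∀ v : ι → ℝ, -(v ⬝ᵥ R s *ᵥ v) ≤ a ^ 2 * (v ⬝ᵥ v))
    {v : ι → ℝ} (hv : v ≠ 0) :
    -(a * (1 + Real.exp (-2 * a * L)) / (1 - Real.exp (-2 * a * L))) <
      (v ⬝ᵥ U s₀ *ᵥ v) / (v ⬝ᵥ v) := by
  have hp : 0 < v ⬝ᵥ v := dotProduct_self_pos' hv
  refine neg_coth_lt_of_riccati_le (μ := fun s ↦ (v ⬝ᵥ U s *ᵥ v) / (v ⬝ᵥ v))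
    (μ' := fun s ↦ (v ⬝ᵥ (-(R s) - U s * U s) *ᵥ v) / (v ⬝ᵥ v)) ha hL
    (fun s hs ↦ hasDerivAt_rayleigh (hU s hs) v) (fun s hs ↦ ?_)
  have h1 := rayleigh_riccati_le (R := R s) (hsymm s hs) hv
  have h2 : -(v ⬝ᵥ R s *ᵥ v) / (v ⬝ᵥ v) ≤ a ^ 2 := by
    rw [div_le_iff₀ hp]; exact hR s hs v
  show _ ≤ a ^ 2 - ((v ⬝ᵥ U s *ᵥ v) / (v ⬝ᵥ v)) ^ 2
  linarith

/-- **Prop. 6.3 (lower bound `μ_m ≥ -√(1 + C₀e^{-2t})` along rays avoiding the cut locus),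
matrix form.** If the symmetric solution `𝒰` of `𝒰' = -ℛ - 𝒰²` exists on `[s₀, ∞)` and
`-⟨ℛ v, v⟩ ≤ a²|v|²` there, then every Rayleigh quotient at `s₀` is `≥ -a`.
[cite: LiQingShi2017, Prop. 6.3] -/
theorem neg_le_rayleigh_of_Ici {U R : ℝ → Matrix ι ι ℝ} {s₀ a : ℝ} (ha : 0 < a)
    (hU : ∀ s ∈ Ici s₀, HasDerivAt U (-(R s) - U s * U s) s)
    (hsymm : ∀ s ∈ Ici s₀, (U s).IsSymm)
    (hR : ∀ s ∈ Ici s₀, ∀ v : ι → ℝ, -(v ⬝ᵥ R s *ᵥ v) ≤ a ^ 2 * (v ⬝ᵥ v))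
    {v : ι → ℝ} (hv : v ≠ 0) : -a ≤ (v ⬝ᵥ U s₀ *ᵥ v) / (v ⬝ᵥ v) := by
  have hp : 0 < v ⬝ᵥ v := dotProduct_self_pos' hv
  refine neg_le_of_riccati_le_Ici (μ := fun s ↦ (v ⬝ᵥ U s *ᵥ v) / (v ⬝ᵥ v))
    (μ' := fun s ↦ (v ⬝ᵥ (-(R s) - U s * U s) *ᵥ v) / (v ⬝ᵥ v)) ha
    (fun s hs ↦ hasDerivAt_rayleigh (hU s hs) v) (fun s hs ↦ ?_)
  have h1 := rayleigh_riccati_le (R := R s) (hsymm s hs) hv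
  have h2 : -(v ⬝ᵥ R s *ᵥ v) / (v ⬝ᵥ v) ≤ a ^ 2 := by
    rw [div_le_iff₀ hp]; exact hR s hs v
  show _ ≤ a ^ 2 - ((v ⬝ᵥ U s *ᵥ v) / (v ⬝ᵥ v)) ^ 2
  linarith

/-! #### Lemma 6.4: the lower barrier for `μ_m` -/

/-- Homogeneity: a lower bound for the quadratic form on the unit sphere `{|v|² = 1}` is a lower
bound `β|v|² ≤ ⟨M v, v⟩` everywhere. [folklore] -/
theorem mul_dotProduct_le_of_unit {M : Matrix ι ι ℝ} {β : ℝ}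
    (h : ∀ v : ι → ℝ, v ⬝ᵥ v = 1 → β ≤ v ⬝ᵥ M *ᵥ v) (v : ι → ℝ) :
    β * (v ⬝ᵥ v) ≤ v ⬝ᵥ M *ᵥ v := by
  by_cases hv : v = 0
  · simp [hv]
  have hp : 0 < v ⬝ᵥ v := dotProduct_self_pos' hv
  set c := (Real.sqrt (v ⬝ᵥ v))⁻¹ with hc
  have hc2 : c ^ 2 = (v ⬝ᵥ v)⁻¹ := by
    rw [hc, inv_pow, Real.sq_sqrt hp.le]
  have hunit : (c • v) ⬝ᵥ (c • v) = 1 := by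
    rw [smul_dotProduct, dotProduct_smul, smul_eq_mul, smul_eq_mul, ← mul_assoc, ← sq, hc2,
      inv_mul_cancel₀ hp.ne']
  have key := h (c • v) hunit
  rw [Matrix.mulVec_smul, smul_dotProduct, dotProduct_smul, smul_eq_mul, smul_eq_mul,
    ← mul_assoc, ← sq, hc2, ← div_eq_inv_mul, le_div_iff₀ hp] at key
  exact key

/-- **A minimiser of the Rayleigh quotient of a symmetric matrix is an eigenvector** (elementary
form: if `β|v|² ≤ ⟨M v, v⟩` for all `v` with equality at `v₁`, then `M v₁ = β v₁`; the positive
semidefinite form `⟨(M - β)v, v⟩` vanishes at `v₁`, hence so does `(M - β)v₁`). [folklore] -/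
theorem mulVec_eq_smul_of_rayleigh_min {M : Matrix ι ι ℝ} (hM : M.IsSymm) {β : ℝ}
    (h : ∀ v : ι → ℝ, β * (v ⬝ᵥ v) ≤ v ⬝ᵥ M *ᵥ v) {v₁ : ι → ℝ}
    (h₁ : v₁ ⬝ᵥ M *ᵥ v₁ = β * (v₁ ⬝ᵥ v₁)) : M *ᵥ v₁ = β • v₁ := by
  set w := M *ᵥ v₁ - β • v₁ with hw
  rw [← sub_eq_zero]
  show w = 0
  -- atoms
  set A := w ⬝ᵥ w with hA
  set B := w ⬝ᵥ M *ᵥ w - β * (w ⬝ᵥ w) with hB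
  have hA0 : 0 ≤ A := dotProduct_self_nonneg' w
  have hB0 : 0 ≤ B := by have := h w; rw [hB]; linarith
  have hAw : A = w ⬝ᵥ M *ᵥ v₁ - β * (w ⬝ᵥ v₁) := by
    rw [hA]
    conv_lhs => rw [show w = M *ᵥ v₁ - β • v₁ from rfl]
    rw [dotProduct_sub, dotProduct_smul, smul_eq_mul]
  have hsymm : v₁ ⬝ᵥ M *ᵥ w = w ⬝ᵥ M *ᵥ v₁ := dotProduct_mulVec_comm_of_isSymm hM v₁ w
  have hcomm : v₁ ⬝ᵥ w = w ⬝ᵥ v₁ := dotProduct_comm v₁ w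
  -- `0 ≤ -2τA + τ²B` for every `τ`
  have key : ∀ τ : ℝ, 0 ≤ -2 * τ * A + τ ^ 2 * B := by
    intro τ
    have hq := h (v₁ - τ • w)
    have e1 : (v₁ - τ • w) ⬝ᵥ M *ᵥ (v₁ - τ • w) =
        v₁ ⬝ᵥ M *ᵥ v₁ - τ * (v₁ ⬝ᵥ M *ᵥ w) - τ * (w ⬝ᵥ M *ᵥ v₁) + τ ^ 2 * (w ⬝ᵥ M *ᵥ w) := by
      simp only [Matrix.mulVec_sub, Matrix.mulVec_smul, dotProduct_sub, sub_dotProduct,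
        dotProduct_smul, smul_dotProduct, smul_eq_mul]
      ring
    have e2 : (v₁ - τ • w) ⬝ᵥ (v₁ - τ • w) =
        v₁ ⬝ᵥ v₁ - τ * (v₁ ⬝ᵥ w) - τ * (w ⬝ᵥ v₁) + τ ^ 2 * (w ⬝ᵥ w) := by
      simp only [dotProduct_sub, sub_dotProduct, dotProduct_smul, smul_dotProduct, smul_eq_mul]
      ring
    rw [e1, e2, hsymm, hcomm] at hq
    rw [hAw, hB]
    linarith [hq, h₁]
  by_contra hw0
  have hApos : 0 < A := dotProduct_self_pos' hw0
  set τ := A / (B + 1) with hτ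
  have hτ0 : 0 < τ := div_pos hApos (by linarith)
  have hτB : τ * B < A := by
    rw [hτ, div_mul_eq_mul_div, div_lt_iff₀ (by linarith : 0 < B + 1)]
    nlinarith
  have := key τ
  nlinarith

/-- The unit sphere `{v | v ⬝ᵥ v = 1}` of `ι → ℝ` is compact. [folklore] -/
theorem isCompact_dotProduct_self_eq_one :
    IsCompact {v : ι → ℝ | v ⬝ᵥ v = 1} := by
  refine Metric.isCompact_of_isClosed_isBounded
    (isClosed_eq (Continuous.dotProduct continuous_id continuous_id) continuous_const)
    ((Metric.isBounded_closedBall (x := (0 : ι → ℝ)) (r := 1)).subset fun v hv ↦ ?_)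
  rw [Metric.mem_closedBall, dist_zero_right, pi_norm_le_iff_of_nonneg zero_le_one]
  intro i
  rw [Real.norm_eq_abs, abs_le_one_iff_mul_self_le_one]
  have hv' : v ⬝ᵥ v = 1 := hv
  calc v i * v i ≤ ∑ j, v j * v j :=
        Finset.single_le_sum (f := fun j ↦ v j * v j) (fun j _ ↦ mul_self_nonneg _)
          (Finset.mem_univ i)
    _ = 1 := hv'

/-- **Lemma 6.4 (lower barrier for the smallest principal curvature), matrix form.** Let `𝒰` be a
symmetric solution of `𝒰' = -ℛ - 𝒰²` on `[s, T]` with the asymptotically hyperbolic UPPER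
sectional bound `b²|v|² ≤ -⟨ℛ(t)v, v⟩` (`K ≤ -b²`, `b² = 1 - C₀e^{-2t_δ} ≥ (1 - δ/2)²` for
`t ≥ t_δ`), and let `|β| < b`. If `μ_m(s) > β` (all Rayleigh quotients at `s` exceed `β`) then
`μ_m(t) > β` for all `t ∈ [s, T]`: "`μ_m'` is positive whenever `μ_m ∈ (0, 1 - δ/2)`", the
argument of Li–Qing–Shi 2017, Lemma 6.4, made rigorous for the non-smooth function `μ_m` — at
the first time `τ₁` where some unit `v₁` has `⟨𝒰 v₁, v₁⟩ = β = μ_m(τ₁)`, `v₁` is an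
eigenvector (`mulVec_eq_smul_of_rayleigh_min`), so `φ = ⟨𝒰(·)v₁, v₁⟩` has
`φ'(τ₁) = -⟨ℛv₁, v₁⟩ - |𝒰v₁|² ≥ b² - β² > 0`, while `φ > β = φ(τ₁)` before `τ₁` forces
`φ'(τ₁) ≤ 0`. [cite: LiQingShi2017, Lemma 6.4] -/
theorem rayleigh_barrier {U R : ℝ → Matrix ι ι ℝ} {s T b β : ℝ} (hβ : |β| < b)
    (hU : ∀ t ∈ Icc s T, HasDerivAt U (-(R t) - U t * U t) t)
    (hsymm : ∀ t ∈ Icc s T, (U t).IsSymm)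
    (hR : ∀ t ∈ Icc s T, ∀ v : ι → ℝ, b ^ 2 * (v ⬝ᵥ v) ≤ -(v ⬝ᵥ R t *ᵥ v))
    (h0 : ∀ v : ι → ℝ, v ⬝ᵥ v = 1 → β < v ⬝ᵥ U s *ᵥ v) :
    ∀ t ∈ Icc s T, ∀ v : ι → ℝ, v ⬝ᵥ v = 1 → β < v ⬝ᵥ U t *ᵥ v := by
  by_contra hcon
  push Not at hcon
  obtain ⟨t₁, ht₁, w₁, hw₁, hle⟩ := hcon
  -- the compact set `K = [s, T] × sphere` and the continuous quadratic form on it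
  set S : Set (ι → ℝ) := {v | v ⬝ᵥ v = 1} with hS
  set K : Set (ℝ × (ι → ℝ)) := Icc s T ×ˢ S with hK
  have hKc : IsCompact K := isCompact_Icc.prod isCompact_dotProduct_self_eq_one
  set F : ℝ × (ι → ℝ) → ℝ := fun p ↦ p.2 ⬝ᵥ U p.1 *ᵥ p.2 with hF
  have hUc : ContinuousOn U (Icc s T) := fun t ht ↦ (hU t ht).continuousAt.continuousWithinAt
  have hFc : ContinuousOn F K := by
    have h1 : ContinuousOn (fun p : ℝ × (ι → ℝ) ↦ U p.1) K :=
      hUc.comp continuousOn_fst fun p hp ↦ (mem_prod.1 hp).1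
    have h2 : ContinuousOn (fun p : ℝ × (ι → ℝ) ↦ U p.1 *ᵥ p.2) K :=
      (Continuous.matrix_mulVec continuous_fst continuous_snd).comp_continuousOn
        (h1.prodMk continuousOn_snd)
    exact (Continuous.dotProduct continuous_fst continuous_snd).comp_continuousOn
      (continuousOn_snd.prodMk h2)
  -- the (compact, nonempty) set of violations and a violation with minimal time
  set A : Set (ℝ × (ι → ℝ)) := K ∩ F ⁻¹' Iic β with hA
  have hAc : IsCompact A :=
    hKc.of_isClosed_subset (hFc.preimage_isClosed_of_isClosed hKc.isClosed isClosed_Iic)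
      inter_subset_left
  have hAne : A.Nonempty := ⟨(t₁, w₁), ⟨mem_prod.2 ⟨ht₁, hw₁⟩, hle⟩⟩
  obtain ⟨p₁, hp₁A, hmin⟩ := hAc.exists_isMinOn hAne continuousOn_fst
  obtain ⟨hp₁K, hp₁F⟩ := hp₁A
  obtain ⟨hτ₁, hv₁⟩ := mem_prod.1 hp₁K
  set τ₁ := p₁.1 with hτ₁_def
  set v₁ := p₁.2 with hv₁_def
  have hv₁' : v₁ ⬝ᵥ v₁ = 1 := hv₁
  have hp₁F' : v₁ ⬝ᵥ U τ₁ *ᵥ v₁ ≤ β := hp₁F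
  -- `τ₁ > s`
  have hsτ₁ : s < τ₁ := by
    rcases hτ₁.1.eq_or_lt with h | h
    · exact absurd (h ▸ h0 v₁ hv₁') (not_lt.2 hp₁F')
    · exact h
  -- before `τ₁` there is no violation
  have hbefore : ∀ τ ∈ Ico s τ₁, ∀ v : ι → ℝ, v ⬝ᵥ v = 1 → β < v ⬝ᵥ U τ *ᵥ v := by
    intro τ hτ v hv
    by_contra hle'
    push Not at hle'
    have hmem : (τ, v) ∈ A :=
      ⟨mem_prod.2 ⟨⟨hτ.1, hτ.2.le.trans hτ₁.2⟩, hv⟩, hle'⟩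
    have := hmin hmem
    exact absurd this (not_le.2 hτ.2)
  -- hence at `τ₁` all quotients are `≥ β`, and `v₁` realises the minimum `β`
  have hat : ∀ v : ι → ℝ, v ⬝ᵥ v = 1 → β ≤ v ⬝ᵥ U τ₁ *ᵥ v := by
    intro v hv
    have hcont : Tendsto (fun τ ↦ v ⬝ᵥ U τ *ᵥ v) (𝓝[<] τ₁) (𝓝 (v ⬝ᵥ U τ₁ *ᵥ v)) :=
      ((hasDerivAt_dotProduct_mulVec (hU τ₁ hτ₁) v v).continuousAt.tendsto).mono_left
        nhdsWithin_le_nhds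
    refine ge_of_tendsto hcont ?_
    filter_upwards [Ico_mem_nhdsLT hsτ₁] with τ hτ
    exact (hbefore τ hτ v hv).le
  have hall : ∀ v : ι → ℝ, β * (v ⬝ᵥ v) ≤ v ⬝ᵥ U τ₁ *ᵥ v := mul_dotProduct_le_of_unit hat
  have heq : v₁ ⬝ᵥ U τ₁ *ᵥ v₁ = β * (v₁ ⬝ᵥ v₁) := by
    rw [hv₁', mul_one]; exact le_antisymm hp₁F' (hat v₁ hv₁')
  have heig : U τ₁ *ᵥ v₁ = β • v₁ := mulVec_eq_smul_of_rayleigh_min (hsymm τ₁ hτ₁) hall heq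
  -- the derivative of `φ = ⟨U(·)v₁, v₁⟩` at `τ₁` is positive ...
  have hφ := hasDerivAt_dotProduct_mulVec (hU τ₁ hτ₁) v₁ v₁
  have hpos : 0 < v₁ ⬝ᵥ (-(R τ₁) - U τ₁ * U τ₁) *ᵥ v₁ := by
    rw [Matrix.sub_mulVec, Matrix.neg_mulVec, dotProduct_sub, dotProduct_neg,
      dotProduct_mul_self_mulVec_of_isSymm (hsymm τ₁ hτ₁), heig, smul_dotProduct,
      dotProduct_smul, smul_eq_mul, smul_eq_mul, hv₁', mul_one]
    have h1 := hR τ₁ hτ₁ v₁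
    rw [hv₁', mul_one] at h1
    have hβ2 : β * β < b ^ 2 := by
      have hb : 0 < b := (abs_nonneg β).trans_lt hβ
      have := sq_lt_sq' (by linarith [neg_abs_le β, (abs_lt.1 hβ).1]) (abs_lt.1 hβ).2
      rwa [sq β] at this
    linarith
  -- ... but `φ > β = φ(τ₁)` on `[s, τ₁)` forces it to be `≤ 0`
  have hslope : Tendsto (slope (fun τ ↦ v₁ ⬝ᵥ U τ *ᵥ v₁) τ₁) (𝓝[<] τ₁)
      (𝓝 (v₁ ⬝ᵥ (-(R τ₁) - U τ₁ * U τ₁) *ᵥ v₁)) :=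
    (hasDerivAt_iff_tendsto_slope.1 hφ).mono_left (nhdsLT_le_nhdsNE τ₁)
  have hnonpos : v₁ ⬝ᵥ (-(R τ₁) - U τ₁ * U τ₁) *ᵥ v₁ ≤ 0 := by
    refine le_of_tendsto hslope ?_
    filter_upwards [Ico_mem_nhdsLT hsτ₁] with τ hτ
    rw [slope_def_field]
    have hnum : 0 < v₁ ⬝ᵥ U τ *ᵥ v₁ - v₁ ⬝ᵥ U τ₁ *ᵥ v₁ := by
      have := hbefore τ hτ v₁ hv₁'
      linarith
    exact (div_neg_of_pos_of_neg hnum (by linarith [hτ.2])).le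
  exact absurd hpos (not_lt.2 hnonpos)

/-- **Lemma 6.4, version for all `v ≠ 0`**: under the hypotheses of `rayleigh_barrier`, with the
initial bound `β|v|² < ⟨𝒰(s)v, v⟩` for `v ≠ 0`, one has `β|v|² < ⟨𝒰(t)v, v⟩` for all
`t ∈ [s, T]`, `v ≠ 0`. [cite: LiQingShi2017, Lemma 6.4] -/
theorem rayleigh_barrier' {U R : ℝ → Matrix ι ι ℝ} {s T b β : ℝ} (hβ : |β| < b)
    (hU : ∀ t ∈ Icc s T, HasDerivAt U (-(R t) - U t * U t) t)
    (hsymm : ∀ t ∈ Icc s T, (U t).IsSymm)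
    (hR : ∀ t ∈ Icc s T, ∀ v : ι → ℝ, b ^ 2 * (v ⬝ᵥ v) ≤ -(v ⬝ᵥ R t *ᵥ v))
    (h0 : ∀ v : ι → ℝ, v ≠ 0 → β * (v ⬝ᵥ v) < v ⬝ᵥ U s *ᵥ v) :
    ∀ t ∈ Icc s T, ∀ v : ι → ℝ, v ≠ 0 → β * (v ⬝ᵥ v) < v ⬝ᵥ U t *ᵥ v := by
  have h0' : ∀ v : ι → ℝ, v ⬝ᵥ v = 1 → β < v ⬝ᵥ U s *ᵥ v := by
    intro v hv
    have hv0 : v ≠ 0 := fun h ↦ by simp [h] at hv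
    simpa [hv] using h0 v hv0
  have key := rayleigh_barrier hβ hU hsymm hR h0'
  intro t ht v hv
  have hp : 0 < v ⬝ᵥ v := dotProduct_self_pos' hv
  set c := (Real.sqrt (v ⬝ᵥ v))⁻¹ with hc
  have hc2 : c ^ 2 = (v ⬝ᵥ v)⁻¹ := by
    rw [hc, inv_pow, Real.sq_sqrt hp.le]
  have hunit : (c • v) ⬝ᵥ (c • v) = 1 := by
    rw [smul_dotProduct, dotProduct_smul, smul_eq_mul, smul_eq_mul, ← mul_assoc, ← sq, hc2,
      inv_mul_cancel₀ hp.ne']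
  have h := key t ht (c • v) hunit
  rw [Matrix.mulVec_smul, smul_dotProduct, dotProduct_smul, smul_eq_mul, smul_eq_mul,
    ← mul_assoc, ← sq, hc2, ← div_eq_inv_mul, lt_div_iff₀ hp] at h
  exact h

end MatrixLayer

/-! ### §C. Prop. 6.7: the trace inequality `(tr 𝒰)² - tr 𝒰² ≥ (n-1)² μ_M μ_m` and the Jacobi
determinant -/

section TraceInequality

variable {ι : Type*} [Fintype ι] [DecidableEq ι]

omit [DecidableEq ι] in
/-- **Finite-sum form of the key inequality of Prop. 6.7**: if `m ≤ μᵢ ≤ M` for all `i` with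
`m ≤ 0 ≤ M`, then `Σ_{i ≠ j} μᵢ μⱼ = (Σ μᵢ)² - Σ μᵢ² ≥ (#ι)² M m` — every product `μᵢμⱼ` is
`≥ M m` (it is `≥ 0` for equal signs and `≥ m · M` for opposite signs), and there are at most
`(#ι)²` off-diagonal pairs (Li–Qing–Shi 2017, proof of Prop. 6.7:
"`Σ_{i≠j} μᵢμⱼ ≥ Σ_{μᵢμⱼ<0} μᵢμⱼ ≥ 2(n-1)² μ_m`", where `M = μ_M ≤ 2`).
[cite: LiQingShi2017, Prop. 6.7 (proof)] -/
theorem sq_sum_sub_sum_sq_ge {μ : ι → ℝ} {m M : ℝ} (hm : m ≤ 0) (hM : 0 ≤ M)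
    (hlo : ∀ i, m ≤ μ i) (hhi : ∀ i, μ i ≤ M) :
    (Fintype.card ι : ℝ) ^ 2 * (M * m) ≤ (∑ i, μ i) ^ 2 - ∑ i, μ i ^ 2 := by
  classical
  -- every product is `≥ M m`
  have hprod : ∀ i j, M * m ≤ μ i * μ j := by
    intro i j
    rcases le_or_gt 0 (μ i) with hi | hi <;> rcases le_or_gt 0 (μ j) with hj | hj
    · exact (mul_nonpos_of_nonneg_of_nonpos hM hm).trans (mul_nonneg hi hj)
    · calc M * m ≤ μ i * m := mul_le_mul_of_nonpos_right (hhi i) hm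
        _ ≤ μ i * μ j := mul_le_mul_of_nonneg_left (hlo j) hi
    · calc M * m ≤ μ j * m := mul_le_mul_of_nonpos_right (hhi j) hm
        _ ≤ μ j * μ i := mul_le_mul_of_nonneg_left (hlo i) hj
        _ = μ i * μ j := mul_comm _ _
    · exact (mul_nonpos_of_nonneg_of_nonpos hM hm).trans (mul_nonneg_of_nonpos_of_nonpos
        hi.le hj.le)
  -- `(Σ μ)² - Σ μ² = Σ_i Σ_{j ≠ i} μ_i μ_j`
  have hsq : (∑ i, μ i) ^ 2 - ∑ i, μ i ^ 2 = ∑ i, ∑ j ∈ Finset.univ.erase i, μ i * μ j := by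
    rw [sq, Finset.sum_mul_sum, ← Finset.sum_sub_distrib]
    refine Finset.sum_congr rfl fun i _ ↦ ?_
    rw [Finset.sum_erase_eq_sub (Finset.mem_univ i), sq]
  rw [hsq]
  have hcard : ∀ i : ι, ((Finset.univ.erase i).card : ℝ) = Fintype.card ι - 1 := by
    intro i
    rw [Finset.card_erase_of_mem (Finset.mem_univ i), Finset.card_univ, Nat.cast_sub, Nat.cast_one]
    exact Fintype.card_pos_iff.2 ⟨i⟩
  have hinner : ∀ i, ((Fintype.card ι : ℝ) - 1) * (M * m) ≤ ∑ j ∈ Finset.univ.erase i, μ i * μ j := by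
    intro i
    calc ((Fintype.card ι : ℝ) - 1) * (M * m)
        = ∑ _j ∈ Finset.univ.erase i, M * m := by rw [Finset.sum_const, nsmul_eq_mul, hcard i]
      _ ≤ ∑ j ∈ Finset.univ.erase i, μ i * μ j := Finset.sum_le_sum fun j _ ↦ hprod i j
  have houter : (Fintype.card ι : ℝ) * (((Fintype.card ι : ℝ) - 1) * (M * m)) ≤
      ∑ i, ∑ j ∈ Finset.univ.erase i, μ i * μ j := by
    calc (Fintype.card ι : ℝ) * (((Fintype.card ι : ℝ) - 1) * (M * m))
        = ∑ _i : ι, ((Fintype.card ι : ℝ) - 1) * (M * m) := by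
          rw [Finset.sum_const, nsmul_eq_mul, Finset.card_univ]
      _ ≤ ∑ i, ∑ j ∈ Finset.univ.erase i, μ i * μ j := Finset.sum_le_sum fun i _ ↦ hinner i
  have hMm : M * m ≤ 0 := mul_nonpos_of_nonneg_of_nonpos hM hm
  have hc0 : (0 : ℝ) ≤ Fintype.card ι := Nat.cast_nonneg _
  nlinarith

/-- For a real symmetric matrix, `tr(U²) = Σ λᵢ²` over the eigenvalues (spectral theorem).
[folklore] -/
theorem trace_mul_self_eq_sum_eigenvalues_sq {U : Matrix ι ι ℝ} (hU : U.IsHermitian) :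
    (U * U).trace = ∑ i, hU.eigenvalues i ^ 2 := by
  have hspec := hU.spectral_theorem
  set u := hU.eigenvectorUnitary with hu
  set D : Matrix ι ι ℝ := Matrix.diagonal (RCLike.ofReal ∘ hU.eigenvalues) with hD
  rw [Unitary.conjStarAlgAut_apply] at hspec
  have hstar : star (u : Matrix ι ι ℝ) * (u : Matrix ι ι ℝ) = 1 := Unitary.coe_star_mul_self u
  have hUU : U * U = (u : Matrix ι ι ℝ) * (D * D) * star (u : Matrix ι ι ℝ) := by
    conv_lhs => rw [hspec]
    simp only [Matrix.mul_assoc]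
    congr 1
    rw [← Matrix.mul_assoc (star (u : Matrix ι ι ℝ)), hstar, Matrix.one_mul, ← Matrix.mul_assoc]
  rw [hUU, Matrix.trace_mul_cycle, hstar, Matrix.one_mul, hD, Matrix.diagonal_mul_diagonal,
    Matrix.trace_diagonal]
  simp [sq]

/-- The eigenvalues of a real symmetric matrix lie between the bounds of its Rayleigh quotient:
if `m|v|² ≤ ⟨U v, v⟩ ≤ M|v|²` for all `v` then `m ≤ λᵢ ≤ M`. [folklore] -/
theorem eigenvalues_mem_Icc_of_rayleigh {U : Matrix ι ι ℝ} (hU : U.IsHermitian) {m M : ℝ}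
    (hlo : ∀ v : ι → ℝ, m * (v ⬝ᵥ v) ≤ v ⬝ᵥ U *ᵥ v) (hhi : ∀ v : ι → ℝ, v ⬝ᵥ U *ᵥ v ≤ M * (v ⬝ᵥ v))
    (i : ι) : hU.eigenvalues i ∈ Icc m M := by
  set e : ι → ℝ := (hU.eigenvectorBasis i).ofLp with he
  have hmul : U *ᵥ e = hU.eigenvalues i • e := hU.mulVec_eigenvectorBasis i
  have hunit : e ⬝ᵥ e = 1 := by
    have h1 : ‖hU.eigenvectorBasis i‖ = 1 := hU.eigenvectorBasis.orthonormal.1 i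
    have h2 := EuclideanSpace.inner_eq_star_dotProduct (hU.eigenvectorBasis i)
      (hU.eigenvectorBasis i)
    rw [real_inner_self_eq_norm_sq, h1, one_pow, star_trivial] at h2
    rw [he]; exact h2.symm
  have hray : e ⬝ᵥ U *ᵥ e = hU.eigenvalues i := by
    rw [hmul, dotProduct_smul, smul_eq_mul, hunit, mul_one]
  constructor
  · have := hlo e; rw [hunit, mul_one, hray] at this; exact this
  · have := hhi e; rw [hunit, mul_one, hray] at this; exact this

/-- **The key pointwise inequality of Prop. 6.7, matrix form**: for a real symmetric matrix `𝒰`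
whose Rayleigh quotient lies in `[m, M]` with `m ≤ 0 ≤ M` (`m = μ_m`, `M = μ_M`),
`(tr 𝒰)² - tr(𝒰²) ≥ (#ι)² M m` — i.e. "`(Δt)² - |∇²t|² = Σ_{i≠j} μᵢμⱼ ≥ 2(n-1)² μ_m`" when
`μ_M ≤ 2` (Li–Qing–Shi 2017, proof of Prop. 6.7, using the sharp upper bound (6.5)).
[cite: LiQingShi2017, Prop. 6.7 (proof)] -/
theorem sq_trace_sub_trace_mul_self_ge {U : Matrix ι ι ℝ} (hU : U.IsSymm) {m M : ℝ}
    (hm : m ≤ 0) (hM : 0 ≤ M)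
    (hlo : ∀ v : ι → ℝ, m * (v ⬝ᵥ v) ≤ v ⬝ᵥ U *ᵥ v) (hhi : ∀ v : ι → ℝ, v ⬝ᵥ U *ᵥ v ≤ M * (v ⬝ᵥ v)) :
    (Fintype.card ι : ℝ) ^ 2 * (M * m) ≤ U.trace ^ 2 - (U * U).trace := by
  have hH := Matrix.isHermitian_iff_isSymm.mpr hU
  have htr : U.trace = ∑ i, hH.eigenvalues i := by
    have := hH.trace_eq_sum_eigenvalues; simpa using this
  rw [htr, trace_mul_self_eq_sum_eigenvalues_sq hH]
  exact sq_sum_sub_sum_sq_ge hm hM (fun i ↦ (eigenvalues_mem_Icc_of_rayleigh hH hlo hhi i).1)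
    (fun i ↦ (eigenvalues_mem_Icc_of_rayleigh hH hlo hhi i).2)

/-- `μ_m ≥ H - (#ι - 1) μ_M` in Rayleigh form: if the quotient of the symmetric `U` is `≤ M`
everywhere then `tr U - (#ι - 1) M ≤ λᵢ` for every eigenvalue — "`Ddt(v, v) ≥ μ_m ≥ H - C`"
(Li–Qing–Shi 2017, proof of Prop. 6.7 and of Thm. 6.8). [cite: LiQingShi2017, Prop. 6.7 (proof)] -/
theorem trace_sub_le_eigenvalues {U : Matrix ι ι ℝ} (hU : U.IsHermitian) {M : ℝ}
    (hhi : ∀ v : ι → ℝ, v ⬝ᵥ U *ᵥ v ≤ M * (v ⬝ᵥ v)) (i : ι) :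
    U.trace - ((Fintype.card ι : ℝ) - 1) * M ≤ hU.eigenvalues i := by
  classical
  have htr : U.trace = ∑ j, hU.eigenvalues j := by
    have := hU.trace_eq_sum_eigenvalues; simpa using this
  have hle : ∀ j, hU.eigenvalues j ≤ M := by
    intro j
    set e : ι → ℝ := (hU.eigenvectorBasis j).ofLp with he
    have hmul : U *ᵥ e = hU.eigenvalues j • e := hU.mulVec_eigenvectorBasis j
    have hunit : e ⬝ᵥ e = 1 := by
      have h1 : ‖hU.eigenvectorBasis j‖ = 1 := hU.eigenvectorBasis.orthonormal.1 j
      have h2 := EuclideanSpace.inner_eq_star_dotProduct (hU.eigenvectorBasis j)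
        (hU.eigenvectorBasis j)
      rw [real_inner_self_eq_norm_sq, h1, one_pow, star_trivial] at h2
      rw [he]; exact h2.symm
    have := hhi e
    rwa [hmul, dotProduct_smul, smul_eq_mul, hunit, mul_one, mul_one] at this
  rw [htr, ← Finset.add_sum_erase Finset.univ _ (Finset.mem_univ i)]
  have hsum : ∑ j ∈ Finset.univ.erase i, hU.eigenvalues j ≤ ((Fintype.card ι : ℝ) - 1) * M := by
    calc ∑ j ∈ Finset.univ.erase i, hU.eigenvalues j ≤ ∑ _j ∈ Finset.univ.erase i, M :=
          Finset.sum_le_sum fun j _ ↦ hle j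
      _ = ((Fintype.card ι : ℝ) - 1) * M := by
          rw [Finset.sum_const, nsmul_eq_mul, Finset.card_erase_of_mem (Finset.mem_univ i),
            Finset.card_univ, Nat.cast_sub (Fintype.card_pos_iff.2 ⟨i⟩), Nat.cast_one]
  linarith

end TraceInequality

/-! ### §D. The Jacobi determinant `𝒥 = det 𝒜` and the mean curvature `H = tr 𝒜'𝒜⁻¹`
(Li–Qing–Shi 2017, (6.13), (6.16)) -/

section JacobiDeterminant

open scoped Matrix.Norms.Operator

variable {ι : Type*} [Fintype ι] [DecidableEq ι]

/-- **(6.16): `d/ds (H𝒥) = (H' + H²)𝒥 = (-Ric(γ',γ') - |∇²t|² + H²)𝒥`**, matrix form: along a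
solution of the Jacobi equation `𝒜'' + ℛ𝒜 = 0` with `det 𝒜 ≠ 0`, for `H = tr 𝒜'𝒜⁻¹` and
`𝒥 = det 𝒜` (first variation `𝒥' = H𝒥`, (6.13), `hasDerivAt_det_jacobi`; traced Riccati
equation `H' = -tr ℛ - tr 𝒰²`, `hasDerivAt_trace_shape`).
[cite: LiQingShi2017, Prop. 6.7 (6.16)] -/
theorem hasDerivAt_trace_mul_det {A A' R : ℝ → Matrix ι ι ℝ} {t : ℝ}
    (hA : HasDerivAt A (A' t) t) (hA' : HasDerivAt A' (-(R t * A t)) t)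
    (hdet : (A t).det ≠ 0) :
    HasDerivAt (fun s ↦ (A' s * (A s)⁻¹).trace * (A s).det)
      ((-(R t).trace - ((A' t * (A t)⁻¹) * (A' t * (A t)⁻¹)).trace +
        (A' t * (A t)⁻¹).trace ^ 2) * (A t).det) t := by
  have hdet' : IsUnit (A t).det := isUnit_iff_ne_zero.2 hdet
  have h := (hasDerivAt_trace_shape hA hA' hdet').mul (hasDerivAt_det_jacobi hA hdet)
  exact h.congr_deriv (by ring)

/-- **Prop. 6.5 (6.15), matrix form**: along a solution of `𝒜'' + ℛ𝒜 = 0` on `[t₀, t]` with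
`det 𝒜 > 0` and mean curvature `H = tr 𝒜'𝒜⁻¹ ≤ K`, the Jacobi determinant grows at most like
`det 𝒜(t) ≤ det 𝒜(t₀) e^{K(t - t₀)}` ("considering `U^δ_r` as a graph … induced by exponential
map at `p`", `K = (n-1)(1 - δ/(4(n-1)))` from Lemma 6.4). [cite: LiQingShi2017, Prop. 6.5 (6.15)] -/
theorem det_le_det_mul_exp {A A' : ℝ → Matrix ι ι ℝ} {t₀ t K : ℝ} (ht : t₀ ≤ t)
    (hA : ∀ s ∈ Icc t₀ t, HasDerivAt A (A' s) s) (hdet : ∀ s ∈ Icc t₀ t, 0 < (A s).det)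
    (hH : ∀ s ∈ Icc t₀ t, (A' s * (A s)⁻¹).trace ≤ K) :
    (A t).det ≤ (A t₀).det * Real.exp (K * (t - t₀)) :=
  le_mul_exp_of_deriv_eq_mul (J := fun s ↦ (A s).det) (H := fun s ↦ (A' s * (A s)⁻¹).trace) ht
    (fun s hs ↦ hasDerivAt_det_jacobi (hA s hs) (hdet s hs).ne') (fun s hs ↦ (hdet s hs).le) hH

/-- **Prop. 6.7, (6.19) ⇒ (6.20) for `F = H𝒥`**: if along the Jacobi tensor on `[t₁, t₂]`
`(H𝒥)' ≥ k H𝒥 - C 𝒥` (the pointwise inequality (6.19), from `hasDerivAt_trace_mul_det`,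
`sq_trace_sub_trace_mul_self_ge`, `-tr ℛ ≥ 0` and `μ_m ≥ H - C`), then
`H𝒥(t₂) ≥ e^{k(t₂-t₁)} H𝒥(t₁) - C e^{kt₂} ∫_{t₁}^{t₂} e^{-ks} 𝒥(s) ds`.
[cite: LiQingShi2017, Prop. 6.7 (6.20)] -/
theorem trace_mul_det_ge {A A' R : ℝ → Matrix ι ι ℝ} {t₁ t₂ k C : ℝ} (ht : t₁ ≤ t₂)
    (hA : ∀ s ∈ Icc t₁ t₂, HasDerivAt A (A' s) s)
    (hA' : ∀ s ∈ Icc t₁ t₂, HasDerivAt A' (-(R s * A s)) s)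
    (hdet : ∀ s ∈ Icc t₁ t₂, (A s).det ≠ 0)
    (hineq : ∀ s ∈ Icc t₁ t₂,
      k * ((A' s * (A s)⁻¹).trace * (A s).det) - C * (A s).det ≤
        (-(R s).trace - ((A' s * (A s)⁻¹) * (A' s * (A s)⁻¹)).trace +
          (A' s * (A s)⁻¹).trace ^ 2) * (A s).det) :
    Real.exp (k * (t₂ - t₁)) * ((A' t₁ * (A t₁)⁻¹).trace * (A t₁).det) -
        C * Real.exp (k * t₂) * ∫ s in t₁..t₂, Real.exp (-k * s) * (A s).det ≤
      (A' t₂ * (A t₂)⁻¹).trace * (A t₂).det :=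
  exp_mul_sub_integral_le_of_deriv_ge (F := fun s ↦ (A' s * (A s)⁻¹).trace * (A s).det)
    (J := fun s ↦ (A s).det) ht (fun s hs ↦ hasDerivAt_trace_mul_det (hA s hs) (hA' s hs) (hdet s hs))
    (fun s hs ↦ (hasDerivAt_matrix_det (hA s hs) (hdet s hs)).continuousAt.continuousWithinAt)
    hineq

/-- **Prop. 6.7, the pointwise inequality (6.19)**, matrix form: if the symmetric `𝒰` has
Rayleigh quotient in `[m, M]` with `m ≤ 0 ≤ M`, `-tr ℛ ≥ 0` (i.e. `-Ric(γ', γ') ≥ 0`, which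
(1.9) gives for `t` large) and `𝒥 ≥ 0`, then the right-hand side of (6.16) is bounded below:
`(-tr ℛ - tr 𝒰² + (tr 𝒰)²)𝒥 ≥ (#ι)² M m 𝒥` ("`d/ds(H𝒥) ≥ 2(n-1)²H𝒥 - C𝒥`" after
`m = μ_m ≥ H - C`, `M = μ_M ≤ 2`). [cite: LiQingShi2017, Prop. 6.7 (6.19)] -/
theorem deriv_trace_mul_det_ge {U R : Matrix ι ι ℝ} (hU : U.IsSymm) {m M J : ℝ} (hm : m ≤ 0)
    (hM : 0 ≤ M) (hlo : ∀ v : ι → ℝ, m * (v ⬝ᵥ v) ≤ v ⬝ᵥ U *ᵥ v)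
    (hhi : ∀ v : ι → ℝ, v ⬝ᵥ U *ᵥ v ≤ M * (v ⬝ᵥ v)) (hR : R.trace ≤ 0) (hJ : 0 ≤ J) :
    (Fintype.card ι : ℝ) ^ 2 * (M * m) * J ≤ (-R.trace - (U * U).trace + U.trace ^ 2) * J := by
  have h := sq_trace_sub_trace_mul_self_ge hU hm hM hlo hhi
  exact mul_le_mul_of_nonneg_right (by linarith) hJ

/-- The model `a coth(at)`: `a cosh(at)/sinh(at) - 1/t → 0` as `t ↓ 0` (from the case `a = 1`,
`tendsto_card_mul_coth_sub_div`, by rescaling time). [folklore] -/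
theorem tendsto_mul_coth_mul_sub_inv {a : ℝ} (ha : 0 < a) :
    Tendsto (fun t ↦ a * (Real.cosh (a * t) / Real.sinh (a * t)) - t⁻¹) (𝓝[>] 0) (𝓝 0) := by
  have h1 := tendsto_card_mul_coth_sub_div (ι := Unit)
  simp only [Fintype.card_unit, Nat.cast_one, one_mul, one_div] at h1
  have hsc : Tendsto (fun t : ℝ ↦ a * t) (𝓝[>] 0) (𝓝[>] 0) := by
    refine tendsto_nhdsWithin_of_tendsto_nhds_of_eventually_within _ ?_ ?_
    · have : Tendsto (fun t : ℝ ↦ a * t) (𝓝 0) (𝓝 (a * 0)) :=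
        (continuous_const.mul continuous_id).tendsto 0
      rw [mul_zero] at this
      exact this.mono_left nhdsWithin_le_nhds
    · filter_upwards [self_mem_nhdsWithin] with t ht
      exact mul_pos ha ht
  have h2 := (h1.comp hsc).const_mul a
  rw [mul_zero] at h2
  refine h2.congr' ?_
  filter_upwards [self_mem_nhdsWithin] with t ht
  have ht0 : (t : ℝ) ≠ 0 := ne_of_gt ht
  simp only [Function.comp_def]
  field_simp

/-- **Hessian comparison in every direction (the input `μ_M(t₀) ≤ C` of Cor. 6.2, replacing
Lemma 6.1 along one geodesic):** along a solution of the Jacobi equation `𝒜'' + ℛ𝒜 = 0` with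
`𝒜(0) = 0`, `𝒜'(0) = I`, `ℛ` symmetric and continuous at `0`, no conjugate point on `(0, b)`,
and the lower sectional bound `-⟨ℛ(t)v, v⟩ ≤ a²|v|²` (`K ≥ -a²`) on `(0, b)`, every Rayleigh
quotient of `𝒰 = 𝒜'𝒜⁻¹` satisfies `⟨𝒰(t)v, v⟩/|v|² ≤ a coth(at)` on `(0, b)` — the classical
estimate `∇²t ≤ a coth(at) g` under `K ≥ -a²` (the standard Riccati comparison, Lee 2018,
Thm. 11.7; Li–Qing–Shi 2017, §6.1: "one indeed can manage to get the desired upper bound for the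
principal curvature, by the nature of the Riccati equations in general (cf. [ST, HQS])"). Proof:
the quotient is a sub-solution of `u' + u² = a²` with `u - 1/t → 0` (`𝒰 - t⁻¹I → 0`,
`jacobi_tendsto_shape_sub_inv_smul_one`), compared with `a coth(at)` by `riccati_comparison`.
[cite: LiQingShi2017, §6.1 (6.1)–(6.2)] [cite: Chavel2006, Thm. III.4.3 (proof)] -/
theorem rayleigh_shape_le_coth {A A' R : ℝ → Matrix ι ι ℝ} {a₀ b a : ℝ} (ha : 0 < a)
    (h0 : (0 : ℝ) ∈ Ioo a₀ b)
    (hA : ∀ t ∈ Ioo a₀ b, HasDerivAt A (A' t) t)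
    (hA' : ∀ t ∈ Ioo a₀ b, HasDerivAt A' (-(R t * A t)) t)
    (hR : ∀ t ∈ Ioo a₀ b, (R t).IsSymm) (hRc : ContinuousAt R 0)
    (hA0 : A 0 = 0) (hA'0 : A' 0 = 1)
    (hdet : ∀ t ∈ Ioo 0 b, (A t).det ≠ 0)
    (hK : ∀ t ∈ Ioo 0 b, ∀ v : ι → ℝ, -(v ⬝ᵥ R t *ᵥ v) ≤ a ^ 2 * (v ⬝ᵥ v))
    {v : ι → ℝ} (hv : v ≠ 0) :
    ∀ t ∈ Ioo 0 b, (v ⬝ᵥ (A' t * (A t)⁻¹) *ᵥ v) / (v ⬝ᵥ v) ≤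
      a * (Real.cosh (a * t) / Real.sinh (a * t)) := by
  have hp : 0 < v ⬝ᵥ v := dotProduct_self_pos' hv
  have hab : ∀ t ∈ Ioo 0 b, t ∈ Ioo a₀ b := fun t ht ↦ ⟨h0.1.trans ht.1, ht.2⟩
  have hunit : ∀ t ∈ Ioo 0 b, IsUnit (A t).det := fun t ht ↦ isUnit_iff_ne_zero.2 (hdet t ht)
  have hW := jacobi_wronskian_eq_zero h0 hA hA' hR hA0
  have hUsymm : ∀ t ∈ Ioo 0 b, (A' t * (A t)⁻¹).IsSymm := fun t ht ↦
    isSymm_mul_inv_of_wronskian_eq_zero (hW t (hab t ht)) (hunit t ht)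
  set U : ℝ → Matrix ι ι ℝ := fun t ↦ A' t * (A t)⁻¹ with hU_def
  have hUd : ∀ t ∈ Ioo 0 b, HasDerivAt U (-(R t) - U t * U t) t := fun t ht ↦
    hasDerivAt_shape_riccati (hA t (hab t ht)) (hA' t (hab t ht)) (hunit t ht)
  set φ : ℝ → ℝ := fun t ↦ (v ⬝ᵥ U t *ᵥ v) / (v ⬝ᵥ v) with hφ
  set φ' : ℝ → ℝ := fun t ↦ (v ⬝ᵥ (-(R t) - U t * U t) *ᵥ v) / (v ⬝ᵥ v) with hφ'
  have hφd : ∀ t ∈ Ioo 0 b, HasDerivAt φ (φ' t) t := fun t ht ↦ hasDerivAt_rayleigh (hUd t ht) v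
  have hric : ∀ t ∈ Ioo 0 b, φ' t + φ t ^ 2 - a ^ 2 ≤ 0 := by
    intro t ht
    have h1 := rayleigh_riccati_le (R := R t) (hUsymm t ht) hv
    have h2 : -(v ⬝ᵥ R t *ᵥ v) / (v ⬝ᵥ v) ≤ a ^ 2 := by
      rw [div_le_iff₀ hp]; exact hK t ht v
    simp only [hφ, hφ']
    linarith
  -- initial behaviour: `φ - 1/t → 0`
  have hlim0 : Tendsto (fun t ↦ φ t - t⁻¹) (𝓝[>] 0) (𝓝 0) := by
    have hmat := jacobi_tendsto_shape_sub_inv_smul_one h0 hA hA' hRc hA0 hA'0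
    let L : Matrix ι ι ℝ →ₗ[ℝ] ℝ :=
      { toFun := fun M ↦ (v ⬝ᵥ M *ᵥ v) / (v ⬝ᵥ v)
        map_add' := fun M N ↦ by
          simp only [Matrix.add_mulVec, dotProduct_add, add_div]
        map_smul' := fun c M ↦ by
          simp only [Matrix.smul_mulVec, dotProduct_smul, smul_eq_mul, RingHom.id_apply,
            mul_div_assoc] }
    have hLc : Continuous L := L.continuous_of_finiteDimensional
    have h2 := (hLc.tendsto 0).comp hmat
    rw [map_zero] at h2
    refine h2.congr' ?_
    filter_upwards [self_mem_nhdsWithin] with t ht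
    simp only [Function.comp_def, hφ]
    show (v ⬝ᵥ (A' t * (A t)⁻¹ - t⁻¹ • (1 : Matrix ι ι ℝ)) *ᵥ v) / (v ⬝ᵥ v) = _
    rw [Matrix.sub_mulVec, Matrix.smul_mulVec, Matrix.one_mulVec, dotProduct_sub,
      dotProduct_smul, smul_eq_mul, sub_div, mul_div_assoc, div_self hp.ne', mul_one]
  have hlim : Tendsto (fun t ↦ φ t - a * (Real.cosh (a * t) / Real.sinh (a * t)))
      (𝓝[>] 0) (𝓝 0) := by
    have L := hlim0.sub (tendsto_mul_coth_mul_sub_inv ha)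
    rw [sub_zero] at L
    refine L.congr (fun t ↦ ?_)
    ring
  -- the model `H = a coth(at)` solves `H' + H² - a² = 0`
  have hsinh : ∀ t ∈ Ioo 0 b, 0 < Real.sinh (a * t) :=
    fun t ht ↦ Real.sinh_pos_iff.2 (mul_pos ha ht.1)
  have key := riccati_comparison (H := fun t ↦ a * (Real.cosh (a * t) / Real.sinh (a * t)))
    (Hc := φ) (Hc' := φ')
    (H' := fun t ↦ a * ((Real.sinh (a * t) * a * Real.sinh (a * t) -
      Real.cosh (a * t) * (Real.cosh (a * t) * a)) / Real.sinh (a * t) ^ 2))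
    (S := fun _ ↦ -a ^ 2) (Sc := fun _ ↦ -a ^ 2) (m := -a ^ 2) (a := 0) (b := b)
    (fun t ht ↦ ?_) hφd (fun t ht ↦ ?_) (fun t ht ↦ by linarith [hric t ht]) (fun _ _ ↦ le_rfl)
    (fun _ _ ↦ le_rfl) (fun ε hε ↦ ?_)
  · exact key
  · have hc : HasDerivAt (fun t ↦ Real.cosh (a * t)) (Real.sinh (a * t) * a) t := by
      have h := ((hasDerivAt_id' t).const_mul a).cosh
      simp only [mul_one] at h
      exact h
    have hs : HasDerivAt (fun t ↦ Real.sinh (a * t)) (Real.cosh (a * t) * a) t := by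
      have h := ((hasDerivAt_id' t).const_mul a).sinh
      simp only [mul_one] at h
      exact h
    exact (hc.div hs (hsinh t ht).ne').const_mul a
  · have hs := (hsinh t ht).ne'
    field_simp
    nlinarith [Real.cosh_sq_sub_sinh_sq (a * t)]
  · have := (tendsto_order.1 hlim).2 ε hε
    filter_upwards [this] with t ht
    exact ht

end JacobiDeterminant

/-! ### §E. The angle between `∇t` and `∇r` (Li–Qing–Shi 2017, Lemma 4.1–4.2, ODE content)

Along a minimal geodesic from `p₀`, `φ = g⁺(∇t, ∇r)` satisfies (4.6)
`dφ/dt = ∇²r(∇t, ∇t) = (1 - φ²) ∇²r(v, v)` with `|φ| ≤ 1`, where `∇²r(v, v) > 1/2` for `r`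
large (and `= 1 + O(e^{-2r})`, (4.3)). Lemma 4.2: `φ > 0` from the time the geodesic exits
`Σ_{r₀}`; Lemma 4.1, (4.5): `g⁺(∇t, ∇r) = 1 + O(e^{-2t})`. The one-variable content: -/

section Angle

/-- **Grönwall's inequality with a differentiable exponent**: `ψ' ≤ Q'ψ` on `[t₀, t]` implies
`ψ(t) ≤ ψ(t₀) e^{Q(t) - Q(t₀)}` (no sign condition on `ψ`). [folklore] -/
theorem le_mul_exp_sub_of_deriv_le {ψ ψ' Q q : ℝ → ℝ} {t₀ t : ℝ} (ht : t₀ ≤ t)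
    (hψ : ∀ s ∈ Icc t₀ t, HasDerivAt ψ (ψ' s) s) (hQ : ∀ s ∈ Icc t₀ t, HasDerivAt Q (q s) s)
    (hle : ∀ s ∈ Icc t₀ t, ψ' s ≤ q s * ψ s) : ψ t ≤ ψ t₀ * Real.exp (Q t - Q t₀) := by
  set G : ℝ → ℝ := fun s ↦ Real.exp (-Q s) * ψ s with hG_def
  have hG : ∀ s ∈ Icc t₀ t, HasDerivAt G
      (Real.exp (-Q s) * (-q s) * ψ s + Real.exp (-Q s) * ψ' s) s :=
    fun s hs ↦ ((hQ s hs).neg.exp).mul (hψ s hs)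
  have hanti : AntitoneOn G (Icc t₀ t) := by
    refine antitoneOn_of_hasDerivWithinAt_nonpos (convex_Icc t₀ t)
      (f' := fun s ↦ Real.exp (-Q s) * (-q s) * ψ s + Real.exp (-Q s) * ψ' s)
      (fun s hs ↦ (hG s hs).continuousAt.continuousWithinAt) (fun s hs ↦ ?_) (fun s hs ↦ ?_)
    · rw [interior_Icc] at hs
      exact (hG s (Ioo_subset_Icc_self hs)).hasDerivWithinAt
    · rw [interior_Icc] at hs
      have hs' := Ioo_subset_Icc_self hs
      have : Real.exp (-Q s) * (-q s) * ψ s + Real.exp (-Q s) * ψ' s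
          = Real.exp (-Q s) * (ψ' s - q s * ψ s) := by ring
      rw [this]
      exact mul_nonpos_of_nonneg_of_nonpos (Real.exp_pos _).le (by linarith [hle s hs'])
  have key := hanti (left_mem_Icc.2 ht) (right_mem_Icc.2 ht) ht
  simp only [hG_def] at key
  have hexp : 0 < Real.exp (Q t) := Real.exp_pos _
  have h1 : Real.exp (Q t) * Real.exp (-Q t) = 1 := by rw [← Real.exp_add]; simp
  have h2 : Real.exp (Q t) * Real.exp (-Q t₀) = Real.exp (Q t - Q t₀) := by
    rw [sub_eq_add_neg, Real.exp_add]
  have key2 := mul_le_mul_of_nonneg_left key hexp.le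
  rw [← mul_assoc, ← mul_assoc, h1, one_mul, h2] at key2
  linarith [key2]

/-- **Lemma 4.2, one-variable content**: if `φ' = (1 - φ²)h` on `[t₀, T]` with `h > 0` and
`φ(t₀) ≥ 0`, then `φ > 0` on `(t₀, T]` ("in the light of (4.6), it is not hard to see that
`φ > 0` from the time `t₀` when the geodesic `γ` exits from `Σ_{r₀}`. Because `φ ≤ 1` for all
`t` and `φ(t₀) ≥ 0`"). [cite: LiQingShi2017, Lemma 4.2 (proof)] -/
theorem pos_of_deriv_eq_one_sub_sq_mul {φ h : ℝ → ℝ} {t₀ T : ℝ}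
    (hφ : ∀ s ∈ Icc t₀ T, HasDerivAt φ ((1 - φ s ^ 2) * h s) s)
    (hh : ∀ s ∈ Icc t₀ T, 0 < h s) (h0 : 0 ≤ φ t₀) : ∀ t ∈ Ioc t₀ T, 0 < φ t := by
  -- first `φ ≥ 0` on `[t₀, T]` (barrier at `0`: there `φ' = h > 0`)
  have hnn : ∀ t ∈ Icc t₀ T, 0 ≤ φ t := by
    intro t ht
    have hcont : ContinuousOn (fun x ↦ -φ x) (Icc t₀ T) :=
      fun x hx ↦ (hφ x hx).neg.continuousAt.continuousWithinAt
    have h0' : (fun x ↦ -φ x) t₀ ≤ (fun _ ↦ (0 : ℝ)) t₀ := by show -φ t₀ ≤ 0; linarith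
    have key := image_le_of_deriv_right_lt_deriv_boundary' (f := fun x ↦ -φ x)
      (f' := fun x ↦ -((1 - φ x ^ 2) * h x)) (a := t₀) (b := T) hcont
      (fun x hx ↦ (hφ x (Ico_subset_Icc_self hx)).neg.hasDerivWithinAt) (B := fun _ ↦ 0)
      (B' := fun _ ↦ 0) h0' continuousOn_const (fun x _ ↦ hasDerivWithinAt_const _ _ _)
      (fun x hx hxB ↦ ?_) ht
    · have key' : -φ t ≤ 0 := key
      linarith
    have hx0 : φ x = 0 := by have : -φ x = 0 := hxB; linarith
    show -((1 - φ x ^ 2) * h x) < 0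
    rw [hx0]; simpa using hh x (Ico_subset_Icc_self hx)
  -- a zero `t₁ > t₀` would be a minimum with `φ'(t₁) = h(t₁) > 0`
  intro t₁ ht₁
  rcases (hnn t₁ ⟨ht₁.1.le, ht₁.2⟩).eq_or_lt with hz | hpos
  · exfalso
    have hd := hφ t₁ ⟨ht₁.1.le, ht₁.2⟩
    rw [← hz] at hd
    simp only [ne_eq, OfNat.ofNat_ne_zero, not_false_eq_true, zero_pow, sub_zero, one_mul] at hd
    have hslope : Tendsto (slope φ t₁) (𝓝[<] t₁) (𝓝 (h t₁)) :=
      (hasDerivAt_iff_tendsto_slope.1 hd).mono_left (nhdsLT_le_nhdsNE t₁)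
    have hle : h t₁ ≤ 0 := by
      refine le_of_tendsto hslope ?_
      filter_upwards [Ico_mem_nhdsLT ht₁.1] with τ hτ
      rw [slope_def_field, ← hz, sub_zero]
      exact div_nonpos_of_nonneg_of_nonpos (hnn τ ⟨hτ.1, hτ.2.le.trans ht₁.2⟩)
        (by linarith [hτ.2])
    exact absurd (hh t₁ ⟨ht₁.1.le, ht₁.2⟩) (not_lt.2 hle)
  · exact hpos

/-- **Lemma 4.1, (4.5), one-variable content with explicit constant**: if `φ' = (1 - φ²)h` on
`[t₀, t]` (`t₀ ≥ 0`) with `0 ≤ φ ≤ 1`, `h ≥ 1/2` and `|h - 1| ≤ C e^{-2s}` (`C ≥ 0`), then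
`1 - φ(t) ≤ (1 - φ(t₀)) e^{3C + 2} e^{-2(t - t₀)}`: with `ψ = 1 - φ`, `ψ' = -ψ(2 - ψ)h ≤ -ψ/2`
gives `ψ ≤ e^{-(s-t₀)/2}` first, and then `ψ' ≤ (-2 + 2Ce^{-2s} + (1 + C)e^{-(s-t₀)/2})ψ`
integrates to the claim — "`g⁺(∇t, ∇r) = 1 + O(e^{-2t})`". [cite: LiQingShi2017, Lemma 4.1 (4.5)–(4.6)] -/
theorem one_sub_le_of_deriv_eq_one_sub_sq_mul {φ h : ℝ → ℝ} {t₀ t C : ℝ} (ht₀ : 0 ≤ t₀)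
    (ht : t₀ ≤ t) (hC : 0 ≤ C)
    (hφ : ∀ s ∈ Icc t₀ t, HasDerivAt φ ((1 - φ s ^ 2) * h s) s)
    (hφ0 : ∀ s ∈ Icc t₀ t, 0 ≤ φ s) (hφ1 : ∀ s ∈ Icc t₀ t, φ s ≤ 1)
    (hh : ∀ s ∈ Icc t₀ t, 1 / 2 ≤ h s) (hdec : ∀ s ∈ Icc t₀ t, |h s - 1| ≤ C * Real.exp (-2 * s)) :
    1 - φ t ≤ (1 - φ t₀) * Real.exp (3 * C + 2) * Real.exp (-2 * (t - t₀)) := by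
  set ψ : ℝ → ℝ := fun s ↦ 1 - φ s with hψ_def
  have hψd : ∀ s ∈ Icc t₀ t, HasDerivAt ψ (-((1 - φ s ^ 2) * h s)) s :=
    fun s hs ↦ ((hasDerivAt_const s (1 : ℝ)).sub (hφ s hs)).congr_deriv (by ring)
  have hψ0 : ∀ s ∈ Icc t₀ t, 0 ≤ ψ s := fun s hs ↦ by simp only [hψ_def]; linarith [hφ1 s hs]
  have hψ1 : ∀ s ∈ Icc t₀ t, ψ s ≤ 1 := fun s hs ↦ by simp only [hψ_def]; linarith [hφ0 s hs]
  have hid : ∀ s, -((1 - φ s ^ 2) * h s) = -(ψ s * (2 - ψ s) * h s) := fun s ↦ by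
    simp only [hψ_def]; ring
  -- pass 1: `ψ' ≤ -ψ/2`, so `ψ(s) ≤ ψ(t₀) e^{(t₀-s)/2} ≤ e^{(t₀-s)/2}`
  have hpass1 : ∀ s ∈ Icc t₀ t, ψ s ≤ Real.exp ((t₀ - s) / 2) := by
    intro s hs
    have hsub : Icc t₀ s ⊆ Icc t₀ t := Icc_subset_Icc_right hs.2
    have key := le_mul_exp_sub_of_deriv_le (ψ := ψ) (ψ' := fun s ↦ -((1 - φ s ^ 2) * h s))
      (Q := fun s ↦ (t₀ - s) / 2) (q := fun _ ↦ (-1 : ℝ) / 2) hs.1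
      (fun u hu ↦ hψd u (hsub hu)) (fun u _ ↦ ((hasDerivAt_id' u).const_sub t₀).div_const 2)
      (fun u hu ↦ ?_)
    · have hψt₀ : ψ t₀ * Real.exp ((t₀ - s) / 2 - (t₀ - t₀) / 2) ≤ Real.exp ((t₀ - s) / 2) := by
        have : (t₀ - s) / 2 - (t₀ - t₀) / 2 = (t₀ - s) / 2 := by ring
        rw [this]
        have h1 := hψ1 t₀ (left_mem_Icc.2 ht)
        nlinarith [Real.exp_pos ((t₀ - s) / 2)]
      exact key.trans hψt₀
    · rw [hid]
      have hu' := hsub hu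
      have h2 : 1 / 2 ≤ (2 - ψ u) * h u := by nlinarith [hψ1 u hu', hh u hu', hψ0 u hu']
      nlinarith [hψ0 u hu']
  -- pass 2: `ψ' ≤ Q'ψ` with `Q(s) = -2s - Ce^{-2s} - 2(1+C)e^{(t₀-s)/2}`
  set Q : ℝ → ℝ := fun s ↦ -2 * s - C * Real.exp (-2 * s) -
    2 * (1 + C) * Real.exp ((t₀ - s) / 2) with hQ_def
  set q : ℝ → ℝ := fun s ↦ -2 + 2 * C * Real.exp (-2 * s) +
    (1 + C) * Real.exp ((t₀ - s) / 2) with hq_def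
  have hQd : ∀ s ∈ Icc t₀ t, HasDerivAt Q (q s) s := by
    intro s _
    have h1 := hasDerivAt_exp_const_mul (-2) s
    have h2 : HasDerivAt (fun s ↦ Real.exp ((t₀ - s) / 2))
        (Real.exp ((t₀ - s) / 2) * ((-1 : ℝ) / 2)) s :=
      (((hasDerivAt_id' s).const_sub t₀).div_const 2).exp
    have h := (((hasDerivAt_id' s).const_mul (-2 : ℝ)).sub (h1.const_mul C)).sub
      (h2.const_mul (2 * (1 + C)))
    exact h.congr_deriv (by simp only [hq_def]; ring)
  have hle : ∀ s ∈ Icc t₀ t, -((1 - φ s ^ 2) * h s) ≤ q s * ψ s := by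
    intro s hs
    rw [hid]
    have hψs := hψ0 s hs
    have hlow := (abs_le.1 (hdec s hs)).1
    have hhigh := (abs_le.1 (hdec s hs)).2
    have hexp1 : Real.exp (-2 * s) ≤ 1 := Real.exp_le_one_iff.2 (by nlinarith [hs.1])
    have hhC : h s ≤ 1 + C := by nlinarith
    have hp1 := hpass1 s hs
    -- `-(2 - ψ)h = -2 + 2(1 - h) + ψh ≤ -2 + 2Ce^{-2s} + (1 + C)e^{(t₀-s)/2}`
    have hψh : ψ s * h s ≤ Real.exp ((t₀ - s) / 2) * (1 + C) :=
      mul_le_mul hp1 hhC (by linarith [hh s hs]) (Real.exp_pos _).le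
    have hcoef : -((2 - ψ s) * h s) ≤ q s := by
      simp only [hq_def]
      linarith
    have := mul_le_mul_of_nonneg_right hcoef hψs
    linarith
  have key := le_mul_exp_sub_of_deriv_le ht hψd hQd hle
  -- `Q(t) - Q(t₀) ≤ -2(t - t₀) + 3C + 2`
  have hQdiff : Q t - Q t₀ ≤ 3 * C + 2 + -2 * (t - t₀) := by
    simp only [hQ_def]
    have e1 : 0 ≤ Real.exp (-2 * t) := (Real.exp_pos _).le
    have e2 : Real.exp (-2 * t₀) ≤ 1 := Real.exp_le_one_iff.2 (by nlinarith)
    have e3 : 0 ≤ Real.exp ((t₀ - t) / 2) := (Real.exp_pos _).le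
    have e4 : Real.exp ((t₀ - t₀) / 2) = 1 := by simp
    rw [e4]
    nlinarith
  have hmono : Real.exp (Q t - Q t₀) ≤ Real.exp (3 * C + 2) * Real.exp (-2 * (t - t₀)) := by
    rw [← Real.exp_add]; exact Real.exp_le_exp.2 hQdiff
  have hψt₀ := hψ0 t₀ (left_mem_Icc.2 ht)
  calc 1 - φ t = ψ t := rfl
    _ ≤ ψ t₀ * Real.exp (Q t - Q t₀) := key
    _ ≤ ψ t₀ * (Real.exp (3 * C + 2) * Real.exp (-2 * (t - t₀))) :=
        mul_le_mul_of_nonneg_left hmono hψt₀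
    _ = (1 - φ t₀) * Real.exp (3 * C + 2) * Real.exp (-2 * (t - t₀)) := by
        simp only [hψ_def]; ring

end Angle

/-! ### §F. Lemma 6.4, Prop. 6.5 and Prop. 6.7 as printed, in matrix form

The statements of §6.2–§6.3 assembled from §A–§D for an abstract symmetric solution `𝒰` of
`𝒰' = -ℛ - 𝒰²` on `[t_δ, T]` together with a Jacobi determinant `𝒥 > 0`, `𝒥' = H𝒥`,
`H = tr 𝒰` (`m = #ι = n - 1`). The constants of the paper: `b = 1 - δ/2` with
`b² ≤ 1 - C₀e^{-2t}` for `t ≥ t_δ` (the upper sectional bound `K ≤ -b²`), and the sharp upper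
bound `μ_M ≤ M` with `(m - 1)(M - 1) ≤ δ/4` ("`(n-2)C(t+1)e^{-2t} ≤ δ/4` for `t ≥ t_δ`",
Cor. 6.2); `a² ≥ 1 + C₀e^{-2(t-1)}` (the lower sectional bound `K ≥ -a²` used by Lemma 6.6). -/

section Printed

open scoped Matrix.Norms.Operator

variable {ι : Type*} [Fintype ι] [DecidableEq ι]

/-! #### Rayleigh quotient, eigenvalues and trace of a real symmetric matrix -/

/-- The eigenvectors of `Matrix.IsHermitian.eigenvectorBasis` are unit vectors for the dot
product. [folklore] -/
theorem eigenvectorBasis_dotProduct_self {U : Matrix ι ι ℝ} (hU : U.IsHermitian) (i : ι) :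
    (hU.eigenvectorBasis i).ofLp ⬝ᵥ (hU.eigenvectorBasis i).ofLp = 1 := by
  have h1 : ‖hU.eigenvectorBasis i‖ = 1 := hU.eigenvectorBasis.orthonormal.1 i
  have h2 := EuclideanSpace.inner_eq_star_dotProduct (hU.eigenvectorBasis i)
    (hU.eigenvectorBasis i)
  rw [real_inner_self_eq_norm_sq, h1, one_pow, star_trivial] at h2
  exact h2.symm

/-- The Rayleigh quotient at the `i`-th eigenvector is the `i`-th eigenvalue. [folklore] -/
theorem eigenvectorBasis_rayleigh {U : Matrix ι ι ℝ} (hU : U.IsHermitian) (i : ι) :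
    (hU.eigenvectorBasis i).ofLp ⬝ᵥ U *ᵥ (hU.eigenvectorBasis i).ofLp = hU.eigenvalues i := by
  rw [hU.mulVec_eigenvectorBasis i, dotProduct_smul, smul_eq_mul,
    eigenvectorBasis_dotProduct_self, mul_one]

/-- **The smallest eigenvalue bounds the Rayleigh quotient from below** (real symmetric case of
the variational principle): if `m₀ ≤ λᵢ` for all `i` then `m₀|v|² ≤ ⟨U v, v⟩` for all `v`
(spectral theorem: `⟨U v, v⟩ = Σ λᵢ wᵢ²`, `w = Pᵀv`, `|w| = |v|`). [folklore] -/
theorem mul_dotProduct_le_of_eigenvalues_ge {U : Matrix ι ι ℝ} (hU : U.IsHermitian) {m₀ : ℝ}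
    (h : ∀ i, m₀ ≤ hU.eigenvalues i) (v : ι → ℝ) : m₀ * (v ⬝ᵥ v) ≤ v ⬝ᵥ U *ᵥ v := by
  have hspec := hU.spectral_theorem
  set P : Matrix ι ι ℝ := (hU.eigenvectorUnitary : Matrix ι ι ℝ) with hP
  set D : Matrix ι ι ℝ := Matrix.diagonal (RCLike.ofReal ∘ hU.eigenvalues) with hD
  rw [Unitary.conjStarAlgAut_apply] at hspec
  have hstarT : star P = Pᵀ := by
    rw [Matrix.star_eq_conjTranspose, Matrix.conjTranspose_eq_transpose_of_trivial]
  have hPPt : P * Pᵀ = 1 := by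
    rw [← hstarT]; exact Unitary.coe_mul_star_self hU.eigenvectorUnitary
  set w : ι → ℝ := Pᵀ *ᵥ v with hw
  -- `⟨U v, v⟩ = ⟨D w, w⟩` and `|v|² = |w|²`
  have hvP : ∀ z : ι → ℝ, v ⬝ᵥ P *ᵥ z = w ⬝ᵥ z := by
    intro z
    rw [dotProduct_mulVec, ← Matrix.mulVec_transpose]
  have hq : v ⬝ᵥ U *ᵥ v = w ⬝ᵥ D *ᵥ w := by
    conv_lhs => rw [hspec, hstarT]
    rw [← Matrix.mulVec_mulVec, ← Matrix.mulVec_mulVec, hvP]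
  have hn : v ⬝ᵥ v = w ⬝ᵥ w := by
    calc v ⬝ᵥ v = v ⬝ᵥ P *ᵥ (Pᵀ *ᵥ v) := by
          rw [Matrix.mulVec_mulVec, hPPt, Matrix.one_mulVec]
      _ = w ⬝ᵥ (Pᵀ *ᵥ v) := hvP _
      _ = w ⬝ᵥ w := rfl
  rw [hq, hn]
  -- `⟨D w, w⟩ = Σ λᵢ wᵢ² ≥ m₀ Σ wᵢ²`
  have hDw : w ⬝ᵥ D *ᵥ w = ∑ i, hU.eigenvalues i * (w i * w i) := by
    simp only [dotProduct, hD, Matrix.mulVec_diagonal, Function.comp_apply, RCLike.ofReal_real_eq_id,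
      id_eq]
    exact Finset.sum_congr rfl fun i _ ↦ by ring
  rw [hDw, dotProduct, Finset.mul_sum]
  exact Finset.sum_le_sum fun i _ ↦ mul_le_mul_of_nonneg_right (h i) (mul_self_nonneg _)

/-- **`μ_m ≥ H - (m - 1)μ_M`** in Rayleigh form: if `⟨U v, v⟩ ≤ M|v|²` for all `v` (`U` real
symmetric) then `(tr U - (#ι - 1)M)|v|² ≤ ⟨U v, v⟩` for all `v` ("`Ddt(v, v) ≥ μ_m ≥ H - C`",
Li–Qing–Shi 2017, proofs of Lemma 6.4, Prop. 6.7 and Thm. 6.8).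
[cite: LiQingShi2017, Prop. 6.7 (proof)] -/
theorem trace_sub_mul_dotProduct_le {U : Matrix ι ι ℝ} (hU : U.IsSymm) {M : ℝ}
    (hhi : ∀ v : ι → ℝ, v ⬝ᵥ U *ᵥ v ≤ M * (v ⬝ᵥ v)) (v : ι → ℝ) :
    (U.trace - ((Fintype.card ι : ℝ) - 1) * M) * (v ⬝ᵥ v) ≤ v ⬝ᵥ U *ᵥ v :=
  mul_dotProduct_le_of_eigenvalues_ge (Matrix.isHermitian_iff_isSymm.mpr hU)
    (trace_sub_le_eigenvalues (Matrix.isHermitian_iff_isSymm.mpr hU) hhi) v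

/-- **`H > m β` when every Rayleigh quotient exceeds `β`** (each eigenvalue is a Rayleigh
quotient). [folklore] -/
theorem card_mul_lt_trace_of_rayleigh_gt [Nonempty ι] {U : Matrix ι ι ℝ} (hU : U.IsSymm) {β : ℝ}
    (h : ∀ v : ι → ℝ, v ≠ 0 → β * (v ⬝ᵥ v) < v ⬝ᵥ U *ᵥ v) :
    (Fintype.card ι : ℝ) * β < U.trace := by
  have hH := Matrix.isHermitian_iff_isSymm.mpr hU
  have htr : U.trace = ∑ i, hH.eigenvalues i := by
    have := hH.trace_eq_sum_eigenvalues; simpa using this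
  have hgt : ∀ i, β < hH.eigenvalues i := by
    intro i
    have hunit := eigenvectorBasis_dotProduct_self hH i
    have hne : (hH.eigenvectorBasis i).ofLp ≠ 0 := fun h0 ↦ by
      rw [h0, dotProduct_zero] at hunit; exact zero_ne_one hunit
    have := h _ hne
    rwa [hunit, mul_one, eigenvectorBasis_rayleigh] at this
  rw [htr]
  calc (Fintype.card ι : ℝ) * β = ∑ _i : ι, β := by
        rw [Finset.sum_const, nsmul_eq_mul, Finset.card_univ]
    _ < ∑ i, hH.eigenvalues i := Finset.sum_lt_sum_of_nonempty Finset.univ_nonempty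
        fun i _ ↦ hgt i

/-- **`μ_m ≤ H/m`** in Rayleigh form: some unit vector (an eigenvector for the smallest
eigenvalue) has `m ⟨U v, v⟩ ≤ tr U`. [folklore] -/
theorem exists_unit_card_mul_rayleigh_le_trace [Nonempty ι] {U : Matrix ι ι ℝ} (hU : U.IsSymm) :
    ∃ v : ι → ℝ, v ⬝ᵥ v = 1 ∧ (Fintype.card ι : ℝ) * (v ⬝ᵥ U *ᵥ v) ≤ U.trace := by
  have hH := Matrix.isHermitian_iff_isSymm.mpr hU
  have htr : U.trace = ∑ i, hH.eigenvalues i := by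
    have := hH.trace_eq_sum_eigenvalues; simpa using this
  obtain ⟨i₀, -, hi₀⟩ := Finset.exists_min_image Finset.univ hH.eigenvalues Finset.univ_nonempty
  refine ⟨(hH.eigenvectorBasis i₀).ofLp, eigenvectorBasis_dotProduct_self hH i₀, ?_⟩
  rw [eigenvectorBasis_rayleigh, htr]
  calc (Fintype.card ι : ℝ) * hH.eigenvalues i₀ = ∑ _i : ι, hH.eigenvalues i₀ := by
        rw [Finset.sum_const, nsmul_eq_mul, Finset.card_univ]
    _ ≤ ∑ i, hH.eigenvalues i := Finset.sum_le_sum fun i _ ↦ hi₀ i (Finset.mem_univ i)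

/-- A lower bound for the quadratic form `-⟨ℛ v, v⟩ ≥ b'|v|²` bounds `-tr ℛ ≥ m b'` (diagonal
entries): `-Ric(γ', γ') ≥ (n-1) min(-K)`. [folklore] -/
theorem card_mul_le_neg_trace {R : Matrix ι ι ℝ} {b' : ℝ}
    (h : ∀ v : ι → ℝ, b' * (v ⬝ᵥ v) ≤ -(v ⬝ᵥ R *ᵥ v)) :
    (Fintype.card ι : ℝ) * b' ≤ -R.trace := by
  have hdiag : ∀ i, b' ≤ -R i i := by
    intro i
    have h1 : (Pi.single i 1 : ι → ℝ) ⬝ᵥ Pi.single i 1 = 1 := by simp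
    have h2 : (Pi.single i 1 : ι → ℝ) ⬝ᵥ R *ᵥ Pi.single i 1 = R i i := by
      simp [Matrix.col_apply]
    have := h (Pi.single i 1)
    rwa [h1, h2, mul_one] at this
  rw [Matrix.trace, ← Finset.sum_neg_distrib]
  calc (Fintype.card ι : ℝ) * b' = ∑ _i : ι, b' := by
        rw [Finset.sum_const, nsmul_eq_mul, Finset.card_univ]
    _ ≤ ∑ i, -R.diag i := Finset.sum_le_sum fun i _ ↦ hdiag i

/-! #### Lemma 6.4 and Prop. 6.5 as printed -/

/-- **Lemma 6.4 (matrix form, as printed).** On `[s, T]` let `𝒰` be a symmetric solution of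
`𝒰' = -ℛ - 𝒰²` with `K ≤ -(1 - δ/2)²` (`(1 - δ/2)²|v|² ≤ -⟨ℛ v, v⟩`), `μ_M ≤ M`
(`⟨𝒰 v, v⟩ ≤ M|v|²`) where `(m - 1)(M - 1) ≤ δ/4`, `0 < δ < 1`, and suppose that at the final
time some direction has Rayleigh quotient `≤ 1 - 3δ/4` (which holds if `H(T) ≤ m(1 - δ)`, i.e.
`q ∈ U^δ`, since `μ_m ≤ H/m`). Then `H ≤ m(1 - δ/(4m)) = m - δ/4` on all of `[s, T]`: at a time
where `H > m - δ/4` one has `μ_m ≥ H - (m-1)M > 1 - δ/2`, and the barrier `rayleigh_barrier'`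
would keep `μ_m > 1 - 3δ/4` up to time `T`. [cite: LiQingShi2017, Lemma 6.4] -/
theorem trace_le_card_sub_of_barrier [Nonempty ι] {U R : ℝ → Matrix ι ι ℝ} {s T δ M : ℝ}
    (hδ0 : 0 < δ) (hδ1 : δ < 1)
    (hMδ : ((Fintype.card ι : ℝ) - 1) * (M - 1) ≤ δ / 4)
    (hU : ∀ τ ∈ Icc s T, HasDerivAt U (-(R τ) - U τ * U τ) τ)
    (hsymm : ∀ τ ∈ Icc s T, (U τ).IsSymm)
    (hRhi : ∀ τ ∈ Icc s T, ∀ v : ι → ℝ, (1 - δ / 2) ^ 2 * (v ⬝ᵥ v) ≤ -(v ⬝ᵥ R τ *ᵥ v))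
    (hMq : ∀ τ ∈ Icc s T, ∀ v : ι → ℝ, v ⬝ᵥ U τ *ᵥ v ≤ M * (v ⬝ᵥ v))
    (hend : ∃ v : ι → ℝ, v ≠ 0 ∧ v ⬝ᵥ U T *ᵥ v ≤ (1 - 3 * δ / 4) * (v ⬝ᵥ v)) :
    ∀ τ ∈ Icc s T, (U τ).trace ≤ Fintype.card ι - δ / 4 := by
  intro τ hτ
  by_contra hgt
  push Not at hgt
  obtain ⟨v₀, hv₀, hv₀le⟩ := hend
  have hβ : |1 - 3 * δ / 4| < 1 - δ / 2 := by
    rw [abs_lt]; constructor <;> linarith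
  have hsub : Icc τ T ⊆ Icc s T := Icc_subset_Icc_left hτ.1
  -- initial condition of the barrier at `τ`
  have h0 : ∀ v : ι → ℝ, v ≠ 0 → (1 - 3 * δ / 4) * (v ⬝ᵥ v) < v ⬝ᵥ U τ *ᵥ v := by
    intro v hv
    have hp : 0 < v ⬝ᵥ v := dotProduct_self_pos' hv
    have h1 := trace_sub_mul_dotProduct_le (hsymm τ hτ) (hMq τ hτ) v
    have h2 : 1 - δ / 2 < (U τ).trace - ((Fintype.card ι : ℝ) - 1) * M := by nlinarith
    nlinarith
  have key := rayleigh_barrier' hβ (fun x hx ↦ hU x (hsub hx)) (fun x hx ↦ hsymm x (hsub hx))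
    (fun x hx ↦ hRhi x (hsub hx)) h0 T (right_mem_Icc.2 hτ.2) v₀ hv₀
  linarith

/-- **Prop. 6.5 (matrix form, as printed), the growth bound (6.15).** Under the hypotheses of
`trace_le_card_sub_of_barrier` on `[t_δ, T]`, a Jacobi determinant `𝒥 ≥ 0` with `𝒥' = H𝒥`
satisfies `𝒥(T) ≤ 𝒥(t_δ) e^{(m - δ/4)(T - t_δ)}` ("considering `U^δ_r` as a graph on a subset of
`Γ_{t_δ}` induced by exponential map at `p`"). [cite: LiQingShi2017, Prop. 6.5 (6.15)] -/
theorem jacobian_le_of_barrier [Nonempty ι] {U R : ℝ → Matrix ι ι ℝ} {J : ℝ → ℝ}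
    {tδ T δ M : ℝ} (hT : tδ ≤ T) (hδ0 : 0 < δ) (hδ1 : δ < 1)
    (hMδ : ((Fintype.card ι : ℝ) - 1) * (M - 1) ≤ δ / 4)
    (hU : ∀ τ ∈ Icc tδ T, HasDerivAt U (-(R τ) - U τ * U τ) τ)
    (hsymm : ∀ τ ∈ Icc tδ T, (U τ).IsSymm)
    (hRhi : ∀ τ ∈ Icc tδ T, ∀ v : ι → ℝ, (1 - δ / 2) ^ 2 * (v ⬝ᵥ v) ≤ -(v ⬝ᵥ R τ *ᵥ v))
    (hMq : ∀ τ ∈ Icc tδ T, ∀ v : ι → ℝ, v ⬝ᵥ U τ *ᵥ v ≤ M * (v ⬝ᵥ v))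
    (hJ : ∀ τ ∈ Icc tδ T, HasDerivAt J ((U τ).trace * J τ) τ) (hJ0 : ∀ τ ∈ Icc tδ T, 0 ≤ J τ)
    (hend : ∃ v : ι → ℝ, v ≠ 0 ∧ v ⬝ᵥ U T *ᵥ v ≤ (1 - 3 * δ / 4) * (v ⬝ᵥ v)) :
    J T ≤ J tδ * Real.exp ((Fintype.card ι - δ / 4) * (T - tδ)) :=
  le_mul_exp_of_deriv_eq_mul hT hJ hJ0
    (trace_le_card_sub_of_barrier hδ0 hδ1 hMδ hU hsymm hRhi hMq hend)

/-! #### Prop. 6.7 as printed -/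

/-- **Prop. 6.7 (matrix form, as printed): the lower bound (6.17) for `H𝒥` where the mean
curvature is very negative.** On `[t_δ, t]` (`t_δ + 1 ≤ t`) let `𝒰` be a symmetric solution of
`𝒰' = -ℛ - 𝒰²` with `K ≤ -(1 - δ/2)²`, `μ_M ≤ M`, `(m - 1)(M - 1) ≤ δ/4`, `1 ≤ M`, `0 < δ < 1`,
let `K ≥ -a²` on `[t - 1, t]` (`a > 0`), and let `𝒥 > 0` satisfy `𝒥' = H𝒥`. If
`H(t) ≤ -2m` then
`H𝒥(t) ≥ -𝒥(t_δ) e^{m²M} (m · a coth a + m²(m-1)M²) · e^{(m - δ/4)(t - 1 - t_δ)}`.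
The printed proof, step by step: `μ_m(t) ≤ H(t)/m ≤ -2`
(`exists_unit_card_mul_rayleigh_le_trace`); by the barrier `rayleigh_barrier'` run backwards from
`t`, at every `s ∈ [t_δ, t]` some direction has quotient `≤ -(1 - δ/2)/2 < 0`, so Lemma 6.4
(`trace_le_card_sub_of_barrier`) gives `H ≤ m - δ/4` on `[t_δ, t]` and Prop. 6.5 the growth
`𝒥(s) ≤ 𝒥(t_δ)e^{(m - δ/4)(s - t_δ)}`; on `[t - 1, t]`, (6.16) with `-tr ℛ ≥ 0`
(`card_mul_le_neg_trace`) and the trace inequality `(tr 𝒰)² - tr 𝒰² ≥ m² M (H - (m-1)M)`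
(`sq_trace_sub_trace_mul_self_ge`, `trace_sub_mul_dotProduct_le`) give (6.19)
`(H𝒥)' ≥ m²M · H𝒥 - m²(m-1)M² 𝒥`, which integrates to (6.20)
(`exp_mul_sub_integral_le_of_deriv_ge`); finally Lemma 6.6 (`neg_coth_lt_rayleigh`, `L = 1`)
bounds `H(t - 1) > -m a coth a`. [cite: LiQingShi2017, Prop. 6.7 (6.17)] -/
theorem trace_mul_jacobian_ge [Nonempty ι] {U R : ℝ → Matrix ι ι ℝ} {J : ℝ → ℝ}
    {tδ t δ M a : ℝ} (ht : tδ + 1 ≤ t) (hδ0 : 0 < δ) (hδ1 : δ < 1) (hM1 : 1 ≤ M)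
    (hMδ : ((Fintype.card ι : ℝ) - 1) * (M - 1) ≤ δ / 4) (ha : 0 < a)
    (hU : ∀ τ ∈ Icc tδ t, HasDerivAt U (-(R τ) - U τ * U τ) τ)
    (hsymm : ∀ τ ∈ Icc tδ t, (U τ).IsSymm)
    (hRhi : ∀ τ ∈ Icc tδ t, ∀ v : ι → ℝ, (1 - δ / 2) ^ 2 * (v ⬝ᵥ v) ≤ -(v ⬝ᵥ R τ *ᵥ v))
    (hRlo : ∀ τ ∈ Icc (t - 1) t, ∀ v : ι → ℝ, -(v ⬝ᵥ R τ *ᵥ v) ≤ a ^ 2 * (v ⬝ᵥ v))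
    (hMq : ∀ τ ∈ Icc tδ t, ∀ v : ι → ℝ, v ⬝ᵥ U τ *ᵥ v ≤ M * (v ⬝ᵥ v))
    (hJ : ∀ τ ∈ Icc tδ t, HasDerivAt J ((U τ).trace * J τ) τ) (hJpos : ∀ τ ∈ Icc tδ t, 0 < J τ)
    (hH : (U t).trace ≤ -2 * Fintype.card ι) :
    -(J tδ * Real.exp ((Fintype.card ι : ℝ) ^ 2 * M) *
        (Fintype.card ι * (a * (1 + Real.exp (-2 * a * 1)) / (1 - Real.exp (-2 * a * 1))) +
          (Fintype.card ι : ℝ) ^ 2 * (Fintype.card ι - 1) * M ^ 2)) *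
        Real.exp ((Fintype.card ι - δ / 4) * (t - 1 - tδ)) ≤ (U t).trace * J t := by
  -- notation for the constants
  set m : ℝ := (Fintype.card ι : ℝ) with hm
  have hm1 : 1 ≤ m := by
    rw [hm]; exact_mod_cast Fintype.card_pos
  set b : ℝ := 1 - δ / 2 with hb
  have hb0 : 0 < b := by rw [hb]; linarith
  set k' : ℝ := m - δ / 4 with hk'
  set k : ℝ := m ^ 2 * M with hk
  set C₁ : ℝ := m ^ 2 * (m - 1) * M ^ 2 with hC₁
  set A₀ : ℝ := a * (1 + Real.exp (-2 * a * 1)) / (1 - Real.exp (-2 * a * 1)) with hA₀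
  have htδt : tδ ≤ t := by linarith
  have ht1 : t - 1 ∈ Icc tδ t := ⟨by linarith, by linarith⟩
  have hsub1 : Icc (t - 1) t ⊆ Icc tδ t := Icc_subset_Icc_left (by linarith)
  -- Step (a): `μ_m(t) ≤ H(t)/m ≤ -2`, a unit vector `v₀`
  obtain ⟨v₀, hv₀1, hv₀⟩ := exists_unit_card_mul_rayleigh_le_trace (hsymm t (right_mem_Icc.2 htδt))
  have hv₀ne : v₀ ≠ 0 := fun h0 ↦ by rw [h0, dotProduct_zero] at hv₀1; exact zero_ne_one hv₀1
  have hv₀le : v₀ ⬝ᵥ U t *ᵥ v₀ ≤ -2 := by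
    have hm0 : 0 < m := by linarith
    have : m * (v₀ ⬝ᵥ U t *ᵥ v₀) ≤ m * (-2) := by rw [hm] at hH ⊢; linarith
    exact le_of_mul_le_mul_left this hm0
  -- Step (b): at every `s ∈ [t_δ, t]` some direction has quotient `≤ -b/2`
  have hneg : ∀ s ∈ Icc tδ t, ∃ v : ι → ℝ, v ≠ 0 ∧ v ⬝ᵥ U s *ᵥ v ≤ -(b / 2) * (v ⬝ᵥ v) := by
    intro s hs
    by_contra hcon
    push Not at hcon
    have hβ : |-(b / 2)| < 1 - δ / 2 := by
      rw [abs_neg, abs_of_pos (by linarith)]; linarith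
    have hsub : Icc s t ⊆ Icc tδ t := Icc_subset_Icc_left hs.1
    have key := rayleigh_barrier' hβ (fun x hx ↦ hU x (hsub hx)) (fun x hx ↦ hsymm x (hsub hx))
      (fun x hx ↦ hRhi x (hsub hx)) (fun v hv ↦ hcon v hv) t (right_mem_Icc.2 hs.2) v₀ hv₀ne
    rw [hv₀1, mul_one] at key
    have hb1 : b < 1 := by rw [hb]; linarith
    linarith
  -- Step (c): Lemma 6.4 ⇒ `H ≤ k'` on `[t_δ, t]`; Prop. 6.5 ⇒ growth of `𝒥`
  have hend : ∀ s ∈ Icc tδ t, ∃ v : ι → ℝ, v ≠ 0 ∧ v ⬝ᵥ U s *ᵥ v ≤ (1 - 3 * δ / 4) * (v ⬝ᵥ v) := by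
    intro s hs
    obtain ⟨v, hv, hvle⟩ := hneg s hs
    refine ⟨v, hv, hvle.trans (mul_le_mul_of_nonneg_right (by linarith) (dotProduct_self_nonneg' v))⟩
  have hHle : ∀ s ∈ Icc tδ t, (U s).trace ≤ k' :=
    trace_le_card_sub_of_barrier hδ0 hδ1 hMδ hU hsymm hRhi hMq (hend t (right_mem_Icc.2 htδt))
  have hJgrow : ∀ s ∈ Icc tδ t, J s ≤ J tδ * Real.exp (k' * (s - tδ)) := by
    intro s hs
    have hsub : Icc tδ s ⊆ Icc tδ t := Icc_subset_Icc_right hs.2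
    exact le_mul_exp_of_deriv_eq_mul hs.1 (fun x hx ↦ hJ x (hsub hx))
      (fun x hx ↦ (hJpos x (hsub hx)).le) (fun x hx ↦ hHle x (hsub hx))
  -- Step (d): on `[t - 1, t]` the lower Rayleigh parameter `H - (m-1)M` is `≤ 0`
  have hlo : ∀ s ∈ Icc (t - 1) t, ∀ v : ι → ℝ,
      ((U s).trace - (m - 1) * M) * (v ⬝ᵥ v) ≤ v ⬝ᵥ U s *ᵥ v :=
    fun s hs v ↦ trace_sub_mul_dotProduct_le (hsymm s (hsub1 hs)) (hMq s (hsub1 hs)) v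
  have hpar : ∀ s ∈ Icc (t - 1) t, (U s).trace - (m - 1) * M ≤ 0 := by
    intro s hs
    obtain ⟨v₁, hv₁, hv₁le⟩ := hneg s (hsub1 hs)
    have hp : 0 < v₁ ⬝ᵥ v₁ := dotProduct_self_pos' hv₁
    have h1 := hlo s hs v₁
    have : ((U s).trace - (m - 1) * M) * (v₁ ⬝ᵥ v₁) ≤ -(b / 2) * (v₁ ⬝ᵥ v₁) := h1.trans hv₁le
    have := le_of_mul_le_mul_right this hp
    linarith
  -- Step (e): the pointwise inequality (6.19) for `F = H𝒥`
  have hR0 : ∀ s ∈ Icc tδ t, (R s).trace ≤ 0 := by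
    intro s hs
    have := card_mul_le_neg_trace (hRhi s hs)
    nlinarith [sq_nonneg (1 - δ / 2)]
  have hF : ∀ s ∈ Icc (t - 1) t, HasDerivAt (fun x ↦ (U x).trace * J x)
      ((-(R s).trace - (U s * U s).trace + (U s).trace ^ 2) * J s) s := by
    intro s hs
    have h := (hasDerivAt_matrix_trace (hU s (hsub1 hs))).mul (hJ s (hsub1 hs))
    refine h.congr_deriv ?_
    rw [Matrix.trace_sub, Matrix.trace_neg]
    ring
  have hineq : ∀ s ∈ Icc (t - 1) t,
      k * ((U s).trace * J s) - C₁ * J s ≤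
        (-(R s).trace - (U s * U s).trace + (U s).trace ^ 2) * J s := by
    intro s hs
    have h := deriv_trace_mul_det_ge (hsymm s (hsub1 hs)) (hpar s hs) (by linarith)
      (hlo s hs) (hMq s (hsub1 hs)) (hR0 s (hsub1 hs)) (hJpos s (hsub1 hs)).le
    have : k * ((U s).trace * J s) - C₁ * J s =
        (Fintype.card ι : ℝ) ^ 2 * (M * ((U s).trace - (m - 1) * M)) * J s := by
      rw [hk, hC₁, hm]; ring
    rw [this]
    exact h
  -- Step (f): (6.20)
  have hJc : ContinuousOn J (Icc (t - 1) t) :=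
    fun s hs ↦ (hJ s (hsub1 hs)).continuousAt.continuousWithinAt
  have h620 := exp_mul_sub_integral_le_of_deriv_ge (by linarith : t - 1 ≤ t) hF hJc hineq
  -- Step (g): Lemma 6.6 at `t - 1` with `L = 1`: `H(t-1) > -m A₀`
  have hquot : ∀ v : ι → ℝ, v ≠ 0 → -A₀ * (v ⬝ᵥ v) < v ⬝ᵥ U (t - 1) *ᵥ v := by
    intro v hv
    have hp : 0 < v ⬝ᵥ v := dotProduct_self_pos' hv
    have hIcc : Icc (t - 1) (t - 1 + 1) = Icc (t - 1) t := by rw [sub_add_cancel]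
    have key := neg_coth_lt_rayleigh (R := R) (U := U) ha one_pos
      (fun x hx ↦ hU x (hsub1 (hIcc ▸ hx))) (fun x hx ↦ hsymm x (hsub1 (hIcc ▸ hx)))
      (fun x hx ↦ hRlo x (hIcc ▸ hx)) hv
    rw [lt_div_iff₀ hp] at key
    rw [hA₀]
    linarith
  have hHt1 : -(m * A₀) < (U (t - 1)).trace := by
    have := card_mul_lt_trace_of_rayleigh_gt (hsymm (t - 1) ht1) hquot
    rw [hm]; linarith
  have hA₀pos : 0 < A₀ := by
    rw [hA₀]
    have hq1 : Real.exp (-2 * a * 1) < 1 := Real.exp_lt_one_iff.2 (by linarith)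
    exact div_pos (mul_pos ha (by linarith [Real.exp_pos (-2 * a * 1)])) (by linarith)
  -- Step (h): bound the integral in (6.20)
  have hkk' : k' ≤ k := by
    rw [hk', hk]
    have : m ≤ m ^ 2 * M := by nlinarith
    linarith
  set Bnd : ℝ := J tδ * Real.exp (-k' * tδ) * Real.exp ((k' - k) * (t - 1)) with hBnd
  have hint : ∫ s in (t - 1)..t, Real.exp (-k * s) * J s ≤ Bnd := by
    have hfc : ContinuousOn (fun s ↦ Real.exp (-k * s) * J s) (Icc (t - 1) t) :=
      ((Real.continuous_exp.comp (continuous_const.mul continuous_id)).continuousOn).mul hJc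
    have h1 : ∫ s in (t - 1)..t, Real.exp (-k * s) * J s ≤ ∫ _s in (t - 1)..t, Bnd := by
      refine intervalIntegral.integral_mono_on (by linarith)
        (hfc.intervalIntegrable_of_Icc (by linarith)) intervalIntegrable_const fun s hs ↦ ?_
      have hJs := hJgrow s (hsub1 hs)
      have he0 : Real.exp (-k * s) * Real.exp (k' * (s - tδ)) =
          Real.exp (-k' * tδ) * Real.exp ((k' - k) * s) := by
        rw [← Real.exp_add, ← Real.exp_add]; congr 1; ring
      have he : Real.exp (-k * s) * (J tδ * Real.exp (k' * (s - tδ))) =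
          J tδ * Real.exp (-k' * tδ) * Real.exp ((k' - k) * s) := by
        calc Real.exp (-k * s) * (J tδ * Real.exp (k' * (s - tδ)))
            = J tδ * (Real.exp (-k * s) * Real.exp (k' * (s - tδ))) := by ring
          _ = J tδ * (Real.exp (-k' * tδ) * Real.exp ((k' - k) * s)) := by rw [he0]
          _ = J tδ * Real.exp (-k' * tδ) * Real.exp ((k' - k) * s) := by ring
      have hmono : Real.exp ((k' - k) * s) ≤ Real.exp ((k' - k) * (t - 1)) :=
        Real.exp_le_exp.2 (mul_le_mul_of_nonpos_left hs.1 (by linarith))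
      calc Real.exp (-k * s) * J s ≤ Real.exp (-k * s) * (J tδ * Real.exp (k' * (s - tδ))) :=
            mul_le_mul_of_nonneg_left hJs (Real.exp_pos _).le
        _ = J tδ * Real.exp (-k' * tδ) * Real.exp ((k' - k) * s) := he
        _ ≤ Bnd := by
            rw [hBnd]
            exact mul_le_mul_of_nonneg_left hmono (mul_nonneg (hJpos tδ
              (left_mem_Icc.2 htδt)).le (Real.exp_pos _).le)
    rw [intervalIntegral.integral_const, smul_eq_mul, show t - (t - 1) = 1 by ring, one_mul] at h1
    exact h1
  -- Step (i): combine
  have hJt1 := hJgrow (t - 1) ht1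
  have hJt1pos := hJpos (t - 1) ht1
  have hC₁0 : 0 ≤ C₁ := by
    rw [hC₁]
    have : 0 ≤ m - 1 := by linarith
    exact mul_nonneg (mul_nonneg (sq_nonneg _) this) (sq_nonneg _)
  have hek : 0 < Real.exp k := Real.exp_pos _
  -- `e^{k} F(t-1) ≥ -e^k m A₀ 𝒥(t_δ) e^{k'(t-1-t_δ)}`
  have hpart1 : -(Real.exp k * (m * A₀) * (J tδ * Real.exp (k' * (t - 1 - tδ)))) ≤
      Real.exp (k * (t - (t - 1))) * ((U (t - 1)).trace * J (t - 1)) := by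
    rw [show k * (t - (t - 1)) = k by ring]
    have h1 : -(m * A₀) * J (t - 1) ≤ (U (t - 1)).trace * J (t - 1) :=
      mul_le_mul_of_nonneg_right hHt1.le hJt1pos.le
    have h2 : -(m * A₀) * (J tδ * Real.exp (k' * (t - 1 - tδ))) ≤ -(m * A₀) * J (t - 1) := by
      apply mul_le_mul_of_nonpos_left hJt1
      have : 0 ≤ m * A₀ := by positivity
      linarith
    nlinarith [mul_le_mul_of_nonneg_left (h2.trans h1) hek.le]
  -- `C₁ e^{kt} ∫ ≤ C₁ e^{k} 𝒥(t_δ) e^{k'(t-1-t_δ)}`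
  have hpart2 : C₁ * Real.exp (k * t) * ∫ s in (t - 1)..t, Real.exp (-k * s) * J s ≤
      Real.exp k * C₁ * (J tδ * Real.exp (k' * (t - 1 - tδ))) := by
    have h1 := mul_le_mul_of_nonneg_left hint (mul_nonneg hC₁0 (Real.exp_pos (k * t)).le)
    refine h1.trans (le_of_eq ?_)
    rw [hBnd]
    have : Real.exp (k * t) * (Real.exp (-k' * tδ) * Real.exp ((k' - k) * (t - 1))) =
        Real.exp k * Real.exp (k' * (t - 1 - tδ)) := by
      rw [← Real.exp_add, ← Real.exp_add, ← Real.exp_add]; congr 1; ring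
    calc C₁ * Real.exp (k * t) * (J tδ * Real.exp (-k' * tδ) * Real.exp ((k' - k) * (t - 1)))
        = C₁ * J tδ * (Real.exp (k * t) * (Real.exp (-k' * tδ) * Real.exp ((k' - k) * (t - 1)))) := by
          ring
      _ = Real.exp k * C₁ * (J tδ * Real.exp (k' * (t - 1 - tδ))) := by rw [this]; ring
  have hfinal : -(J tδ * Real.exp k * (m * A₀ + C₁)) * Real.exp (k' * (t - 1 - tδ)) ≤
      (U t).trace * J t := by
    have := h620
    nlinarith [hpart1, hpart2]
  simpa only [hk, hk', hC₁, hA₀, hm] using hfinal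

/-! #### The inputs of §F along the Jacobi tensor: Cor. 6.2 from the Hessian comparison, and the
choice of `t_δ` -/

/-- **Cor. 6.2 along one geodesic, with Lemma 6.1 replaced by the Hessian comparison**: along a
solution of `𝒜'' + ℛ𝒜 = 0` (`𝒜(0) = 0`, `𝒜'(0) = I`, `ℛ` symmetric, continuous at `0`, no
conjugate point on `(0, c)`) with the asymptotically hyperbolic lower sectional bound
`-⟨ℛ(t)v, v⟩ ≤ (1 + C₀e^{-2t})|v|²` on `(0, c)` (`C₀ ≥ 0`), for `0 < t₀ ≤ t < c` every
Rayleigh quotient of `𝒰 = 𝒜'𝒜⁻¹` is `≤ 1 + C(t + 1)e^{-2t}` with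
`C = max (e^{2t₀}(a coth(at₀) - 1)) C₀`, `a = √(1 + C₀)` (`rayleigh_shape_le_coth` at `t₀`,
then `rayleigh_le_one_add` on `[t₀, t]`). [cite: LiQingShi2017, Cor. 6.2] -/
theorem rayleigh_shape_le_one_add {A A' R : ℝ → Matrix ι ι ℝ} {a₀ c C₀ t₀ t : ℝ} (hC₀ : 0 ≤ C₀)
    (h0 : (0 : ℝ) ∈ Ioo a₀ c)
    (hA : ∀ s ∈ Ioo a₀ c, HasDerivAt A (A' s) s)
    (hA' : ∀ s ∈ Ioo a₀ c, HasDerivAt A' (-(R s * A s)) s)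
    (hR : ∀ s ∈ Ioo a₀ c, (R s).IsSymm) (hRc : ContinuousAt R 0)
    (hA0 : A 0 = 0) (hA'0 : A' 0 = 1)
    (hdet : ∀ s ∈ Ioo 0 c, (A s).det ≠ 0)
    (hK : ∀ s ∈ Ioo 0 c, ∀ v : ι → ℝ,
      -(v ⬝ᵥ R s *ᵥ v) ≤ (1 + C₀ * Real.exp (-2 * s)) * (v ⬝ᵥ v))
    (ht₀ : 0 < t₀) (ht : t₀ ≤ t) (htc : t < c) {v : ι → ℝ} (hv : v ≠ 0) :
    (v ⬝ᵥ (A' t * (A t)⁻¹) *ᵥ v) / (v ⬝ᵥ v) ≤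
      1 + max (Real.exp (2 * t₀) * (Real.sqrt (1 + C₀) *
          (Real.cosh (Real.sqrt (1 + C₀) * t₀) / Real.sinh (Real.sqrt (1 + C₀) * t₀)) - 1)) C₀ *
        (t + 1) * Real.exp (-2 * t) := by
  set a := Real.sqrt (1 + C₀) with ha_def
  have ha : 0 < a := Real.sqrt_pos.2 (by linarith)
  have ha2 : a ^ 2 = 1 + C₀ := Real.sq_sqrt (by linarith)
  have hab : ∀ s ∈ Ioo 0 c, s ∈ Ioo a₀ c := fun s hs ↦ ⟨h0.1.trans hs.1, hs.2⟩
  have hunit : ∀ s ∈ Ioo 0 c, IsUnit (A s).det := fun s hs ↦ isUnit_iff_ne_zero.2 (hdet s hs)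
  have hW := jacobi_wronskian_eq_zero h0 hA hA' hR hA0
  have hUsymm : ∀ s ∈ Ioo 0 c, (A' s * (A s)⁻¹).IsSymm := fun s hs ↦
    isSymm_mul_inv_of_wronskian_eq_zero (hW s (hab s hs)) (hunit s hs)
  -- `K ≥ -a²` on `(0, c)`, so the quotient at `t₀` is `≤ a coth(a t₀)`
  have hKa : ∀ s ∈ Ioo 0 c, ∀ v : ι → ℝ, -(v ⬝ᵥ R s *ᵥ v) ≤ a ^ 2 * (v ⬝ᵥ v) := by
    intro s hs w
    refine (hK s hs w).trans (mul_le_mul_of_nonneg_right ?_ (dotProduct_self_nonneg' w))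
    rw [ha2]
    have : Real.exp (-2 * s) ≤ 1 := Real.exp_le_one_iff.2 (by nlinarith [hs.1])
    nlinarith
  -- Cor. 6.2 on `[t₀, t]`, with `K := a coth(a t₀)` at `t₀` from the Hessian comparison
  have hsub : Icc t₀ t ⊆ Ioo 0 c := fun s hs ↦ ⟨ht₀.trans_le hs.1, hs.2.trans_lt htc⟩
  have hUd : ∀ s ∈ Icc t₀ t, HasDerivAt (fun x ↦ A' x * (A x)⁻¹)
      (-(R s) - (A' s * (A s)⁻¹) * (A' s * (A s)⁻¹)) s := fun s hs ↦
    hasDerivAt_shape_riccati (hA s (hab s (hsub hs))) (hA' s (hab s (hsub hs))) (hunit s (hsub hs))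
  refine rayleigh_le_one_add (U := fun x ↦ A' x * (A x)⁻¹) ht₀.le ht hC₀ hUd
    (fun s hs ↦ hUsymm s (hsub hs)) (fun s hs w ↦ hK s (hsub hs) w) (fun w hw ↦ ?_) hv
  exact rayleigh_shape_le_coth ha h0 hA hA' hR hRc hA0 hA'0 hdet hKa hw t₀ ⟨ht₀, ht.trans_lt htc⟩

omit [DecidableEq ι] in
/-- `(t + 1) e^{-2t} ≤ 1/(2t)` for `t > 0` (from `e^{x} ≥ 1 + x + x²/2`). [folklore] -/
theorem add_one_mul_exp_neg_two_mul_le {t : ℝ} (ht : 0 < t) :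
    (t + 1) * Real.exp (-2 * t) ≤ 1 / (2 * t) := by
  have hq := Real.quadratic_le_exp_of_nonneg (by linarith : (0 : ℝ) ≤ 2 * t)
  have hexp : 0 < Real.exp (2 * t) := Real.exp_pos _
  have hee : Real.exp (2 * t) * Real.exp (-2 * t) = 1 := exp_mul_exp_neg_mul 2 t
  rw [le_div_iff₀ (by linarith : (0 : ℝ) < 2 * t)]
  -- `2t(t+1) ≤ e^{2t}`, then multiply by `e^{-2t}`
  have h1 : 2 * t * (t + 1) ≤ Real.exp (2 * t) := by nlinarith
  have h2 := mul_le_mul_of_nonneg_right h1 (Real.exp_pos (-2 * t)).le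
  rw [hee] at h2
  linarith

omit [DecidableEq ι] in
/-- **The choice of `t_δ`** (Li–Qing–Shi 2017, §6.2: "let `t_δ` be a fixed large number such
that `(n-2)C(t+1)e^{-2t} ≤ δ/4` and `1 - C₀e^{-2t} ≥ (1 - δ/2)²` for all `t ≥ t_δ`"): for
`X, C₀ ≥ 0` and `ε₁, ε₂ > 0` there is `t_δ ≥ 1` with `X(t+1)e^{-2t} ≤ ε₁` and `C₀e^{-2t} ≤ ε₂`
for all `t ≥ t_δ` (explicitly `t_δ = max 1 (max (X/(2ε₁)) (C₀/(2ε₂)))`).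
[cite: LiQingShi2017, §6.2 (before Lemma 6.4)] -/
theorem exists_tδ {X C₀ ε₁ ε₂ : ℝ} (hX : 0 ≤ X) (hC₀ : 0 ≤ C₀) (hε₁ : 0 < ε₁) (hε₂ : 0 < ε₂) :
    ∃ tδ : ℝ, 1 ≤ tδ ∧ ∀ t, tδ ≤ t →
      X * ((t + 1) * Real.exp (-2 * t)) ≤ ε₁ ∧ C₀ * Real.exp (-2 * t) ≤ ε₂ := by
  refine ⟨max 1 (max (X / (2 * ε₁)) (C₀ / (2 * ε₂))), le_max_left _ _, fun t ht ↦ ?_⟩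
  have ht1 : 1 ≤ t := (le_max_left _ _).trans ht
  have htX : X / (2 * ε₁) ≤ t := ((le_max_left _ _).trans (le_max_right _ _)).trans ht
  have htC : C₀ / (2 * ε₂) ≤ t := ((le_max_right _ _).trans (le_max_right _ _)).trans ht
  have ht0 : 0 < t := by linarith
  have hb := add_one_mul_exp_neg_two_mul_le ht0
  have hb' : Real.exp (-2 * t) ≤ 1 / (2 * t) := by
    have : Real.exp (-2 * t) ≤ (t + 1) * Real.exp (-2 * t) := by
      nlinarith [Real.exp_pos (-2 * t)]
    exact this.trans hb
  constructor
  · calc X * ((t + 1) * Real.exp (-2 * t)) ≤ X * (1 / (2 * t)) :=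
          mul_le_mul_of_nonneg_left hb hX
      _ ≤ ε₁ := by
          rw [div_le_iff₀ (by linarith)] at htX
          rw [mul_one_div, div_le_iff₀ (by linarith)]
          linarith
  · calc C₀ * Real.exp (-2 * t) ≤ C₀ * (1 / (2 * t)) := mul_le_mul_of_nonneg_left hb' hC₀
      _ ≤ ε₂ := by
          rw [div_le_iff₀ (by linarith)] at htC
          rw [mul_one_div, div_le_iff₀ (by linarith)]
          linarith

end Printed

/-! ### §G. The model normalisation (4.13) and the arithmetic of Thm. 1.5

"`Vol(Γ_t, g⁺)/Vol(Γ_t, g_ℍ) = Vol(Γ_t, g̃_t)(e^t/2)^{n-1}/(ω_{n-1} sinh^{n-1} t)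
= Vol(Γ_t, g̃_t)/ω_{n-1} + o(1)`" (Li–Qing–Shi 2017, (4.13)) rests on
`(e^t/2)^{n-1}/sinh^{n-1} t → 1`; and Thm. 1.5 follows from Lemma 4.4,
`(Y/((n-2)(n-1)))^{(n-1)/2} ≤ Vol(∂X, g̃₀)`, by dividing by
`ω_{n-1} = (Y(S^{n-1})/((n-1)(n-2)))^{(n-1)/2}` (`Y(S^{n-1}, [g_S]) = (n-1)(n-2)ω_{n-1}^{2/(n-1)}`). -/

section ModelNormalisation

/-- **`(e^t/2)^m / sinh^m t → 1` as `t → ∞`** (`e^t/(2 sinh t) = 1/(1 - e^{-2t})`): the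
normalisation `Vol(Γ_t, g_ℍ) = ω_{n-1} sinh^{n-1} t ∼ ω_{n-1}(e^t/2)^{n-1}` behind (4.13) of
Li–Qing–Shi 2017. [cite: LiQingShi2017, (4.13)] -/
theorem tendsto_exp_div_two_pow_div_sinh_pow (m : ℕ) :
    Tendsto (fun t ↦ (Real.exp t / 2) ^ m / Real.sinh t ^ m) atTop (𝓝 1) := by
  -- `e^t/(2 sinh t) = (1 - e^{-2t})⁻¹ → 1`
  have h1 : Tendsto (fun t ↦ (1 - Real.exp (-2 * t))⁻¹) atTop (𝓝 1) := by
    have he : Tendsto (fun t ↦ Real.exp (-2 * t)) atTop (𝓝 0) := by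
      have := Real.tendsto_exp_neg_atTop_nhds_zero.comp (tendsto_id.const_mul_atTop
        (by norm_num : (0 : ℝ) < 2))
      refine this.congr (fun t ↦ ?_)
      simp only [Function.comp_apply, id_eq]; ring_nf
    have h := (tendsto_const_nhds (x := (1 : ℝ))).sub he
    rw [sub_zero] at h
    have h' := h.inv₀ one_ne_zero
    rwa [inv_one] at h'
  have h2 := h1.pow m
  rw [one_pow] at h2
  refine h2.congr' ?_
  filter_upwards [eventually_gt_atTop 0] with t ht
  have hsinh : 0 < Real.sinh t := Real.sinh_pos_iff.2 ht
  have hne : Real.exp t - Real.exp (-t) ≠ 0 := by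
    have : Real.sinh t = (Real.exp t - Real.exp (-t)) / 2 := Real.sinh_eq t
    intro h; rw [h, zero_div] at this; exact hsinh.ne' this
  have key : Real.exp t / 2 / Real.sinh t * (1 - Real.exp (-2 * t)) = 1 := by
    have h2t : Real.exp (-2 * t) = (Real.exp t)⁻¹ * (Real.exp t)⁻¹ := by
      rw [← Real.exp_neg, ← Real.exp_add]; ring_nf
    rw [Real.sinh_eq, h2t]
    rw [Real.exp_neg] at hne ⊢
    have hE : Real.exp t ≠ 0 := (Real.exp_pos t).ne'
    have hne' : Real.exp t * Real.exp t - 1 ≠ 0 := by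
      intro h; apply hne
      field_simp
      linear_combination h
    have hne'' : -1 + Real.exp t ^ 2 ≠ 0 := by convert hne' using 1; ring
    have hne''' : Real.exp t ^ 2 - 1 ≠ 0 := by convert hne' using 1; ring
    field_simp
  rw [← div_pow]
  congr 1
  exact (eq_inv_of_mul_eq_one_left key).symm

/-- **The arithmetic of Thm. 1.5 from Lemma 4.4**: with `m = n - 1`, Lemma 4.4 gives
`(Y/(m(m-1)))^{m/2} ≤ V₀ = Vol(∂X, g̃₀)`, and (4.13) identifies the limit of the volume ratio
with `V₀/ω_m`; since `Y(S^m, [g_S]) = m(m-1)ω_m^{2/m}`, the printed lower bound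
`(Y/Y(S^m))^{m/2} ≤ V₀/ω_m` is the same inequality divided by `ω_m = (ω_m^{2/m})^{m/2}`.
[cite: LiQingShi2017, Thm. 1.5 (proof, p. 13) and Lemma 4.4] -/
theorem rpow_div_yamabeSphere_le {Y m ω V₀ : ℝ} (hY : 0 ≤ Y) (hm : 1 < m) (hω : 0 < ω)
    (h : (Y / (m * (m - 1))) ^ (m / 2) ≤ V₀) :
    (Y / (m * (m - 1) * ω ^ (2 / m))) ^ (m / 2) ≤ V₀ / ω := by
  have hmm : 0 < m * (m - 1) := mul_pos (by linarith) (by linarith)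
  have hωp : 0 < ω ^ (2 / m) := Real.rpow_pos_of_pos hω _
  have hsplit : Y / (m * (m - 1) * ω ^ (2 / m)) = (Y / (m * (m - 1))) / ω ^ (2 / m) := by
    rw [div_div]
  have hωω : (ω ^ (2 / m)) ^ (m / 2) = ω := by
    rw [← Real.rpow_mul hω.le]
    have : 2 / m * (m / 2) = 1 := by field_simp
    rw [this, Real.rpow_one]
  rw [hsplit, Real.div_rpow (div_nonneg hY hmm.le) hωp.le, hωω]
  exact div_le_div_of_nonneg_right h hω.le

end ModelNormalisation

/-! ### §H. The volume forms `dv(∇t)` and `dv(∇r)` on `(∇r)^⊥` ((6.10)–(6.12)), and the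
constant `(n-1)(n-2)ω_{n-1}^{2/(n-1)} = 8√6π` at `n = 5`

(6.11)–(6.12) of Li–Qing–Shi 2017 compare the hypersurface volume forms `dv[g⁺](∇t) = ι_{∇t} dv`
and `dv[g⁺](∇r) = ι_{∇r} dv` restricted to the hyperplane `(∇r)^⊥`: the pointwise content is the
linear-algebra identity `(ι_ν Ω)|_{ν'^⊥} = ⟨ν, ν'⟩ (ι_{ν'} Ω)|_{ν'^⊥}` for an alternating top form
`Ω` and a unit vector `ν'`, so that the ratio in (6.11) is exactly `g⁺(∇t, ∇r) = 1 + O(e^{-2t})`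
((4.5), `one_sub_le_of_deriv_eq_one_sub_sq_mul`). -/

section VolumeForms

open scoped InnerProductSpace

/-- **(6.10)–(6.11), pointwise**: for an alternating `(m+1)`-form `Ω` on an `(m+1)`-dimensional
real inner product space, a unit vector `ν'` and vectors `v₁, …, v_m ⊥ ν'`,
`Ω(ν, v₁, …, v_m) = ⟨ν, ν'⟩ Ω(ν', v₁, …, v_m)` for every `ν` — the component of `ν` orthogonal
to `ν'` contributes nothing, `m + 1` vectors of the `m`-dimensional hyperplane `ν'^⊥` being
linearly dependent. With `Ω = dv[g⁺]`, `ν = ∇t`, `ν' = ∇r/|∇r|`: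
`dv(∇t)|_{(∇r)^⊥} = g⁺(∇t, ∇r) dv(∇r)|_{(∇r)^⊥}` (up to the normalisation of `∇r`).
[cite: LiQingShi2017, (6.10)–(6.11)] -/
theorem alternatingMap_cons_eq_inner_mul {V : Type*} [NormedAddCommGroup V]
    [InnerProductSpace ℝ V] {m : ℕ} (hdim : Module.finrank ℝ V = m + 1)
    (Ω : V [⋀^Fin (m + 1)]→ₗ[ℝ] ℝ) (ν ν' : V) (hν' : ‖ν'‖ = 1) (v : Fin m → V)
    (hv : ∀ i, ⟪ν', v i⟫_ℝ = 0) :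
    Ω (Fin.cons ν v) = ⟪ν, ν'⟫_ℝ * Ω (Fin.cons ν' v) := by
  haveI : FiniteDimensional ℝ V := Module.finite_of_finrank_eq_succ hdim
  haveI : Fact (Module.finrank ℝ V = m + 1) := ⟨hdim⟩
  -- split `ν = ⟨ν, ν'⟩ ν' + w` with `w ⊥ ν'`
  set w : V := ν - ⟪ν, ν'⟫_ℝ • ν' with hw
  have hνsplit : ν = ⟪ν, ν'⟫_ℝ • ν' + w := by rw [hw]; abel
  have hwperp : ⟪ν', w⟫_ℝ = 0 := by
    rw [hw, inner_sub_right, inner_smul_right, real_inner_self_eq_norm_sq, hν', one_pow, mul_one,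
      real_inner_comm, sub_self]
  have h1 : Ω (Fin.cons ν v) = ⟪ν, ν'⟫_ℝ * Ω (Fin.cons ν' v) + Ω (Fin.cons w v) := by
    conv_lhs => rw [hνsplit]
    rw [show (Fin.cons (⟪ν, ν'⟫_ℝ • ν' + w) v : Fin (m + 1) → V) =
        Fin.cons (⟪ν, ν'⟫_ℝ • ν' + w) v from rfl]
    have hadd := MultilinearMap.cons_add Ω.toMultilinearMap v (⟪ν, ν'⟫_ℝ • ν') w
    have hsmul := MultilinearMap.cons_smul Ω.toMultilinearMap v (⟪ν, ν'⟫_ℝ) ν'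
    simp only [AlternatingMap.coe_multilinearMap, smul_eq_mul] at hadd hsmul
    rw [hadd, hsmul]
  -- the second term vanishes: `m + 1` vectors in the `m`-dimensional hyperplane `ν'^⊥`
  have hν'0 : ν' ≠ 0 := by
    intro h; rw [h, norm_zero] at hν'; exact zero_ne_one hν'
  set K : Submodule ℝ V := (ℝ ∙ ν')ᗮ with hK
  have hKdim : Module.finrank ℝ K = m := Submodule.finrank_orthogonal_span_singleton hν'0
  have hmem : ∀ i : Fin (m + 1), (Fin.cons w v : Fin (m + 1) → V) i ∈ K := by
    intro i
    refine Fin.cases ?_ (fun j ↦ ?_) i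
    · simpa [hK, Submodule.mem_orthogonal_singleton_iff_inner_right] using hwperp
    · simpa [hK, Submodule.mem_orthogonal_singleton_iff_inner_right] using hv j
  have hdep : ¬LinearIndependent ℝ (Fin.cons w v : Fin (m + 1) → V) := by
    intro hli
    set u : Fin (m + 1) → K := fun i ↦ ⟨(Fin.cons w v : Fin (m + 1) → V) i, hmem i⟩ with hu
    have hcomp : (K.subtype : K →ₗ[ℝ] V) ∘ u = (Fin.cons w v : Fin (m + 1) → V) := by
      funext i; rfl
    have hli' : LinearIndependent ℝ u := LinearIndependent.of_comp K.subtype (by rwa [hcomp])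
    have hcard := hli'.fintype_card_le_finrank
    rw [Fintype.card_fin, hKdim] at hcard
    omega
  rw [h1, Ω.map_linearDependent _ hdep, add_zero]

/-- **The constant of Lemma 4.4 at `n = 5`**: `(n-1)(n-2) ω_{n-1}^{2/(n-1)} = 4·3·(8π²/3)^{1/2} = 8√6π`
(`ω₄ = Vol(S⁴) = 8π²/3`), the value `Y(S⁴, [g_S])` which normalises Thm. 1.5 and appears
literally in `liQingShi_pinching_five`. [cite: LiQingShi2017, Lemma 4.4 and Thm. 1.5] -/
theorem twelve_mul_sqrt_vol_sphere_four :
    (12 : ℝ) * Real.sqrt (8 * Real.pi ^ 2 / 3) = 8 * Real.sqrt 6 * Real.pi := by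
  have hπ : 0 ≤ Real.pi := Real.pi_pos.le
  have h1 : Real.sqrt (8 * Real.pi ^ 2 / 3) = Real.pi * Real.sqrt (8 / 3) := by
    rw [show 8 * Real.pi ^ 2 / 3 = Real.pi ^ 2 * (8 / 3) by ring, Real.sqrt_mul (sq_nonneg _),
      Real.sqrt_sq hπ]
  have h2 : Real.sqrt (8 / 3) = 2 * Real.sqrt 6 / 3 := by
    rw [show (8 : ℝ) / 3 = (2 * Real.sqrt 6 / 3) ^ 2 by
      rw [div_pow, mul_pow, Real.sq_sqrt (by norm_num : (0 : ℝ) ≤ 6)]; norm_num]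
    exact Real.sqrt_sq (by positivity)
  rw [h1, h2]
  ring

end VolumeForms

/-! ### §I. Thm. 1.5 in polar data: the middle inequality, the passage from `t → ∞` to all `t`,
and the smallness of `U^δ` (Prop. 6.5, second half of (6.15))

One-variable / measure-theoretic bookkeeping around Thm. 1.5 (Li–Qing–Shi 2017, (1.7) and §4,
p. 11: "one may employ the Bishop–Gromov relative volume comparison theorem and get
`Vol(Γ_t)/Vol(Γ_t, g_ℍ) ≤ Vol(B(t))/Vol(B(t), g_ℍ) ≤ 1` … the real issue for (1.7) is the lower
bound and the key is to establish the relative volume lower bound by the limit `t → ∞`"), in the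
polar-data conventions of `VolumeSphereTheoremProofs.lean`, §9 (`𝔄(t)` a lower area, `g` a model
area, cross inequality `𝔄(t)g(u) ≤ 𝔄(u)g(t)` from Bishop's monotonicity). -/

section PolarData

open MeasureTheory intervalIntegral

/-- **The middle inequality of (1.7): area ratio `≤` volume ratio.** If `𝔄(t) g(u) ≤ 𝔄(u) g(t)`
for `u ∈ (0, t)` (the ratio `𝔄/g` is nonincreasing — Bishop–Gromov for spheres), `g(t) > 0`
and `∫₀ᵗ g > 0`, then `𝔄(t)/g(t) ≤ (∫₀ᵗ 𝔄)/(∫₀ᵗ g)`, i.e.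
`Vol(Γ_t)/Vol(Γ_t, g_ℍ) ≤ Vol(B(t))/Vol(B(t), g_ℍ)`. [cite: LiQingShi2017, Thm. 1.5 (1.7)] -/
theorem div_le_integral_div_integral_of_cross {𝔄 g : ℝ → ℝ} {t : ℝ} (ht : 0 ≤ t)
    (h𝔄 : IntervalIntegrable 𝔄 volume 0 t) (hg : IntervalIntegrable g volume 0 t)
    (hgt : 0 < g t) (hgint : 0 < ∫ u in 0..t, g u)
    (hcross : ∀ u ∈ Set.Ioo 0 t, 𝔄 t * g u ≤ 𝔄 u * g t) :
    𝔄 t / g t ≤ (∫ u in 0..t, 𝔄 u) / ∫ u in 0..t, g u := by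
  have h1 : ∫ u in 0..t, 𝔄 t * g u ≤ ∫ u in 0..t, 𝔄 u * g t :=
    intervalIntegral.integral_mono_on_of_le_Ioo ht (hg.const_mul _) (h𝔄.mul_const _) hcross
  rw [intervalIntegral.integral_const_mul, intervalIntegral.integral_mul_const] at h1
  rw [div_le_div_iff₀ hgt hgint]
  linarith

/-- **From the limit `t → ∞` to all `t`**: a ratio which is nonincreasing on `(0, ∞)` and
tends to `L` at infinity is `≥ L` at every `t > 0` — the lower bound of (1.7) from
`lim_{t→∞} Vol(Γ_t)/Vol(Γ_t, g_ℍ)` (Li–Qing–Shi 2017, §4, p. 11 and (4.13)).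
[cite: LiQingShi2017, Thm. 1.5 (proof, pp. 11–13)] -/
theorem le_of_antitoneOn_Ioi_of_tendsto {f : ℝ → ℝ} {L : ℝ} (hf : AntitoneOn f (Set.Ioi 0))
    (hlim : Tendsto f atTop (𝓝 L)) {t : ℝ} (ht : 0 < t) : L ≤ f t := by
  refine le_of_tendsto hlim ?_
  filter_upwards [eventually_ge_atTop t] with s hs
  exact hf (Set.mem_Ioi.2 ht) (Set.mem_Ioi.2 (ht.trans_le hs)) hs

/-- The same with only an asymptotic lower bound: if `f` is nonincreasing on `(0, ∞)` and
`f(s) ≥ L - ε` eventually for every `ε > 0` (`liminf_{s→∞} f ≥ L`), then `f(t) ≥ L` for `t > 0`.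
[cite: LiQingShi2017, Thm. 1.5 (proof, pp. 11–13)] -/
theorem le_of_antitoneOn_Ioi_of_eventually_ge {f : ℝ → ℝ} {L : ℝ} (hf : AntitoneOn f (Set.Ioi 0))
    (hlim : ∀ ε > 0, ∀ᶠ s in atTop, L - ε ≤ f s) {t : ℝ} (ht : 0 < t) : L ≤ f t := by
  refine le_of_forall_pos_lt_add fun ε hε ↦ ?_
  obtain ⟨s, hs⟩ := ((hlim (ε / 2) (by linarith)).and (eventually_ge_atTop t)).exists
  have hmono := hf (Set.mem_Ioi.2 ht) (Set.mem_Ioi.2 (ht.trans_le hs.2)) hs.2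
  linarith [hs.1]

variable {Ξ : Type*} [MeasurableSpace Ξ]

/-- **Prop. 6.5, second half of (6.15), in polar data: `∫_{U^δ_r} dv[g̃_r] → 0`.** For a set `S`
of directions (those hitting `Σ_r` in `U^δ_r`), hitting times `t_Σ(ξ) ≥ r - C` (`|r - t| ≤ C`,
Lemma 4.1), and Jacobi determinants obeying the growth bound (6.15)
`𝒥_ξ(t_Σ ξ) ≤ 𝒥_ξ(t_δ) e^{(m-ε)(t_Σ ξ - t_δ)}` in every direction of `S` (Prop. 6.5 with
`ε = δ/4`, `jacobian_le_of_barrier`), the normalised area of `S` at the hitting times is small: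
`∫_S e^{-m t_Σ} 𝒥(t_Σ) dμ ≤ e^{-(m-ε)t_δ} e^{-ε(r - C)} ∫_S 𝒥(t_δ) dμ → 0` as `r → ∞`
(the factors `2^{n-1}` and `dv(∇r)/dv(∇t)|_{(∇r)^⊥} = 1 + O(e^{-2t})` of (6.10)–(6.12) being
constants). [cite: LiQingShi2017, Prop. 6.5 (6.15)] -/
theorem setIntegral_exp_neg_mul_jacobian_le (μ : Measure Ξ) {J : Ξ → ℝ → ℝ} {tS : Ξ → ℝ}
    {S : Set Ξ} {tδ m ε r C : ℝ} (hε : 0 < ε) (hS : MeasurableSet S)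
    (hint : IntegrableOn (fun ξ ↦ Real.exp (-m * tS ξ) * J ξ (tS ξ)) S μ)
    (hintδ : IntegrableOn (fun ξ ↦ J ξ tδ) S μ)
    (hJ0 : ∀ ξ ∈ S, 0 ≤ J ξ tδ) (ht : ∀ ξ ∈ S, r - C ≤ tS ξ)
    (hgrow : ∀ ξ ∈ S, J ξ (tS ξ) ≤ J ξ tδ * Real.exp ((m - ε) * (tS ξ - tδ))) :
    ∫ ξ in S, Real.exp (-m * tS ξ) * J ξ (tS ξ) ∂μ ≤
      Real.exp (-(m - ε) * tδ) * Real.exp (-ε * (r - C)) * ∫ ξ in S, J ξ tδ ∂μ := by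
  set K : ℝ := Real.exp (-(m - ε) * tδ) * Real.exp (-ε * (r - C)) with hK
  have hpt : ∀ ξ ∈ S, Real.exp (-m * tS ξ) * J ξ (tS ξ) ≤ K * J ξ tδ := by
    intro ξ hξ
    have h1 := mul_le_mul_of_nonneg_left (hgrow ξ hξ) (Real.exp_pos (-m * tS ξ)).le
    have h2e : Real.exp (-m * tS ξ) * Real.exp ((m - ε) * (tS ξ - tδ)) =
        Real.exp (-(m - ε) * tδ) * Real.exp (-ε * tS ξ) := by
      rw [← Real.exp_add, ← Real.exp_add]; congr 1; ring
    have h2 : Real.exp (-m * tS ξ) * (J ξ tδ * Real.exp ((m - ε) * (tS ξ - tδ))) =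
        Real.exp (-(m - ε) * tδ) * Real.exp (-ε * tS ξ) * J ξ tδ := by
      calc Real.exp (-m * tS ξ) * (J ξ tδ * Real.exp ((m - ε) * (tS ξ - tδ)))
          = (Real.exp (-m * tS ξ) * Real.exp ((m - ε) * (tS ξ - tδ))) * J ξ tδ := by ring
        _ = Real.exp (-(m - ε) * tδ) * Real.exp (-ε * tS ξ) * J ξ tδ := by rw [h2e]
    have h3 : Real.exp (-ε * tS ξ) ≤ Real.exp (-ε * (r - C)) :=
      Real.exp_le_exp.2 (by nlinarith [ht ξ hξ])
    calc Real.exp (-m * tS ξ) * J ξ (tS ξ)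
        ≤ Real.exp (-(m - ε) * tδ) * Real.exp (-ε * tS ξ) * J ξ tδ := h1.trans_eq h2
      _ ≤ K * J ξ tδ := by
          rw [hK]
          exact mul_le_mul_of_nonneg_right
            (mul_le_mul_of_nonneg_left h3 (Real.exp_pos _).le) (hJ0 ξ hξ)
  calc ∫ ξ in S, Real.exp (-m * tS ξ) * J ξ (tS ξ) ∂μ ≤ ∫ ξ in S, K * J ξ tδ ∂μ :=
        setIntegral_mono_on hint (hintδ.const_mul K) hS hpt
    _ = K * ∫ ξ in S, J ξ tδ ∂μ := MeasureTheory.integral_const_mul _ _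

/-- **Prop. 6.7 integrated, in polar data: the third integral of Thm. 6.8 is exponentially
small.** For a set `S` of directions (those hitting `Σ_r` where `H ≤ -2(n-1)`), hitting times
`t_S(ξ) ≥ r - C`, and the per-direction lower bound (6.17)
`H𝒥_ξ(t_S ξ) ≥ -B · 𝒥_ξ(t_δ) e^{(m-ε)(t_S ξ - 1 - t_δ)}` (`trace_mul_jacobian_ge`, `ε = δ/4`,
`B = e^{m²M}(m a coth a + m²(m-1)M²)`), the normalised integral is bounded below:
`∫_S e^{-m t_S} H𝒥(t_S) dμ ≥ -B e^{-(m-ε)(1+t_δ)} e^{-ε(r-C)} ∫_S 𝒥(t_δ) dμ → 0` as `r → ∞`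
(so that, `R dv` being bounded below by a multiple of `H dv` there, the third integral in the
splitting of Thm. 6.8 is `o_r(1)`). [cite: LiQingShi2017, Prop. 6.7 (6.17) and Thm. 6.8 (proof)] -/
theorem setIntegral_exp_neg_mul_trace_jacobian_ge (μ : Measure Ξ) {HJ J : Ξ → ℝ → ℝ}
    {tS : Ξ → ℝ} {S : Set Ξ} {tδ m ε r C B : ℝ} (hε : 0 < ε) (hB : 0 ≤ B)
    (hS : MeasurableSet S)
    (hint : IntegrableOn (fun ξ ↦ Real.exp (-m * tS ξ) * HJ ξ (tS ξ)) S μ)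
    (hintδ : IntegrableOn (fun ξ ↦ J ξ tδ) S μ)
    (hJ0 : ∀ ξ ∈ S, 0 ≤ J ξ tδ) (ht : ∀ ξ ∈ S, r - C ≤ tS ξ)
    (hlow : ∀ ξ ∈ S, -(B * J ξ tδ) * Real.exp ((m - ε) * (tS ξ - 1 - tδ)) ≤ HJ ξ (tS ξ)) :
    -(B * Real.exp (-(m - ε) * (1 + tδ)) * Real.exp (-ε * (r - C))) * ∫ ξ in S, J ξ tδ ∂μ ≤
      ∫ ξ in S, Real.exp (-m * tS ξ) * HJ ξ (tS ξ) ∂μ := by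
  set K : ℝ := B * Real.exp (-(m - ε) * (1 + tδ)) * Real.exp (-ε * (r - C)) with hK
  have hpt : ∀ ξ ∈ S, -K * J ξ tδ ≤ Real.exp (-m * tS ξ) * HJ ξ (tS ξ) := by
    intro ξ hξ
    have h1 := mul_le_mul_of_nonneg_left (hlow ξ hξ) (Real.exp_pos (-m * tS ξ)).le
    have h2e : Real.exp (-m * tS ξ) * Real.exp ((m - ε) * (tS ξ - 1 - tδ)) =
        Real.exp (-(m - ε) * (1 + tδ)) * Real.exp (-ε * tS ξ) := by
      rw [← Real.exp_add, ← Real.exp_add]; congr 1; ring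
    have h2 : Real.exp (-m * tS ξ) * (-(B * J ξ tδ) * Real.exp ((m - ε) * (tS ξ - 1 - tδ))) =
        -(B * Real.exp (-(m - ε) * (1 + tδ)) * Real.exp (-ε * tS ξ)) * J ξ tδ := by
      calc Real.exp (-m * tS ξ) * (-(B * J ξ tδ) * Real.exp ((m - ε) * (tS ξ - 1 - tδ)))
          = -(B * (Real.exp (-m * tS ξ) * Real.exp ((m - ε) * (tS ξ - 1 - tδ)))) * J ξ tδ := by
            ring
        _ = -(B * Real.exp (-(m - ε) * (1 + tδ)) * Real.exp (-ε * tS ξ)) * J ξ tδ := by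
            rw [h2e]; ring
    have h3 : Real.exp (-ε * tS ξ) ≤ Real.exp (-ε * (r - C)) :=
      Real.exp_le_exp.2 (by nlinarith [ht ξ hξ])
    have h4 : -K * J ξ tδ ≤
        -(B * Real.exp (-(m - ε) * (1 + tδ)) * Real.exp (-ε * tS ξ)) * J ξ tδ := by
      rw [hK]
      apply mul_le_mul_of_nonneg_right _ (hJ0 ξ hξ)
      have : B * Real.exp (-(m - ε) * (1 + tδ)) * Real.exp (-ε * tS ξ) ≤
          B * Real.exp (-(m - ε) * (1 + tδ)) * Real.exp (-ε * (r - C)) :=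
        mul_le_mul_of_nonneg_left h3 (mul_nonneg hB (Real.exp_pos _).le)
      linarith
    exact h4.trans (h2.symm.le.trans h1)
  calc -K * ∫ ξ in S, J ξ tδ ∂μ = ∫ ξ in S, -K * J ξ tδ ∂μ :=
        (MeasureTheory.integral_const_mul _ _).symm
    _ ≤ ∫ ξ in S, Real.exp (-m * tS ξ) * HJ ξ (tS ξ) ∂μ :=
        setIntegral_mono_on (hintδ.const_mul (-K)) hint hS hpt

end PolarData

/-! ### §J. Rigidity: the equality case of Bishop's inequality along one geodesic
(Thm. 1.7 and Steps 1–2 of the proof of Thm. 1.8)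

The endgames of Li–Qing–Shi 2017 — Thm. 1.7 ("`(Xⁿ, g⁺)` is isometric to `ℍⁿ` provided the
conformal infinity is the round sphere", via Thm. 1.5: then `Vol(Γ_t)/Vol(Γ_t, g_ℍ) ≡ 1`),
Step 1 of Thm. 1.8 ("`Vol(Γ_t, g_∞) = Vol(Γ_t, g_E)` for all `t > 0`, which implies that
`(X_∞, g_∞)` is isometric to the Euclidean space") and Step 2 ("the exact same argument at the end
of Section 7 in [DJ]") — are the EQUALITY CASE of Bishop's comparison theorem: if
`det 𝒜(t;ξ) = sinh^{n-1} t` for all `t` (resp. `= t^{n-1}`) in a direction `ξ` along which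
`Ric ≥ -(n-1)` (resp. `≥ 0`), then every intermediate inequality is an equality — the traced
Riccati inequality (Cauchy–Schwarz `tr 𝒰² ≥ (tr 𝒰)²/(n-1)`) and `Ric ≥ -(n-1)` — so
`𝒰 ≡ coth t · I`, `ℛ ≡ -I` (all radial sectional curvatures are `-1`) and `𝒜 ≡ sinh t · I`
(the metric in polar coordinates is `dt² + sinh²t g_S`, i.e. hyperbolic). The matrix content: -/

section Rigidity

open scoped Matrix.Norms.Operator

variable {ι : Type*} [Fintype ι] [DecidableEq ι]

omit [DecidableEq ι] in
/-- A real matrix with `tr(VᵀV) = 0` vanishes. [folklore] -/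
theorem eq_zero_of_trace_transpose_mul_self_eq_zero {V : Matrix ι ι ℝ}
    (h : (Vᵀ * V).trace = 0) : V = 0 := by
  have hsum : (Vᵀ * V).trace = ∑ i, ∑ j, V j i * V j i := by
    simp only [Matrix.trace, Matrix.diag_apply, Matrix.mul_apply, Matrix.transpose_apply]
  rw [hsum] at h
  have hnn : ∀ i ∈ Finset.univ, (0 : ℝ) ≤ ∑ j, V j i * V j i :=
    fun i _ ↦ Finset.sum_nonneg fun j _ ↦ mul_self_nonneg _
  have h1 := (Finset.sum_eq_zero_iff_of_nonneg hnn).1 h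
  ext j i
  have h2 := (Finset.sum_eq_zero_iff_of_nonneg (fun j _ ↦ mul_self_nonneg (V j i))).1
    (h1 i (Finset.mem_univ i)) j (Finset.mem_univ j)
  simpa using h2

/-- **Equality in the Cauchy–Schwarz trace step**: a symmetric real matrix with
`m · tr(U²) = (tr U)²` is the scalar matrix `(tr U/m) I` (`tr((U - (tr U/m)I)²) = 0`).
[folklore] -/
theorem eq_smul_one_of_sq_trace_eq [Nonempty ι] {U : Matrix ι ι ℝ} (hU : U.IsSymm)
    (h : (Fintype.card ι : ℝ) * (U * U).trace = U.trace ^ 2) :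
    U = (U.trace / Fintype.card ι) • (1 : Matrix ι ι ℝ) := by
  set m : ℝ := (Fintype.card ι : ℝ) with hm
  have hm0 : 0 < m := by rw [hm]; exact_mod_cast Fintype.card_pos
  set c : ℝ := U.trace / m with hc
  set V : Matrix ι ι ℝ := U - c • (1 : Matrix ι ι ℝ) with hV
  have hVsymm : Vᵀ = V := by
    rw [hV, Matrix.transpose_sub, Matrix.transpose_smul, Matrix.transpose_one, hU.eq]
  have htrV : (Vᵀ * V).trace = 0 := by
    rw [hVsymm, hV]
    have hexp : (U - c • (1 : Matrix ι ι ℝ)) * (U - c • (1 : Matrix ι ι ℝ)) =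
        U * U - c • U - c • U + (c * c) • (1 : Matrix ι ι ℝ) := by
      rw [sub_mul, mul_sub, mul_sub, Matrix.mul_smul, Matrix.mul_one, Matrix.smul_mul,
        Matrix.one_mul, Matrix.smul_mul, Matrix.one_mul, smul_smul]
      abel
    rw [hexp, Matrix.trace_add, Matrix.trace_sub, Matrix.trace_sub, Matrix.trace_smul,
      Matrix.trace_smul, Matrix.trace_one, smul_eq_mul, smul_eq_mul, ← hm]
    have hcm : c * m = U.trace := by rw [hc]; field_simp
    have : (U * U).trace = U.trace ^ 2 / m := by
      rw [eq_div_iff hm0.ne']; linarith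
    rw [this]
    field_simp
    nlinarith [hcm]
  have hV0 := eq_zero_of_trace_transpose_mul_self_eq_zero htrV
  rw [hV, sub_eq_zero] at hV0
  exact hV0

/-- **Rigidity of Bishop's inequality along one geodesic, `κ = -1` (the hyperbolic equality case:
Thm. 1.7 of Li–Qing–Shi 2017 and Step 2 of the proof of Thm. 1.8 via "the end of §7 of [DJ]").**
Along a solution of `𝒜'' + ℛ𝒜 = 0` (`𝒜(0) = 0`, `𝒜'(0) = I`, `ℛ` symmetric, no conjugate
point on `(0, b)`) with `Ric = tr ℛ ≥ -(n-1)`, if `det 𝒜(t) = sinh^{n-1} t` on `(0, b)` (equality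
in `det 𝒜 ≤ sinh^{n-1}`, `jacobi_det_le_sinh_pow`), then on `(0, b)`:
`𝒰 = 𝒜'𝒜⁻¹ = coth t · I`, `ℛ = -I` (all sectional curvatures `K(·, γ') = -1`) and
`𝒜 = sinh t · I`. Proof: `ϕ = (det 𝒜)'/det 𝒜 = (n-1) coth t` solves the model Riccati EQUATION,
so the traced Riccati inequality `ϕ' + ϕ²/(n-1) + tr ℛ ≤ 0` and `tr ℛ ≥ -(n-1)` are equalities;
equality in Cauchy–Schwarz gives `𝒰 = (ϕ/(n-1)) I` (`eq_smul_one_of_sq_trace_eq`), the Riccati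
equation then gives `ℛ`, and `(𝒜/sinh t)' = 0` with `𝒜/sinh t → I` gives `𝒜`.
[cite: LiQingShi2017, Thm. 1.7 and Thm. 1.8 (proof, Steps 1–2, pp. 12–13)]
[cite: Chavel2006, Thm. III.4.3 (equality discussion)] -/
theorem jacobi_rigidity_sinh [Nonempty ι] {A A' R : ℝ → Matrix ι ι ℝ} {a b : ℝ}
    (h0 : (0 : ℝ) ∈ Ioo a b)
    (hA : ∀ t ∈ Ioo a b, HasDerivAt A (A' t) t)
    (hA' : ∀ t ∈ Ioo a b, HasDerivAt A' (-(R t * A t)) t)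
    (hR : ∀ t ∈ Ioo a b, (R t).IsSymm) (hA0 : A 0 = 0) (hA'0 : A' 0 = 1)
    (hdet : ∀ t ∈ Ioo 0 b, (A t).det ≠ 0)
    (hRic : ∀ t ∈ Ioo 0 b, -(Fintype.card ι : ℝ) ≤ (R t).trace)
    (heq : ∀ t ∈ Ioo 0 b, (A t).det = Real.sinh t ^ Fintype.card ι) :
    ∀ t ∈ Ioo 0 b, A' t * (A t)⁻¹ = (Real.cosh t / Real.sinh t) • (1 : Matrix ι ι ℝ) ∧
      R t = -1 ∧ A t = Real.sinh t • (1 : Matrix ι ι ℝ) := by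
  set m : ℕ := Fintype.card ι with hm
  have hm1 : 1 ≤ m := Fintype.card_pos
  have hmR : (0 : ℝ) < m := by exact_mod_cast Fintype.card_pos
  have hab : ∀ t ∈ Ioo 0 b, t ∈ Ioo a b := fun t ht ↦ ⟨h0.1.trans ht.1, ht.2⟩
  have hunit : ∀ t ∈ Ioo 0 b, IsUnit (A t).det := fun t ht ↦ isUnit_iff_ne_zero.2 (hdet t ht)
  have hW := jacobi_wronskian_eq_zero h0 hA hA' hR hA0
  have hUsymm : ∀ t ∈ Ioo 0 b, (A' t * (A t)⁻¹).IsSymm := fun t ht ↦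
    isSymm_mul_inv_of_wronskian_eq_zero (hW t (hab t ht)) (hunit t ht)
  have hsinh : ∀ t ∈ Ioo 0 b, 0 < Real.sinh t := fun t ht ↦ Real.sinh_pos_iff.2 ht.1
  have hnhd : ∀ t ∈ Ioo 0 b, Ioo 0 b ∈ 𝓝 t := fun t ht ↦ Ioo_mem_nhds ht.1 ht.2
  set U : ℝ → Matrix ι ι ℝ := fun t ↦ A' t * (A t)⁻¹ with hU_def
  -- Step 1: `ϕ = tr 𝒰 = m coth t`
  have hφ : ∀ t ∈ Ioo 0 b, (U t).trace = m * (Real.cosh t / Real.sinh t) := by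
    intro t ht
    have h1 := hasDerivAt_det_jacobi (hA t (hab t ht)) (hdet t ht)
    have h2 : HasDerivAt (fun s ↦ (A s).det) (m * Real.sinh t ^ (m - 1) * Real.cosh t) t := by
      have h := (Real.hasDerivAt_sinh t).pow m
      refine h.congr_of_eventuallyEq ?_
      filter_upwards [hnhd t ht] with s hs
      simp only [Pi.pow_apply]
      exact heq s hs
    have h3 := h1.unique h2
    rw [heq t ht] at h3
    have hs := hsinh t ht
    have hpow : Real.sinh t ^ m = Real.sinh t ^ (m - 1) * Real.sinh t := by
      conv_lhs => rw [← Nat.sub_add_cancel hm1, pow_succ]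
    rw [hpow] at h3
    have h5 : ((A' t * (A t)⁻¹).trace * Real.sinh t - m * Real.cosh t) *
        Real.sinh t ^ (m - 1) = 0 := by linear_combination h3
    have h4 : (A' t * (A t)⁻¹).trace * Real.sinh t = m * Real.cosh t := by
      rcases mul_eq_zero.1 h5 with h6 | h6
      · linarith
      · exact absurd h6 (pow_ne_zero _ hs.ne')
    show (A' t * (A t)⁻¹).trace = m * (Real.cosh t / Real.sinh t)
    rw [show (m : ℝ) * (Real.cosh t / Real.sinh t) = m * Real.cosh t / Real.sinh t by ring,
      eq_div_iff hs.ne']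
    exact h4
  -- Step 2: the traced Riccati equation forces equality in Cauchy–Schwarz and in `Ric ≥ -m`
  have hequal : ∀ t ∈ Ioo 0 b, (m : ℝ) * (U t * U t).trace = (U t).trace ^ 2 ∧
      (R t).trace = -m := by
    intro t ht
    have hd1 := hasDerivAt_trace_shape (hA t (hab t ht)) (hA' t (hab t ht)) (hunit t ht)
    have hd2 : HasDerivAt (fun s ↦ (A' s * (A s)⁻¹).trace)
        (m * ((Real.sinh t * Real.sinh t - Real.cosh t * Real.cosh t) / Real.sinh t ^ 2)) t := by
      have h := ((Real.hasDerivAt_cosh t).div (Real.hasDerivAt_sinh t)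
        (hsinh t ht).ne').const_mul (m : ℝ)
      refine h.congr_of_eventuallyEq ?_
      filter_upwards [hnhd t ht] with s hs
      exact hφ s hs
    have h3 := hd1.unique hd2
    have hcs := sq_trace_le_card_mul_trace_mul_self (hUsymm t ht)
    have hric := hRic t ht
    have hs := (hsinh t ht).ne'
    have hφt := hφ t ht
    have hid : Real.cosh t ^ 2 - Real.sinh t ^ 2 = 1 := Real.cosh_sq_sub_sinh_sq t
    -- `-tr R - tr U² = -m/sinh²` while `tr U² ≥ m coth²`, `tr R ≥ -m`
    have hval : -(R t).trace - (U t * U t).trace = -m / Real.sinh t ^ 2 := by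
      simp only [hU_def] at h3 ⊢
      rw [h3]; field_simp; nlinarith [hid]
    have hU2 : (m : ℝ) * (Real.cosh t / Real.sinh t) ^ 2 ≤ (U t * U t).trace := by
      have this : (U t).trace ^ 2 ≤ m * (U t * U t).trace := by
        have h' := hcs; rw [← hm] at h'; exact h'
      rw [hφt] at this
      nlinarith
    have hkey : (m : ℝ) * (Real.cosh t / Real.sinh t) ^ 2 - m = m / Real.sinh t ^ 2 := by
      field_simp; nlinarith [hid]
    have htrU2 : (U t * U t).trace = m * (Real.cosh t / Real.sinh t) ^ 2 := by
      have hq : -(m : ℝ) / Real.sinh t ^ 2 = -(m / Real.sinh t ^ 2) := by ring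
      rw [hq] at hval
      linarith
    constructor
    · rw [hφt, htrU2]; ring
    · have hq : -(m : ℝ) / Real.sinh t ^ 2 = -(m / Real.sinh t ^ 2) := by ring
      rw [hq] at hval
      linarith
  -- Step 3: `𝒰 = coth · I`
  have hUeq : ∀ t ∈ Ioo 0 b, U t = (Real.cosh t / Real.sinh t) • (1 : Matrix ι ι ℝ) := by
    intro t ht
    have h := eq_smul_one_of_sq_trace_eq (hUsymm t ht) (by rw [← hm]; exact (hequal t ht).1)
    have hφt := hφ t ht
    simp only [hU_def] at hφt
    rw [hφt] at h
    have hc : ((m : ℝ) * (Real.cosh t / Real.sinh t) / (Fintype.card ι : ℝ)) =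
        Real.cosh t / Real.sinh t := by
      rw [← hm]; field_simp
    rw [hc] at h
    exact h
  -- Step 4: `ℛ = -I` from the Riccati equation
  have hReq : ∀ t ∈ Ioo 0 b, R t = -1 := by
    intro t ht
    have hd1 := hasDerivAt_shape_riccati (hA t (hab t ht)) (hA' t (hab t ht)) (hunit t ht)
    have hd2 : HasDerivAt (fun s ↦ A' s * (A s)⁻¹)
        (((Real.sinh t * Real.sinh t - Real.cosh t * Real.cosh t) / Real.sinh t ^ 2) •
          (1 : Matrix ι ι ℝ)) t := by
      have h := ((Real.hasDerivAt_cosh t).div (Real.hasDerivAt_sinh t) (hsinh t ht).ne').smul_const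
        (1 : Matrix ι ι ℝ)
      refine h.congr_of_eventuallyEq ?_
      filter_upwards [hnhd t ht] with s hs
      exact hUeq s hs
    have h3 := hd1.unique hd2
    have hUt := hUeq t ht
    simp only [hU_def] at hUt
    rw [hUt, smul_mul_smul_comm, Matrix.one_mul] at h3
    have hs := (hsinh t ht).ne'
    have hid : Real.cosh t ^ 2 - Real.sinh t ^ 2 = 1 := Real.cosh_sq_sub_sinh_sq t
    have hcoef : (Real.sinh t * Real.sinh t - Real.cosh t * Real.cosh t) / Real.sinh t ^ 2 +
        Real.cosh t / Real.sinh t * (Real.cosh t / Real.sinh t) = 1 := by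
      field_simp; nlinarith [hid]
    -- `-R - coth² I = coth' I` ⇒ `R = -(coth' + coth²) I = -I`
    have : R t = -(((Real.sinh t * Real.sinh t - Real.cosh t * Real.cosh t) / Real.sinh t ^ 2 +
        Real.cosh t / Real.sinh t * (Real.cosh t / Real.sinh t)) • (1 : Matrix ι ι ℝ)) := by
      rw [add_smul, ← h3]; abel
    rw [this, hcoef, one_smul]
  -- Step 5: `𝒜 = sinh · I` : `B = (sinh)⁻¹ 𝒜` has zero derivative and tends to `I` at `0`
  have hA'eq : ∀ t ∈ Ioo 0 b, A' t = (Real.cosh t / Real.sinh t) • A t := by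
    intro t ht
    have hUt := hUeq t ht
    simp only [hU_def] at hUt
    calc A' t = A' t * (A t)⁻¹ * A t := by
          rw [Matrix.mul_assoc, Matrix.nonsing_inv_mul _ (hunit t ht), Matrix.mul_one]
      _ = (Real.cosh t / Real.sinh t) • A t := by rw [hUt, Matrix.smul_mul, Matrix.one_mul]
  set B : ℝ → Matrix ι ι ℝ := fun t ↦ (Real.sinh t)⁻¹ • A t with hB_def
  have hBd : ∀ t ∈ Ioo 0 b, HasDerivAt B (0 : Matrix ι ι ℝ) t := by
    intro t ht
    have hs := (hsinh t ht).ne'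
    have h1 : HasDerivAt (fun s ↦ (Real.sinh s)⁻¹) (-(Real.cosh t) / Real.sinh t ^ 2) t :=
      (Real.hasDerivAt_sinh t).inv hs
    have h := h1.smul (hA t (hab t ht))
    refine h.congr_deriv ?_
    rw [hA'eq t ht, smul_smul]
    have : (Real.sinh t)⁻¹ * (Real.cosh t / Real.sinh t) = -(-(Real.cosh t) / Real.sinh t ^ 2) := by
      field_simp
    rw [this, neg_smul, neg_add_cancel]
  have hBconst : ∀ s ∈ Ioo 0 b, ∀ t ∈ Ioo 0 b, B t = B s := by
    intro s hs t ht
    have key := (convex_Ioo 0 b).norm_image_sub_le_of_norm_hasDerivWithin_le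
      (fun x hx ↦ (hBd x hx).hasDerivWithinAt) (fun x _ ↦ norm_zero.le) hs ht
    rw [zero_mul, norm_le_zero_iff, sub_eq_zero] at key
    exact key
  have hBlim : Tendsto B (𝓝[>] 0) (𝓝 1) := by
    -- `B t = (t/sinh t) • (t⁻¹ • A t)` with `t⁻¹ • A t → A'(0) = I` and `t/sinh t → 1`
    have hslope : Tendsto (fun t ↦ t⁻¹ • A t) (𝓝[>] 0) (𝓝 1) := by
      have h1 := (hA 0 h0).tendsto_slope_zero_right
      simp only [hA0, hA'0, zero_add, sub_zero] at h1
      exact h1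
    have hsl : Tendsto (fun t : ℝ ↦ t⁻¹ * Real.sinh t) (𝓝[>] 0) (𝓝 1) := by
      have h1 := (Real.hasDerivAt_sinh 0).tendsto_slope_zero_right
      simp only [Real.sinh_zero, Real.cosh_zero, zero_add, sub_zero, smul_eq_mul] at h1
      exact h1
    have hinv : Tendsto (fun t : ℝ ↦ (t⁻¹ * Real.sinh t)⁻¹) (𝓝[>] 0) (𝓝 1) := by
      simpa using hsl.inv₀ one_ne_zero
    have hprod := hinv.smul hslope
    rw [one_smul] at hprod
    refine hprod.congr' ?_
    filter_upwards [self_mem_nhdsWithin] with t ht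
    have ht0 : (t : ℝ) ≠ 0 := ne_of_gt ht
    have hst : Real.sinh t ≠ 0 := (Real.sinh_pos_iff.2 ht).ne'
    show (t⁻¹ * Real.sinh t)⁻¹ • (t⁻¹ • A t) = (Real.sinh t)⁻¹ • A t
    rw [smul_smul]
    congr 1
    field_simp
  intro t ht
  have hBt : B t = 1 := by
    have h0b : (0 : ℝ) < b := ht.1.trans ht.2
    have hev : B =ᶠ[𝓝[>] 0] fun _ ↦ B t := by
      filter_upwards [Ioo_mem_nhdsGT h0b] with s hs
      exact (hBconst s hs t ht).symm
    have hconst : Tendsto (fun _ : ℝ ↦ B t) (𝓝[>] 0) (𝓝 1) := hBlim.congr' hev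
    exact tendsto_nhds_unique tendsto_const_nhds hconst
  refine ⟨hUeq t ht, hReq t ht, ?_⟩
  have hs := (hsinh t ht).ne'
  calc A t = Real.sinh t • B t := by
        simp only [hB_def, smul_smul, mul_inv_cancel₀ hs, one_smul]
    _ = Real.sinh t • (1 : Matrix ι ι ℝ) := by rw [hBt]

/-- **Rigidity of Bishop's inequality along one geodesic, `κ = 0` (the flat equality case:
Step 1 of the proof of Thm. 1.8, "`Vol(Γ_t, g_∞) = Vol(Γ_t, g_E)` for all `t > 0`, which implies
that `(X_∞, g_∞)` is isometric to the Euclidean space").** Along a solution of `𝒜'' + ℛ𝒜 = 0`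
(`𝒜(0) = 0`, `𝒜'(0) = I`, `ℛ` symmetric, no conjugate point on `(0, b)`) with
`Ric = tr ℛ ≥ 0`, if `det 𝒜(t) = t^{n-1}` on `(0, b)` (equality in `det 𝒜 ≤ t^{n-1}`,
`jacobi_det_le_pow`), then on `(0, b)`: `𝒰 = t⁻¹ I`, `ℛ = 0` (all sectional curvatures
`K(·, γ') = 0`) and `𝒜 = t I`. [cite: LiQingShi2017, Thm. 1.8 (proof, Step 1, p. 13)]
[cite: Chavel2006, Thm. III.4.3 (equality discussion)] -/
theorem jacobi_rigidity_flat [Nonempty ι] {A A' R : ℝ → Matrix ι ι ℝ} {a b : ℝ}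
    (h0 : (0 : ℝ) ∈ Ioo a b)
    (hA : ∀ t ∈ Ioo a b, HasDerivAt A (A' t) t)
    (hA' : ∀ t ∈ Ioo a b, HasDerivAt A' (-(R t * A t)) t)
    (hR : ∀ t ∈ Ioo a b, (R t).IsSymm) (hA0 : A 0 = 0) (hA'0 : A' 0 = 1)
    (hdet : ∀ t ∈ Ioo 0 b, (A t).det ≠ 0)
    (hRic : ∀ t ∈ Ioo 0 b, 0 ≤ (R t).trace)
    (heq : ∀ t ∈ Ioo 0 b, (A t).det = t ^ Fintype.card ι) :
    ∀ t ∈ Ioo 0 b, A' t * (A t)⁻¹ = t⁻¹ • (1 : Matrix ι ι ℝ) ∧ R t = 0 ∧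
      A t = t • (1 : Matrix ι ι ℝ) := by
  set m : ℕ := Fintype.card ι with hm
  have hm1 : 1 ≤ m := Fintype.card_pos
  have hmR : (0 : ℝ) < m := by exact_mod_cast Fintype.card_pos
  have hab : ∀ t ∈ Ioo 0 b, t ∈ Ioo a b := fun t ht ↦ ⟨h0.1.trans ht.1, ht.2⟩
  have hunit : ∀ t ∈ Ioo 0 b, IsUnit (A t).det := fun t ht ↦ isUnit_iff_ne_zero.2 (hdet t ht)
  have hW := jacobi_wronskian_eq_zero h0 hA hA' hR hA0
  have hUsymm : ∀ t ∈ Ioo 0 b, (A' t * (A t)⁻¹).IsSymm := fun t ht ↦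
    isSymm_mul_inv_of_wronskian_eq_zero (hW t (hab t ht)) (hunit t ht)
  have hnhd : ∀ t ∈ Ioo 0 b, Ioo 0 b ∈ 𝓝 t := fun t ht ↦ Ioo_mem_nhds ht.1 ht.2
  set U : ℝ → Matrix ι ι ℝ := fun t ↦ A' t * (A t)⁻¹ with hU_def
  -- Step 1: `ϕ = tr 𝒰 = m/t`
  have hφ : ∀ t ∈ Ioo 0 b, (U t).trace = m / t := by
    intro t ht
    have ht0 : (t : ℝ) ≠ 0 := ht.1.ne'
    have h1 := hasDerivAt_det_jacobi (hA t (hab t ht)) (hdet t ht)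
    have h2 : HasDerivAt (fun s ↦ (A s).det) (m * t ^ (m - 1) * 1) t := by
      have h := (hasDerivAt_id' t).pow m
      refine h.congr_of_eventuallyEq ?_
      filter_upwards [hnhd t ht] with s hs
      exact heq s hs
    have h3 := h1.unique h2
    rw [heq t ht] at h3
    have hpow : t ^ m = t ^ (m - 1) * t := by
      conv_lhs => rw [← Nat.sub_add_cancel hm1, pow_succ]
    rw [hpow] at h3
    have h5 : ((A' t * (A t)⁻¹).trace * t - m) * t ^ (m - 1) = 0 := by linear_combination h3
    have h4 : (A' t * (A t)⁻¹).trace * t = m := by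
      rcases mul_eq_zero.1 h5 with h6 | h6
      · linarith
      · exact absurd h6 (pow_ne_zero _ ht0)
    show (A' t * (A t)⁻¹).trace = m / t
    rw [eq_div_iff ht0]
    exact h4
  -- Step 2: equality in Cauchy–Schwarz and in `Ric ≥ 0`
  have hequal : ∀ t ∈ Ioo 0 b, (m : ℝ) * (U t * U t).trace = (U t).trace ^ 2 ∧
      (R t).trace = 0 := by
    intro t ht
    have ht0 : (t : ℝ) ≠ 0 := ht.1.ne'
    have hd1 := hasDerivAt_trace_shape (hA t (hab t ht)) (hA' t (hab t ht)) (hunit t ht)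
    have hd2 : HasDerivAt (fun s ↦ (A' s * (A s)⁻¹).trace) (m * (-(t ^ 2)⁻¹)) t := by
      have h := (hasDerivAt_inv ht0).const_mul (m : ℝ)
      refine h.congr_of_eventuallyEq ?_
      filter_upwards [hnhd t ht] with s hs
      rw [hφ s hs, div_eq_mul_inv]
    have h3 := hd1.unique hd2
    have hcs := sq_trace_le_card_mul_trace_mul_self (hUsymm t ht)
    have hric := hRic t ht
    have hφt := hφ t ht
    have hval : -(R t).trace - (U t * U t).trace = -(m / t ^ 2) := by
      simp only [hU_def] at h3 ⊢
      rw [h3]; field_simp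
    have hU2 : (m : ℝ) / t ^ 2 ≤ (U t * U t).trace := by
      have this : (U t).trace ^ 2 ≤ m * (U t * U t).trace := by
        have h' := hcs; rw [← hm] at h'; exact h'
      rw [hφt] at this
      have hmt : (m : ℝ) / t ^ 2 * m = (m / t) ^ 2 := by field_simp
      nlinarith
    have htrU2 : (U t * U t).trace = m / t ^ 2 := by linarith
    constructor
    · rw [hφt, htrU2]; field_simp
    · linarith
  -- Step 3: `𝒰 = t⁻¹ I`
  have hUeq : ∀ t ∈ Ioo 0 b, U t = t⁻¹ • (1 : Matrix ι ι ℝ) := by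
    intro t ht
    have ht0 : (t : ℝ) ≠ 0 := ht.1.ne'
    have h := eq_smul_one_of_sq_trace_eq (hUsymm t ht) (by rw [← hm]; exact (hequal t ht).1)
    have hφt := hφ t ht
    simp only [hU_def] at hφt
    rw [hφt] at h
    have hc : ((m : ℝ) / t / (Fintype.card ι : ℝ)) = t⁻¹ := by
      rw [← hm]; field_simp
    rw [hc] at h
    exact h
  -- Step 4: `ℛ = 0`
  have hReq : ∀ t ∈ Ioo 0 b, R t = 0 := by
    intro t ht
    have ht0 : (t : ℝ) ≠ 0 := ht.1.ne'
    have hd1 := hasDerivAt_shape_riccati (hA t (hab t ht)) (hA' t (hab t ht)) (hunit t ht)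
    have hd2 : HasDerivAt (fun s ↦ A' s * (A s)⁻¹) ((-(t ^ 2)⁻¹) • (1 : Matrix ι ι ℝ)) t := by
      have h := (hasDerivAt_inv ht0).smul_const (1 : Matrix ι ι ℝ)
      refine h.congr_of_eventuallyEq ?_
      filter_upwards [hnhd t ht] with s hs
      exact hUeq s hs
    have h3 := hd1.unique hd2
    have hUt := hUeq t ht
    simp only [hU_def] at hUt
    rw [hUt, smul_mul_smul_comm, Matrix.one_mul] at h3
    have hcoef : -(t ^ 2)⁻¹ + t⁻¹ * t⁻¹ = (0 : ℝ) := by field_simp; ring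
    have : R t = -((-(t ^ 2)⁻¹ + t⁻¹ * t⁻¹) • (1 : Matrix ι ι ℝ)) := by
      rw [add_smul, ← h3]; abel
    rw [this, hcoef, zero_smul, neg_zero]
  -- Step 5: `𝒜 = t I`
  have hA'eq : ∀ t ∈ Ioo 0 b, A' t = t⁻¹ • A t := by
    intro t ht
    have hUt := hUeq t ht
    simp only [hU_def] at hUt
    calc A' t = A' t * (A t)⁻¹ * A t := by
          rw [Matrix.mul_assoc, Matrix.nonsing_inv_mul _ (hunit t ht), Matrix.mul_one]
      _ = t⁻¹ • A t := by rw [hUt, Matrix.smul_mul, Matrix.one_mul]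
  set B : ℝ → Matrix ι ι ℝ := fun t ↦ t⁻¹ • A t with hB_def
  have hBd : ∀ t ∈ Ioo 0 b, HasDerivAt B (0 : Matrix ι ι ℝ) t := by
    intro t ht
    have ht0 : (t : ℝ) ≠ 0 := ht.1.ne'
    have h := (hasDerivAt_inv ht0).smul (hA t (hab t ht))
    refine h.congr_deriv ?_
    rw [hA'eq t ht, smul_smul]
    have : t⁻¹ * t⁻¹ = -(-(t ^ 2)⁻¹ : ℝ) := by field_simp
    rw [this, neg_smul, neg_add_cancel]
  have hBconst : ∀ s ∈ Ioo 0 b, ∀ t ∈ Ioo 0 b, B t = B s := by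
    intro s hs t ht
    have key := (convex_Ioo 0 b).norm_image_sub_le_of_norm_hasDerivWithin_le
      (fun x hx ↦ (hBd x hx).hasDerivWithinAt) (fun x _ ↦ norm_zero.le) hs ht
    rw [zero_mul, norm_le_zero_iff, sub_eq_zero] at key
    exact key
  have hBlim : Tendsto B (𝓝[>] 0) (𝓝 1) := by
    have h1 := (hA 0 h0).tendsto_slope_zero_right
    simp only [hA0, hA'0, zero_add, sub_zero] at h1
    exact h1
  intro t ht
  have hBt : B t = 1 := by
    have h0b : (0 : ℝ) < b := ht.1.trans ht.2
    have hev : B =ᶠ[𝓝[>] 0] fun _ ↦ B t := by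
      filter_upwards [Ioo_mem_nhdsGT h0b] with s hs
      exact (hBconst s hs t ht).symm
    have hconst : Tendsto (fun _ : ℝ ↦ B t) (𝓝[>] 0) (𝓝 1) := hBlim.congr' hev
    exact tendsto_nhds_unique tendsto_const_nhds hconst
  refine ⟨hUeq t ht, hReq t ht, ?_⟩
  have ht0 : (t : ℝ) ≠ 0 := ht.1.ne'
  calc A t = t • B t := by
        simp only [hB_def, smul_smul, mul_inv_cancel₀ ht0, one_smul]
    _ = t • (1 : Matrix ι ι ℝ) := by rw [hBt]

end Rigidity

/-! ### §K. Prop. 6.5 and Prop. 6.7 straight from the two-sided curvature decay along the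
Jacobi tensor (all constants explicit)

The hypotheses of §F (`μ_M ≤ M`, `K ≤ -(1 - δ/2)²`, `K ≥ -a²`, `𝒥' = H𝒥`, `𝒥 > 0`) derived
once and for all from the raw data of the printed proof: a Jacobi tensor along a minimal geodesic
(`𝒜'' + ℛ𝒜 = 0`, `𝒜(0) = 0`, `𝒜'(0) = I`, no conjugate point before `c`) with the two-sided
decay (1.9)/(6.2) `(1 - C₀e^{-2t})|v|² ≤ -⟨ℛ(t)v, v⟩ ≤ (1 + C₀e^{-2t})|v|²` on `(0, c)`, and a
time `T₀ ≥ 1` from which on `C(t+1)e^{-2t} ≤ δ/(4(n-2))` and `C₀e^{-2t} ≤ δ(1 - δ/4)` (the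
paper's `t_δ`; `exists_T₀_of_pinching`). Here `C = max (e²(a coth a - 1)) C₀`, `a = √(1 + C₀)`,
is the constant of Cor. 6.2 with `t₀ = 1` (`rayleigh_shape_le_one_add`). -/

section RawPinching

open scoped Matrix.Norms.Operator

variable {ι : Type*} [Fintype ι] [DecidableEq ι]

omit [DecidableEq ι] in
/-- **The choice of `t_δ` for the raw constants** (`m = #ι ≥ 2`, `0 < δ < 4`): there is `T₀ ≥ 1`
with `C(t+1)e^{-2t} ≤ δ/(4(m-1))` and `C₀e^{-2t} ≤ δ(1 - δ/4)` for all `t ≥ T₀`, where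
`C = max (e²(a coth a - 1)) C₀`, `a = √(1 + C₀)`. [cite: LiQingShi2017, §6.2 (before Lemma 6.4)] -/
theorem exists_T₀_of_pinching {C₀ δ : ℝ} (hC₀ : 0 ≤ C₀) (hδ0 : 0 < δ) (hδ4 : δ < 4)
    (hm2 : 2 ≤ Fintype.card ι) :
    ∃ T₀ : ℝ, 1 ≤ T₀ ∧ ∀ t, T₀ ≤ t →
      max (Real.exp (2 * 1) * (Real.sqrt (1 + C₀) *
          (Real.cosh (Real.sqrt (1 + C₀) * 1) / Real.sinh (Real.sqrt (1 + C₀) * 1)) - 1)) C₀ *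
        ((t + 1) * Real.exp (-2 * t)) ≤ δ / (4 * ((Fintype.card ι : ℝ) - 1)) ∧
      C₀ * Real.exp (-2 * t) ≤ δ * (1 - δ / 4) := by
  have hm : (2 : ℝ) ≤ Fintype.card ι := by exact_mod_cast hm2
  refine exists_tδ (le_max_of_le_right hC₀) hC₀ (div_pos hδ0 (by linarith)) (by nlinarith)

/-- **The hypotheses of §F from the raw decay.** Along a Jacobi tensor with the two-sided decay on
`(0, c)` and for `1 ≤ T₀`, `T < c` with the two `t_δ`-conditions from `T₀` on, on `[T₀, T]`:
`𝒰 = 𝒜'𝒜⁻¹` is a symmetric solution of `𝒰' = -ℛ - 𝒰²`; `K ≤ -(1 - δ/2)²`; every Rayleigh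
quotient of `𝒰` is `≤ M = 1 + δ/(4(m-1))` (Cor. 6.2 from `t₀ = 1`, `rayleigh_shape_le_one_add`);
`(det 𝒜)' = H det 𝒜` and `det 𝒜 > 0`. [cite: LiQingShi2017, §6.2] -/
theorem shape_hypotheses_of_pinching [Nonempty ι] {A A' R : ℝ → Matrix ι ι ℝ}
    {a₀ c C₀ δ T₀ T : ℝ} (hC₀ : 0 ≤ C₀) (hm2 : 2 ≤ Fintype.card ι)
    (h0 : (0 : ℝ) ∈ Ioo a₀ c)
    (hA : ∀ s ∈ Ioo a₀ c, HasDerivAt A (A' s) s)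
    (hA' : ∀ s ∈ Ioo a₀ c, HasDerivAt A' (-(R s * A s)) s)
    (hR : ∀ s ∈ Ioo a₀ c, (R s).IsSymm) (hRc : ContinuousAt R 0)
    (hA0 : A 0 = 0) (hA'0 : A' 0 = 1)
    (hdet : ∀ s ∈ Ioo 0 c, (A s).det ≠ 0)
    (hKlo : ∀ s ∈ Ioo 0 c, ∀ v : ι → ℝ,
      -(v ⬝ᵥ R s *ᵥ v) ≤ (1 + C₀ * Real.exp (-2 * s)) * (v ⬝ᵥ v))
    (hKhi : ∀ s ∈ Ioo 0 c, ∀ v : ι → ℝ,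
      (1 - C₀ * Real.exp (-2 * s)) * (v ⬝ᵥ v) ≤ -(v ⬝ᵥ R s *ᵥ v))
    (hT₀ : 1 ≤ T₀) (hTc : T < c)
    (hε₁ : ∀ s, T₀ ≤ s →
      max (Real.exp (2 * 1) * (Real.sqrt (1 + C₀) *
          (Real.cosh (Real.sqrt (1 + C₀) * 1) / Real.sinh (Real.sqrt (1 + C₀) * 1)) - 1)) C₀ *
        ((s + 1) * Real.exp (-2 * s)) ≤ δ / (4 * ((Fintype.card ι : ℝ) - 1)))
    (hε₂ : ∀ s, T₀ ≤ s → C₀ * Real.exp (-2 * s) ≤ δ * (1 - δ / 4)) :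
    (∀ τ ∈ Icc T₀ T, HasDerivAt (fun x ↦ A' x * (A x)⁻¹)
        (-(R τ) - (A' τ * (A τ)⁻¹) * (A' τ * (A τ)⁻¹)) τ) ∧
    (∀ τ ∈ Icc T₀ T, (A' τ * (A τ)⁻¹).IsSymm) ∧
    (∀ τ ∈ Icc T₀ T, ∀ v : ι → ℝ, (1 - δ / 2) ^ 2 * (v ⬝ᵥ v) ≤ -(v ⬝ᵥ R τ *ᵥ v)) ∧
    (∀ τ ∈ Icc T₀ T, ∀ v : ι → ℝ,
      v ⬝ᵥ (A' τ * (A τ)⁻¹) *ᵥ v ≤ (1 + δ / (4 * ((Fintype.card ι : ℝ) - 1))) * (v ⬝ᵥ v)) ∧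
    (∀ τ ∈ Icc T₀ T, HasDerivAt (fun x ↦ (A x).det)
      ((A' τ * (A τ)⁻¹).trace * (A τ).det) τ) ∧
    (∀ τ ∈ Icc T₀ T, 0 < (A τ).det) := by
  have hm : (2 : ℝ) ≤ Fintype.card ι := by exact_mod_cast hm2
  have hab : ∀ s ∈ Ioo 0 c, s ∈ Ioo a₀ c := fun s hs ↦ ⟨h0.1.trans hs.1, hs.2⟩
  have hsub : Icc T₀ T ⊆ Ioo 0 c := fun s hs ↦ ⟨by linarith [hs.1], hs.2.trans_lt hTc⟩
  have hunit : ∀ s ∈ Ioo 0 c, IsUnit (A s).det := fun s hs ↦ isUnit_iff_ne_zero.2 (hdet s hs)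
  have hW := jacobi_wronskian_eq_zero h0 hA hA' hR hA0
  have hUsymm : ∀ s ∈ Ioo 0 c, (A' s * (A s)⁻¹).IsSymm := fun s hs ↦
    isSymm_mul_inv_of_wronskian_eq_zero (hW s (hab s hs)) (hunit s hs)
  refine ⟨fun τ hτ ↦ hasDerivAt_shape_riccati (hA τ (hab τ (hsub hτ))) (hA' τ (hab τ (hsub hτ)))
      (hunit τ (hsub hτ)), fun τ hτ ↦ hUsymm τ (hsub hτ), fun τ hτ v ↦ ?_, fun τ hτ v ↦ ?_,
    fun τ hτ ↦ hasDerivAt_det_jacobi (hA τ (hab τ (hsub hτ))) (hdet τ (hsub hτ)),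
    fun τ hτ ↦ jacobi_det_pos h0 hA hA0 hA'0 hdet τ (hsub hτ)⟩
  · -- `K ≤ -(1 - δ/2)²` from `C₀e^{-2τ} ≤ δ(1 - δ/4)`
    have h1 := hKhi τ (hsub hτ) v
    have h2 := hε₂ τ hτ.1
    have h3 : (1 - δ / 2) ^ 2 ≤ 1 - C₀ * Real.exp (-2 * τ) := by nlinarith
    exact (mul_le_mul_of_nonneg_right h3 (dotProduct_self_nonneg' v)).trans h1
  · -- `μ_M ≤ M` from Cor. 6.2 with `t₀ = 1`
    by_cases hv : v = 0
    · simp [hv]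
    have hp : 0 < v ⬝ᵥ v := dotProduct_self_pos' hv
    have hq := rayleigh_shape_le_one_add hC₀ h0 hA hA' hR hRc hA0 hA'0 hdet hKlo one_pos
      (hT₀.trans hτ.1) (hτ.2.trans_lt hTc) hv
    have h2 := hε₁ τ hτ.1
    have h3 : (v ⬝ᵥ (A' τ * (A τ)⁻¹) *ᵥ v) / (v ⬝ᵥ v) ≤
        1 + δ / (4 * ((Fintype.card ι : ℝ) - 1)) := by
      refine hq.trans ?_
      have : max (Real.exp (2 * 1) * (Real.sqrt (1 + C₀) *
          (Real.cosh (Real.sqrt (1 + C₀) * 1) / Real.sinh (Real.sqrt (1 + C₀) * 1)) - 1)) C₀ *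
            (τ + 1) * Real.exp (-2 * τ) =
          max (Real.exp (2 * 1) * (Real.sqrt (1 + C₀) *
            (Real.cosh (Real.sqrt (1 + C₀) * 1) / Real.sinh (Real.sqrt (1 + C₀) * 1)) - 1)) C₀ *
            ((τ + 1) * Real.exp (-2 * τ)) := by ring
      rw [this]
      linarith
    rwa [div_le_iff₀ hp] at h3

/-- **Prop. 6.5 from the raw decay.** With the data of `shape_hypotheses_of_pinching` (`0 < δ < 1`)
and `T ∈ [T₀, c)`: if some direction has Rayleigh quotient `≤ 1 - 3δ/4` at time `T` (e.g.
`H(T) ≤ (n-1)(1-δ)`, `q ∈ U^δ_r`), then `det 𝒜(T) ≤ det 𝒜(T₀) e^{(m - δ/4)(T - T₀)}`.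
[cite: LiQingShi2017, Prop. 6.5 (6.15)] -/
theorem det_le_of_pinching [Nonempty ι] {A A' R : ℝ → Matrix ι ι ℝ}
    {a₀ c C₀ δ T₀ T : ℝ} (hC₀ : 0 ≤ C₀) (hm2 : 2 ≤ Fintype.card ι) (hδ0 : 0 < δ) (hδ1 : δ < 1)
    (h0 : (0 : ℝ) ∈ Ioo a₀ c)
    (hA : ∀ s ∈ Ioo a₀ c, HasDerivAt A (A' s) s)
    (hA' : ∀ s ∈ Ioo a₀ c, HasDerivAt A' (-(R s * A s)) s)
    (hR : ∀ s ∈ Ioo a₀ c, (R s).IsSymm) (hRc : ContinuousAt R 0)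
    (hA0 : A 0 = 0) (hA'0 : A' 0 = 1)
    (hdet : ∀ s ∈ Ioo 0 c, (A s).det ≠ 0)
    (hKlo : ∀ s ∈ Ioo 0 c, ∀ v : ι → ℝ,
      -(v ⬝ᵥ R s *ᵥ v) ≤ (1 + C₀ * Real.exp (-2 * s)) * (v ⬝ᵥ v))
    (hKhi : ∀ s ∈ Ioo 0 c, ∀ v : ι → ℝ,
      (1 - C₀ * Real.exp (-2 * s)) * (v ⬝ᵥ v) ≤ -(v ⬝ᵥ R s *ᵥ v))
    (hT₀ : 1 ≤ T₀) (hTT : T₀ ≤ T) (hTc : T < c)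
    (hε₁ : ∀ s, T₀ ≤ s →
      max (Real.exp (2 * 1) * (Real.sqrt (1 + C₀) *
          (Real.cosh (Real.sqrt (1 + C₀) * 1) / Real.sinh (Real.sqrt (1 + C₀) * 1)) - 1)) C₀ *
        ((s + 1) * Real.exp (-2 * s)) ≤ δ / (4 * ((Fintype.card ι : ℝ) - 1)))
    (hε₂ : ∀ s, T₀ ≤ s → C₀ * Real.exp (-2 * s) ≤ δ * (1 - δ / 4))
    (hend : ∃ v : ι → ℝ, v ≠ 0 ∧
      v ⬝ᵥ (A' T * (A T)⁻¹) *ᵥ v ≤ (1 - 3 * δ / 4) * (v ⬝ᵥ v)) :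
    (A T).det ≤ (A T₀).det * Real.exp ((Fintype.card ι - δ / 4) * (T - T₀)) := by
  obtain ⟨hU, hsymm, hRhi, hMq, hJ, hJpos⟩ := shape_hypotheses_of_pinching hC₀ hm2 h0 hA hA' hR
    hRc hA0 hA'0 hdet hKlo hKhi hT₀ hTc hε₁ hε₂
  have hm : (2 : ℝ) ≤ Fintype.card ι := by exact_mod_cast hm2
  have hMδ : ((Fintype.card ι : ℝ) - 1) * (1 + δ / (4 * ((Fintype.card ι : ℝ) - 1)) - 1) ≤ δ / 4 := by
    have hne : (Fintype.card ι : ℝ) - 1 ≠ 0 := by linarith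
    have : ((Fintype.card ι : ℝ) - 1) * (1 + δ / (4 * ((Fintype.card ι : ℝ) - 1)) - 1) = δ / 4 := by
      field_simp
      ring
    rw [this]
  exact jacobian_le_of_barrier (U := fun x ↦ A' x * (A x)⁻¹) (J := fun x ↦ (A x).det) hTT hδ0 hδ1
    hMδ hU hsymm hRhi hMq hJ (fun τ hτ ↦ (hJpos τ hτ).le) hend

/-- **Prop. 6.7 (6.17) from the raw decay.** With the data of `shape_hypotheses_of_pinching`
(`0 < δ < 1`) and `T₀ + 1 ≤ t < c`: if `H(t) ≤ -2(n-1)` then `H𝒥(t)` is bounded below by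
`-det 𝒜(T₀) e^{m²M}(m·a coth a + m²(m-1)M²) e^{(m-δ/4)(t-1-T₀)}` with `M = 1 + δ/(4(m-1))`,
`a = √(1 + C₀)` — all constants depending only on `n`, `δ`, `C₀` and `det 𝒜(T₀)`.
[cite: LiQingShi2017, Prop. 6.7 (6.17)] -/
theorem trace_mul_det_ge_of_pinching [Nonempty ι] {A A' R : ℝ → Matrix ι ι ℝ}
    {a₀ c C₀ δ T₀ t : ℝ} (hC₀ : 0 ≤ C₀) (hm2 : 2 ≤ Fintype.card ι) (hδ0 : 0 < δ) (hδ1 : δ < 1)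
    (h0 : (0 : ℝ) ∈ Ioo a₀ c)
    (hA : ∀ s ∈ Ioo a₀ c, HasDerivAt A (A' s) s)
    (hA' : ∀ s ∈ Ioo a₀ c, HasDerivAt A' (-(R s * A s)) s)
    (hR : ∀ s ∈ Ioo a₀ c, (R s).IsSymm) (hRc : ContinuousAt R 0)
    (hA0 : A 0 = 0) (hA'0 : A' 0 = 1)
    (hdet : ∀ s ∈ Ioo 0 c, (A s).det ≠ 0)
    (hKlo : ∀ s ∈ Ioo 0 c, ∀ v : ι → ℝ,
      -(v ⬝ᵥ R s *ᵥ v) ≤ (1 + C₀ * Real.exp (-2 * s)) * (v ⬝ᵥ v))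
    (hKhi : ∀ s ∈ Ioo 0 c, ∀ v : ι → ℝ,
      (1 - C₀ * Real.exp (-2 * s)) * (v ⬝ᵥ v) ≤ -(v ⬝ᵥ R s *ᵥ v))
    (hT₀ : 1 ≤ T₀) (ht : T₀ + 1 ≤ t) (htc : t < c)
    (hε₁ : ∀ s, T₀ ≤ s →
      max (Real.exp (2 * 1) * (Real.sqrt (1 + C₀) *
          (Real.cosh (Real.sqrt (1 + C₀) * 1) / Real.sinh (Real.sqrt (1 + C₀) * 1)) - 1)) C₀ *
        ((s + 1) * Real.exp (-2 * s)) ≤ δ / (4 * ((Fintype.card ι : ℝ) - 1)))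
    (hε₂ : ∀ s, T₀ ≤ s → C₀ * Real.exp (-2 * s) ≤ δ * (1 - δ / 4))
    (hH : (A' t * (A t)⁻¹).trace ≤ -2 * Fintype.card ι) :
    -((A T₀).det * Real.exp ((Fintype.card ι : ℝ) ^ 2 * (1 + δ / (4 * ((Fintype.card ι : ℝ) - 1)))) *
        (Fintype.card ι * (Real.sqrt (1 + C₀) * (1 + Real.exp (-2 * Real.sqrt (1 + C₀) * 1)) /
            (1 - Real.exp (-2 * Real.sqrt (1 + C₀) * 1))) +
          (Fintype.card ι : ℝ) ^ 2 * (Fintype.card ι - 1) *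
            (1 + δ / (4 * ((Fintype.card ι : ℝ) - 1))) ^ 2)) *
        Real.exp ((Fintype.card ι - δ / 4) * (t - 1 - T₀)) ≤
      (A' t * (A t)⁻¹).trace * (A t).det := by
  obtain ⟨hU, hsymm, hRhi, hMq, hJ, hJpos⟩ := shape_hypotheses_of_pinching hC₀ hm2 h0 hA hA' hR
    hRc hA0 hA'0 hdet hKlo hKhi hT₀ htc hε₁ hε₂
  have hm : (2 : ℝ) ≤ Fintype.card ι := by exact_mod_cast hm2
  have hM1 : (1 : ℝ) ≤ 1 + δ / (4 * ((Fintype.card ι : ℝ) - 1)) := by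
    have : 0 ≤ δ / (4 * ((Fintype.card ι : ℝ) - 1)) := div_nonneg hδ0.le (by linarith)
    linarith
  have hMδ : ((Fintype.card ι : ℝ) - 1) * (1 + δ / (4 * ((Fintype.card ι : ℝ) - 1)) - 1) ≤ δ / 4 := by
    have hne : (Fintype.card ι : ℝ) - 1 ≠ 0 := by linarith
    have : ((Fintype.card ι : ℝ) - 1) * (1 + δ / (4 * ((Fintype.card ι : ℝ) - 1)) - 1) = δ / 4 := by
      field_simp
      ring
    rw [this]
  have ha : 0 < Real.sqrt (1 + C₀) := Real.sqrt_pos.2 (by linarith)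
  have ha2 : Real.sqrt (1 + C₀) ^ 2 = 1 + C₀ := Real.sq_sqrt (by linarith)
  -- `K ≥ -a²` on `[t - 1, t]` from the lower decay
  have hRlo : ∀ τ ∈ Icc (t - 1) t, ∀ v : ι → ℝ,
      -(v ⬝ᵥ R τ *ᵥ v) ≤ Real.sqrt (1 + C₀) ^ 2 * (v ⬝ᵥ v) := by
    intro τ hτ v
    have hτ' : τ ∈ Ioo 0 c := ⟨by linarith [hτ.1], hτ.2.trans_lt htc⟩
    refine (hKlo τ hτ' v).trans (mul_le_mul_of_nonneg_right ?_ (dotProduct_self_nonneg' v))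
    rw [ha2]
    have : Real.exp (-2 * τ) ≤ 1 := Real.exp_le_one_iff.2 (by nlinarith [hτ'.1])
    nlinarith
  exact trace_mul_jacobian_ge (U := fun x ↦ A' x * (A x)⁻¹) (J := fun x ↦ (A x).det) ht hδ0 hδ1
    hM1 hMδ ha hU hsymm hRhi hRlo hMq hJ hJpos hH

end RawPinching

end AHRiccati

end Literature.Geometry.Riemannian
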